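import Summits.PneNP.PneNP.Theses.ConvexRankGates
import Literature.Computability.Complexity.ExtMonotoneCircuits
import Literature.Computability.Complexity.ExtMonotoneGRankSupport
import Literature.Computability.Complexity.CircuitComposition
import Literature.Computability.Complexity.NegationElimination
import Literature.Barriers.PneNP.MonotoneGapHolds
import Literature.Computability.Complexity.PseudoComplementCircuits
import Literature.Computability.Complexity.SliceFunctionsProofs
import Literature.Computability.Complexity.DeMorganSimulation
import Summits.PneNP.PneNP.Theorems.ConvexRankGatesCaptureDefs

/-!
# Disproof work file for the crux `Capture` (stmt-PneNP-2659, route PneNP/ConvexRankGates) — cycle 3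

Standing adversary (cdisprove) on
`Summit.PneNP.PneNP.Theses.ConvexRankGates.Capture`:
`∃ a, ∀ finite ι, ∀ MONOTONE f : (ι → Bool) → Bool, ∀ B₂-circuit C computing f,
 ∃ C' over B_N = {∧₂,∨₂} ∪ CONV_N ∪ PERM_N ∪ GRANK_N with ≤ N gates computing f`, `N = (|C| + |ι| + 2)^a`.

VERDICT SO FAR: **not refuted, not mis-stated.** `¬Capture` is a super-polynomial lower bound for an
explicit monotone P/poly family against circuits with LP/SDP-feasibility, permutation-group and
generic-rank gates — open even for ONE weak LP gate (Oliveira–Pudlák 2019, p. 3). The statement elaborates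
(rc 0), has no junk (constants = CONV gates `p = q = 0` / `p = 1, q = 0, b = -1`; `ι = ∅` and constant `f`
fine; every gate class realises only `2^{poly(n,s)}` functions by Warren / `(d!)^{n+1}` /
Rónyai–Babai–Ganapathy counting, so neither `Capture` nor its negation is trivial).

FINDINGS, as theorems (everything below is `sorry`-free; cycle-1 items re-derived because the cycle-1
file lives only in run/gate/evidence, which seats cannot read):

* §0 `capture_iff` — read-back: the inline `let Ext` IS `Literature…extGate`; `CaptureInto B` = the
  crux shape with target basis family `B` (the crux is `CaptureInto extGate`), monotone in `B`.
* §1 `capture_false_without_Monotone` — LOAD-BEARING: drop `Monotone f` and `x ↦ ¬x₀` kills it (the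
  extended basis is monotone by syntax, `Circuit.not_computes_bnot_of_isOver_extGate`).
* §2 `not_captureByMonotoneBasis` — LOAD-BEARING: the wide gates cannot be dropped; capture into
  `{∧₂,∨₂}` is a polynomial monotone-to-general transfer, refuted by the tree's PROVED Tardos gap
  (`Literature.Barriers.PneNP.not_monotoneTransfer_pow_holds`).
* §3 `no_zmod_primePow_embedding` — the PERM door AS TYPED: `Sym(d)` hosts an element of order `p^k`
  only if `p^k ≤ d` (cycle type), so `ℤ/2^k ↪̸ Sym(d)` for `d < 2^k`: the natural one-gate capture of
  the route's third-door candidate LIN-UNSAT over `ℤ/2^{n^ε}` needs `s ≥ 2^{n^ε}`. Obstructs the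
  homomorphic embedding ONLY (not a one-gate lower bound).
* §4 `grank_local`, `IsGRankGate.local`, `and_not_isGRankGate` — NEW (cycle 2): GRANK gates are LOCAL —
  every minterm of a `GRANK_s` gate has `≤ min θ d ≤ s` wires (affine-linear pencil ⇒ `θ`-minors have
  total degree `≤ θ`; Edmonds' support criterion `le_rank_symbolicMatrix_iff`). `∧_k ∉ GRANK_s` for
  `s < k`. For FIXED `d`, a GRANK gate of fan-in `k` is a DNF with `≤ (k+1)^d` terms.
* §5 `perm_local`, `IsPermGate.local` — NEW: PERM gates are LOCAL too — a minterm with `r` wires gives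
  a strict chain of `r` subgroups of `Sym(d)`, so `2^r ≤ d!`, `r ≤ log₂ d! < d log₂ d`. Hence in `B_s`
  ALL large-minterm power is convex (`∧_k ∈ CONV₁`), all non-convex power is `s log s`-local. Locality
  does NOT obstruct LIN-UNSAT(ℤ/2^k) as one PERM gate (its minterms have `≤ k(D+1)` rows): that one-gate
  question stays open.
* §6 `cktSize_allWires'`, `Circuit.rebase` — NEW, reusable by provers: gate-by-gate rebasing of
  straight-line programs (`1 + m·size` gates if every gate has an `m`-gate gadget over the new basis).
* §7 `cktSize_monotone_univ_fin` — NEW: monotone Shannon expansion, every monotone `k`-ary function has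
  a `{∧₂,∨₂,0,1}`-program of size `monoBound k = 3·2^k − 2`.
* §8 `not_captureBoundedFanIn` — NEW LOAD-BEARING: the strengthening "wide gates of fan-in `≤ k`" is
  FALSE for every `k` (rebasing + constant elimination + Tardos gap): any proof of `Capture` must use
  CONV/PERM/GRANK gates of UNBOUNDED fan-in.
* §9 `isConvGate_cnf`, `isConvGate_dnf`, `exists_size_one_of_dnf`, `exists_size_one_of_cnf`,
  `monotone_iff_exists_subset` — AUTOMATIC CASES (re-derived): a monotone CNF with `m` clauses is ONE CONV
  gate of width `m` (`q = 0`); a monotone DNF with `q` terms is ONE CONV gate of width `q·n + 1 + q`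
  (diagonal psd `Y`); so `Capture` holds with a size-ONE circuit whenever `#minterms·(n+1) + 1` or
  `#maxterms` is `≤ (t+n+2)^a` — a counterexample needs super-polynomially many minterms AND maxterms.

* §10 `cktSize_bigAnd`, `cktSize_bigOr`, `cktSize_dnf` — DNF builders over `{∧₂,∨₂,0,1}`.
* §11 `cktSize_of_wireLocal` — NEW: an `L`-local monotone map on `R` candidate wires has a
  `{∧₂,∨₂,0,1}`-program of size `localBound R L = (R+1)^L (L+2) + 1` (OR over accepted enumerations
  `Fin L → Option S` of the AND of the listed wires) — polynomial in `R` for fixed `L`.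
* §12 `not_captureFixedWidth` — NEW LOAD-BEARING: STRENGTHENING S₃ "PERM/GRANK gates of a FIXED width `s₀`
  (ANY fan-in) + `∧₂,∨₂` + CONV gates of fan-in `≤ k`" is FALSE for every `s₀, k`: every such gate is
  `(k + s₀! + s₀ + 2)`-local in positions (§4, §5), position-locality transfers to wire-locality by
  monotonicity (`wireLocal_of_posLocal`), so each gate is a polynomial DNF gadget; rebase, eliminate
  constants, Tardos gap. Hence the WIDTH of the linear-algebra gates PERM/GRANK must grow with `t + n`
  (or CONV gates of unbounded fan-in must do the work): the parameter `(t+n+2)^a` inside `Ext` is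
  load-bearing for PERM/GRANK too, not only through CONV.

* §13 `capture_iff_captureFin` — NORMAL FORM: `Capture` is equivalent to its restriction to `ι = Fin n`
  (transport along `Fintype.equivFin`; `CktSize.ofCircuit`, `Circuit.exists_rewire`), so provers may build the
  simulating circuit on `Fin n` and refuters may search there.

* §14 (cycle 3) `thr_six_two_isPermGate` — the order obstruction of §3 is NOT a one-gate lower bound:
  `Th₂⁶` (= LIN-UNSAT over `ℤ/P`, one unknown, six equations `y = b`, ANY prime `P ≥ 7`) is ONE PERM gate on
  `5` points — wire `i` switches on the `i`-th Sylow 5-subgroup of `A₅`, target a 3-cycle; PERM gates compute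
  by PAIRWISE GENERATION, non-homomorphically (`M₆ ↪ Sub(Sym 5)`). `IsBlockPermGate`,
  `IsBlockPermGate.exists_size_one` — several generators per wire cost nothing (one honest `PERM_s` gate
  reading wires repeatedly): the PERM door in semilattice normal form `v ↦ [τ ∈ ⨆_{vᵢ=1} Pᵢ]`.
  `IsBlockPermGate.two_pow_chain_le` — Myhill–Nerode chain invariant: `L` nested selections with pairwise
  distinguishable residuals force `2^L ≤ s!`; for LIN-UNSAT over `ℤ/2^k` residual chains have length
  `≤ k(D+1)`, so NO one-gate lower bound for the third door can come from chains/orders — it would need a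
  lattice-embedding (coordinatisation) obstruction for `Sub((ℤ/2^k)^3)` inside `Sub(Sym d)`, not in print.
* §15 (cycle 3) `captureSlice` — POSITIVE BOUNDARY: `Capture` restricted to SLICE functions is a THEOREM,
  with target basis `{∧₂,∨₂,0,1}` and no wide gate (Berkowitz 1982 / Jukna 2012 Thm 10.1, assembled from
  the tree's `CktSize.deMorgan_of_B2`, a new double-rail lemma `exists_doubleRail`, and
  `pseudoComplements_cktSize_holds`). With §9: a counterexample to the crux is a non-sliceable monotone
  P-function with super-polynomially many minterms AND maxterms.
* §16 (cycle 3) `PermCSP.not_sat_iff_bad` — TARGETS (Stub 3b of the picked line, the nonabelian door test):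
  for PERMUTATION constraints `h(dst j) = p_j(h(src j))` (all functional binary coset constraints over ANY
  group: holonomies, two-sided and automorphism-twisted diagonals; Unique-Games-type constraints) UNSAT of
  the selected system ⟺ `∃ x, ∀ a, ∃ a' ≠ a, (x,a) ~ (x,a')` in the cover graph — a positive combination of
  STCONN queries, monotone in the selection (`Bad.mono`), hence poly-size `{∧₂,∨₂}` and NO PERM gate. The
  door test therefore lives in RELATIONAL couplings through abelian sections twisted by the group (arity
  `≥ 3` / quotient couplings); over `S₃` these are sign-class-dependent `𝔽₃`-systems, for which the
  docstring of `PermCSP.not_sat_iff_bad` gives a 3-level ROADMAP (double cover + reachability-masked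
  `𝔽₃`-span gates + one `𝔽₂`-span gate; paper) — so the genuine first cases are the 2-groups `D₄`, `Q₈`.
* §17 (cycle 3) `PermCSP.exists_circuit_unsat` — the CIRCUIT for §16: UNSAT of a selected system of `m`
  permutation constraints on `nv` variables over a domain of size `nd` has a `{∧₂,∨₂,0,1}`-circuit of size
  `≤ (m + nv + nd + nv·nd + 2)^9` (`relax_card_iff`: Boolean reflexive–transitive closure in `card` rounds of
  relaxation; `PermCSP.cktSize_badB`). So the functional part of the (nonabelian) coset stratum is in
  monotone P outright — kernel-checked, no PERM gate.
* §18 (cycle 3) `doorD4` — the first genuine instance of the nonabelian door test as a Lean object: the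
  subgroup `{(x,y) : rotIdx y = 2·rotIdx x} ≤ D₄²` (order 16; `doorD4_not_functional`, `doorD4_couples_untied`):
  binary, relational, couples the `ℤ/4`-parts through the 2-torsion with reflection bits free.
  `doorGate nv` (UNSAT of the selected door constraints on `nv` variables, arity `64·nv²`) is an
  `IsNonabelianCosetGate s` gate of the line for `s ≥ 64·nv²` (`doorGate_isNonabelianCosetGate`): the
  proposed FIRST TARGET of `stub_cosetMeetToJoinNonabelian`.
* §19 (cycle 3) `capture_iff_captureNoN` — NORMAL FORM: the number of variables is cosmetic in the budget
  (`(t+n+2)^a ↦ (t+2)^a`): a `B₂`-circuit of size `t` reads `≤ 2t+1` variables (`card_readVars_le`,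
  `eval_mask`); capture on the read variables and transport back. Provers may assume `n ≤ 2t+1`.
* §20 (cycle 3) `ZMod.baer` / `ZMod.selfInjective` (`ℤ/n` is self-injective, via Baer and a gcd/Bézout
  divisibility transfer), `ZMod.exists_linearMap_apply_ne_zero` (nonzero elements of `ℤ/n`-modules are detected
  by functionals), `ZMod.not_exists_mulVec_eq_iff` — the FREDHOLM ALTERNATIVE over `ℤ/n`: `A y = b` unsolvable
  iff `∃ z, z A = 0 ∧ z·b ≠ 0` — and `linUnsat_iff_exists_mem_span` + `span_zmod_eq_closure`: LIN-UNSAT of a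
  selected system = `(0, c) ∈ ⟨selected augmented rows⟩` for some `c ≠ 0`, literally a PERM-gate condition in
  the regular representation of `(ℤ/m)^{D+1}` (the algebra of Stub 2 `stub_cyclicFredholm`, and of the
  third-door discussion §3/§14).

LANDED (tree, `Summits/PneNP/PneNP/Theorems/Capture/Negative/`, all accepted 2026-08-16): `LoadBearing.lean`
(§0–§2; p76013, commit 71421c717426), `GateLocality.lean` (§3–§5; p74960, 7c56066a553f), `BoundedFanIn.lean`
(§6–§8; p74967, 12465f7ed6f9), `FixedWidth.lean` (§10–§12; p76025, 7c7a24c8658e). Ideators / planners / the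
lead may `import Summits.PneNP.PneNP.Theorems.Capture.Negative.FixedWidth` (it pulls the other three).
PREPARED (cycle 3, folder of seat g3, each `lean check` rc0, proposals pending on gate availability):
`PermNormalForm.lean` (§14), `SliceCapture.lean` (§15), `PermConstraints.lean` (§16–§17).

WHY IT RESISTS (for ideators/provers). Every refutation route needs a lower bound against a basis that
contains, as single gates: all monotone real-weighted thresholds (CONV, `p = 1, q = 0`), all monotone
CNFs/DNFs of polynomially many clauses/terms (CONV, `q = 0` / diagonal `Y`), all monotone span programs
over every `𝔽_p` (PERM, `PermConsequences.abelianProgram_isPermGate`), bipartite/general matching and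
linear-matroid intersection (GRANK). The three candidate "third doors" on record — LIN-UNSAT over
`ℤ/2^{n^ε}` (passes A/C, §3), integer-lattice membership LAT (ideator-3 g2 card, set-dependent modulus),
LIN-UNSAT over `GF(q)` with `q = n^{ω(1)}` — are NOT known to lie outside poly-size `B_s`-CIRCUITS; only
their natural ONE-GATE captures are excluded (§3) or open (PQ: is `𝔽`-span membership a support shadow
of a poly-dimensional pencil, i.e. abelian PERM ⊆ one GRANK gate?). A Lean refutation therefore needs
new mathematics (a lower-bound method passing through LP/SDP, group and rank gates), not a search.
(CONV door: `{∧₂,∨₂} ∪ CONV_s`-circuits with `t` gates are ONE CONV gate of width `4(s+3)(t+n+1)²` —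
PROVED in the tree by the sibling seats, `Summit.PneNP.PneNP.Theorems.exists_oneConvGate_of_isOver`,
`Theorems/ConvexRankGatesConvexGateBlindCollapseMain.lean`; so on the convex side `¬Capture` is literally a
ONE-gate = psd-lift lower bound.)
CYCLE 3 adds (§14–§18): one-gate lower bounds for PERM cannot come from element orders or Myhill–Nerode chains
(`Th₂⁶ ∈ PERM₅`; chains give only `2^L ≤ s!`); the crux HOLDS on slice functions outright; inside the picked
line's nonabelian coset stratum everything functional is monotone-P (kernel-checked circuit), `S₃` should pass
by a 3-level masked-span construction (paper), and the first genuine door test is `D₄` with binary relational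
constraints through the 2-torsion (quadratic twists) — whose natural absorber, if any, is a genuinely nonabelian
(class-2) PERM gate. So the live candidates for `¬Capture` remain: LIN-UNSAT over `ℤ/2^{n^ε}` (outside the spine by
modulus), and — new — the `D₄`-coset family IF nonabelian PERM gates fail to absorb quadratic twists.

ON PAPER, NOT YET IN LEAN: (b) slice functions are captured with `{∧₂,∨₂} ∪ CONV₁` (Berkowitz pseudo-complements are threshold
gates, `thr_isConvGate`); (c) CONV gates with `O(1)` CONSTRAINTS `p` (any psd dimension, any fan-in) are
monotone functions of `p` non-negative linear forms of the wires, i.e. `(p+1)`-ary monotone REAL gates after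
`p` summation chains; if the fan-in reduction for monotone real circuits costs `n^{p-2}` as the route text
cites (HrubesPudlak2018 — not re-read this cycle, searchd was down), then "CONV with O(1) constraints"
is refuted for Tardos-type functions by the monotone-REAL-circuit bound of Jukna 2012 Thm 9.28, which the
tree vendors only in Boolean form (so at best a `--negative-modulo` lemma here).

Refuter seats cdisprove-stmt-PneNP-2659 gen 2 (cycle 2) and gen 3 (cycle 3, §14–§17), 2026-08-16. Cycle-1 evidence (same item):
run/gate/evidence/stmt-PneNP-2659/20260815T223608Z-Disproof.lean (47 decls, sorry-free; §4 ThirdDoor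
`linUnsat` + monotone projection onto XOR-UNSAT and §5 AutoCases live there).
-/

set_option linter.dupNamespace false

namespace Summit.PneNP.PneNP.Cruxes.Capture.Disproof

open Literature.Computability.Complexity Literature.Computability.Complexity.GateList
  Literature.Barriers.PneNP Filter Finset MvPolynomial
open Summit.PneNP.PneNP.Theses.ConvexRankGates (Capture)

/-! ## §0 Read-back: the inline `let Ext` of the crux is the Literature's `extGate` -/

/-- `Capture` with an arbitrary target basis family `B : ℕ → Set GateFn` and size budget: the common
shape of the crux (`B = extGate`) and of the strengthenings / mutations below. [folklore] -/
def CaptureInto (B : ℕ → Set GateFn) : Prop :=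
  ∃ a : ℕ, ∀ (ι : Type) (_ : Fintype ι) (f : (ι → Bool) → Bool), Monotone f →
    ∀ C : Circuit ι, C.IsOver B2 → C.Computes f →
      ∃ C' : Circuit ι, C'.IsOver (B ((C.size + Fintype.card ι + 2) ^ a)) ∧
        C'.size ≤ (C.size + Fintype.card ι + 2) ^ a ∧ C'.Computes f

/-- The inline gate class of the crux is `extGate s` (definitional up to `mem_extGate_iff`). [folklore] -/
theorem inlineExt_eq_extGate (s : ℕ) :
    ({g : GateFn | g = GateFn.and 2 ∨ g = GateFn.or 2 ∨ IsConvGate s g ∨ IsPermGate s g ∨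
      IsGRankGate s g}) = extGate s := by
  ext g; rw [mem_extGate_iff]; rfl

/-- **Read-back.** The crux `Capture` is `CaptureInto extGate`: every monotone `f` with a `B₂`-circuit of
size `t` on `n = |ι|` inputs has a circuit over `B_N = {∧₂,∨₂} ∪ CONV_N ∪ PERM_N ∪ GRANK_N` with at most
`N = (t+n+2)^a` gates, for one absolute exponent `a`. [folklore] -/
theorem capture_iff : Capture ↔ CaptureInto extGate := by
  unfold Capture CaptureInto
  simp only []
  constructor
  · rintro ⟨a, h⟩
    refine ⟨a, fun ι _ f hf C hB hC => ?_⟩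
    obtain ⟨C', h1, h2, h3⟩ := h ι _ f hf C hB hC
    refine ⟨C', ?_, h2, h3⟩
    rw [← inlineExt_eq_extGate]
    exact h1
  · rintro ⟨a, h⟩
    refine ⟨a, fun ι _ f hf C hB hC => ?_⟩
    obtain ⟨C', h1, h2, h3⟩ := h ι _ f hf C hB hC
    refine ⟨C', ?_, h2, h3⟩
    rw [← inlineExt_eq_extGate] at h1
    exact h1

/-- `CaptureInto` is monotone in the target basis family. [folklore] -/
theorem CaptureInto.mono {B B' : ℕ → Set GateFn} (h : CaptureInto B) (hBB' : ∀ s, B s ⊆ B' s) :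
    CaptureInto B' := by
  obtain ⟨a, h⟩ := h
  refine ⟨a, fun ι _ f hf C hB hC => ?_⟩
  obtain ⟨C', h1, h2, h3⟩ := h ι _ f hf C hB hC
  exact ⟨C', h1.mono (hBB' _), h2, h3⟩

/-! ## §1 The hypothesis `Monotone f` is load-bearing -/

/-- The crux with the hypothesis `Monotone f` DROPPED. [folklore] -/
def CaptureWithoutMonotone : Prop :=
  ∃ a : ℕ, ∀ (ι : Type) (_ : Fintype ι) (f : (ι → Bool) → Bool),
    ∀ C : Circuit ι, C.IsOver B2 → C.Computes f →
      ∃ C' : Circuit ι, C'.IsOver (extGate ((C.size + Fintype.card ι + 2) ^ a)) ∧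
        C'.size ≤ (C.size + Fintype.card ι + 2) ^ a ∧ C'.Computes f

/-- **Any proof of `Capture` must use `Monotone f`.** Without it the statement is false: `x ↦ ¬x₀` has a
`B₂`-circuit of size `1`, but every circuit over every `B_s`, of any size, computes a monotone function
(`Circuit.not_computes_bnot_of_isOver_extGate`: the extended basis is monotone BY SYNTAX). [folklore] -/
theorem capture_false_without_Monotone : ¬ CaptureWithoutMonotone := by
  rintro ⟨a, h⟩
  obtain ⟨C, hB, -, hC⟩ := (cktSize_not (ι := Fin 1) (0 : Fin 1)).toCircuit
  obtain ⟨C', h1, -, h3⟩ := h (Fin 1) inferInstance (fun x => !(x 0)) C hB (fun x => hC x)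
  exact C'.not_computes_bnot_of_isOver_extGate h1 0 h3

/-! ## §2 The wide gates are load-bearing: capture by `{∧₂, ∨₂}` alone is FALSE (Tardos gap) -/

/-- STRENGTHENING S₁ — capture WITHOUT wide gates: the simulating circuit is over the plain monotone basis
`{∧₂, ∨₂}`. [folklore] -/
def CaptureByMonotoneBasis : Prop := CaptureInto fun _ => monotoneBasis

/-- `#E(K_v) ≤ v²`. [folklore] -/
theorem card_edgeSet_top_le (v : ℕ) [Fintype ((⊤ : SimpleGraph (Fin v)).edgeSet)] :
    Fintype.card ((⊤ : SimpleGraph (Fin v)).edgeSet) ≤ v ^ 2 :=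
  calc Fintype.card ((⊤ : SimpleGraph (Fin v)).edgeSet)
      ≤ Fintype.card (Sym2 (Fin v)) := Fintype.card_le_of_injective Subtype.val Subtype.val_injective
    _ ≤ Fintype.card (Fin v × Fin v) :=
        Fintype.card_le_of_surjective (Sym2.mk (α := Fin v)).uncurry Sym2.mk_surjective
    _ = v ^ 2 := by simp [sq]

/-- Size bookkeeping: `t + v² + 2 ≤ (v + t)³` for `v ≥ 2`. [folklore] -/
theorem size_bookkeeping {v t : ℕ} (hv : 2 ≤ v) : t + v ^ 2 + 2 ≤ (v + t) ^ 3 := by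
  have h1 : v ^ 2 + 2 ≤ v ^ 3 := by nlinarith
  have h2 : v ^ 3 + t ≤ (v + t) ^ 3 := by
    have h3 : 1 ≤ 3 * v ^ 2 + 3 * v * t + t ^ 2 := by nlinarith
    calc v ^ 3 + t = v ^ 3 + t * 1 := by ring
      _ ≤ v ^ 3 + t * (3 * v ^ 2 + 3 * v * t + t ^ 2) := by gcongr
      _ = (v + t) ^ 3 := by ring
  omega

/-- **The strengthening "no wide gates" is FALSE**: `CaptureByMonotoneBasis` would be a polynomial
monotone-to-general transfer `(v + t)^{3a}`, refuted by the tree's PROVED Tardos gap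
(`Literature.Barriers.PneNP.not_monotoneTransfer_pow_holds`: Tardos 1988 / Jukna 2012 Thm. 9.28, via
Alon–Boppana and the GLS theta machine). So any proof of `Capture` must route some function through a CONV,
PERM or GRANK gate. [cite: Tardos1988] -/
theorem not_captureByMonotoneBasis : ¬ CaptureByMonotoneBasis := by
  rintro ⟨a, h⟩
  refine not_monotoneTransfer_pow_holds (3 * a) ?_
  filter_upwards [eventually_ge_atTop 2] with v hv f hf C hB hC
  obtain ⟨C', h1, h2, h3⟩ := h _ inferInstance f hf C (hB.mono deMorganBasis_subset_B2) hC
  calc circuitSizeOver monotoneBasis f ≤ C'.size := circuitSizeOver_le_of_computes C' h1 h3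
    _ ≤ (C.size + Fintype.card ((⊤ : SimpleGraph (Fin v)).edgeSet) + 2) ^ a := h2
    _ ≤ ((v + C.size) ^ 3) ^ a := by
        apply Nat.pow_le_pow_left
        have := card_edgeSet_top_le v
        have := size_bookkeeping (t := C.size) hv
        omega
    _ = (v + C.size) ^ (3 * a) := by rw [← pow_mul]

/-- Equivalently: `Capture` into ANY basis family contained in `{∧₂,∨₂}` is false; in particular the
wide part `CONV ∪ PERM ∪ GRANK` of `extGate` cannot be dropped. [folklore] -/
theorem not_captureInto_of_subset_monotoneBasis {B : ℕ → Set GateFn} (hB : ∀ s, B s ⊆ monotoneBasis) :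
    ¬ CaptureInto B := fun h => not_captureByMonotoneBasis (h.mono hB)

/-! ## §3 The PERM door as typed: `Sym(d)` hosts an element of order `p^k` only if `p^k ≤ d` -/

/-- A prime power dividing the `lcm` of a multiset of naturals divides a member. [folklore] -/
theorem exists_mem_prime_pow_dvd_of_dvd_lcm {p k : ℕ} (hp : p.Prime) (hk : 0 < k) :
    ∀ (s : Multiset ℕ), p ^ k ∣ s.lcm → ∃ a ∈ s, p ^ k ∣ a := by
  intro s
  induction s using Multiset.induction_on with
  | empty =>
    intro h
    rw [Multiset.lcm_zero] at h
    exact absurd (Nat.dvd_one.1 h) (ne_of_gt (Nat.one_lt_pow hk.ne' hp.one_lt))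
  | cons a s ih =>
    intro h
    rw [Multiset.lcm_cons] at h
    by_cases ha : a = 0
    · exact ⟨a, Multiset.mem_cons_self a s, ha ▸ dvd_zero _⟩
    by_cases hs : s.lcm = 0
    · obtain ⟨b, hb, hbd⟩ := ih (hs ▸ dvd_zero _)
      exact ⟨b, Multiset.mem_cons_of_mem hb, hbd⟩
    have hl : Nat.lcm a s.lcm ≠ 0 := Nat.lcm_ne_zero ha hs
    have hle := (hp.pow_dvd_iff_le_factorization hl).1 h
    rw [Nat.factorization_lcm ha hs, Finsupp.sup_apply] at hle
    rcases le_sup_iff.1 hle with h1 | h1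
    · exact ⟨a, Multiset.mem_cons_self a s, (hp.pow_dvd_iff_le_factorization ha).2 h1⟩
    · obtain ⟨b, hb, hbd⟩ := ih ((hp.pow_dvd_iff_le_factorization hs).2 h1)
      exact ⟨b, Multiset.mem_cons_of_mem hb, hbd⟩

/-- **Order obstruction.** If a prime power `p^k` (`k ≥ 1`) divides the order of a permutation of `d`
points then `p^k ≤ d`: `p^k` divides the `lcm` of the cycle type, hence some cycle length, and the cycle
lengths sum to at most `d`. [folklore] -/
theorem prime_pow_le_of_dvd_orderOf_perm {d p k : ℕ} (hp : p.Prime) (hk : 0 < k)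
    (σ : Equiv.Perm (Fin d)) (h : p ^ k ∣ orderOf σ) : p ^ k ≤ d := by
  rw [← Equiv.Perm.lcm_cycleType] at h
  obtain ⟨c, hc, hcd⟩ := exists_mem_prime_pow_dvd_of_dvd_lcm hp hk _ h
  have hcpos : 0 < c := lt_of_lt_of_le two_pos (Equiv.Perm.two_le_of_mem_cycleType hc)
  calc p ^ k ≤ c := Nat.le_of_dvd hcpos hcd
    _ ≤ σ.cycleType.sum := Multiset.le_sum_of_mem hc
    _ = σ.support.card := Equiv.Perm.sum_cycleType σ
    _ ≤ Fintype.card (Fin d) := Finset.card_le_univ _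
    _ = d := Fintype.card_fin d

/-- Hence a group embedding into `Sym(d)` an element of order `p^k` forces `p^k ≤ d`. [folklore] -/
theorem prime_pow_le_of_injective_hom {G : Type*} [Group G] {d p k : ℕ} (hp : p.Prime) (hk : 0 < k)
    (φ : G →* Equiv.Perm (Fin d)) (hφ : Function.Injective φ) (g : G) (hg : orderOf g = p ^ k) :
    p ^ k ≤ d :=
  prime_pow_le_of_dvd_orderOf_perm hp hk (φ g) (by rw [orderOf_injective φ hφ g, hg])

/-- **`ℤ/p^k` does not embed in `Sym(d)` for `d < p^k`.** This is the backbone of the third-door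
objection to the crux AS TYPED (route KILL CRITERIA; refuter passes A/C 2026-08-15): the natural one-gate
capture of LIN-UNSAT over `ℤ/2^k` (Fredholm: unsolvable iff `(0,…,0,2^{k-1})` lies in the additive subgroup
generated by the selected augmented rows) needs the group `(ℤ/2^k)^{D+1}` INSIDE a PERM gate, i.e. inside
`Sym(d)` with `d ≤ s`; for `k = n^ε` this forces `s ≥ 2^{n^ε}`. It obstructs the homomorphic embedding
only — a PERM gate is not required to act through a homomorphism of the row group, so this is NOT a lower
bound for LIN-UNSAT against one PERM gate (that one-gate question stays open; see §5 for why locality does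
not settle it either). [folklore] -/
theorem no_zmod_primePow_embedding {d p k : ℕ} (hp : p.Prime) (hk : 0 < k) (hd : d < p ^ k) :
    ¬ ∃ φ : Multiplicative (ZMod (p ^ k)) →* Equiv.Perm (Fin d), Function.Injective φ := by
  rintro ⟨φ, hφ⟩
  have h1 : orderOf (Multiplicative.ofAdd (1 : ZMod (p ^ k))) = p ^ k := by
    rw [orderOf_ofAdd_eq_addOrderOf, ZMod.addOrderOf_one]
  exact absurd (prime_pow_le_of_injective_hom hp hk φ hφ _ h1) (not_le.2 hd)

/-- The case of the route's candidate door: no `ℤ/2^k ↪ Sym(d)` when `d < 2^k`. [folklore] -/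
theorem no_zmod_two_pow_embedding {d k : ℕ} (hk : 0 < k) (hd : d < 2 ^ k) :
    ¬ ∃ φ : Multiplicative (ZMod (2 ^ k)) →* Equiv.Perm (Fin d), Function.Injective φ :=
  no_zmod_primePow_embedding Nat.prime_two hk hd

/-! ## §4 GRANK gates are LOCAL: every minterm of a GRANK gate of dimension `d` has at most `d` wires -/

section GRankLocal

variable {F : Type*} [Field F] {n d : ℕ}

/-- The entries of the generic symbolic matrix `K₀ + ∑ Xᵢ Kᵢ` are affine-linear in `X`. [folklore] -/
theorem totalDegree_symbolicPolyMatrix_apply_le (K₀ : Matrix (Fin d) (Fin d) F)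
    (K : Fin n → Matrix (Fin d) (Fin d) F) (a b : Fin d) :
    (symbolicPolyMatrix K₀ K a b).totalDegree ≤ 1 := by
  simp only [symbolicPolyMatrix, Matrix.add_apply, Matrix.map_apply, Matrix.sum_apply,
    Matrix.smul_apply, smul_eq_mul]
  refine (totalDegree_add _ _).trans (max_le ?_ ?_)
  · rw [totalDegree_C]; exact zero_le_one
  · refine (totalDegree_finsetSum _ _).trans (Finset.sup_le fun i _ => ?_)
    refine (totalDegree_mul _ _).trans ?_
    rw [totalDegree_X, totalDegree_C]

/-- Signs do not raise the total degree. [folklore] -/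
theorem totalDegree_units_smul_le (u : ℤˣ) (p : MvPolynomial (Fin n) F) :
    (u • p).totalDegree ≤ p.totalDegree := by
  rcases Int.units_eq_one_or u with rfl | rfl
  · rw [one_smul]
  · rw [Units.neg_smul, one_smul, totalDegree_neg]

/-- A determinant of affine-linear entries has total degree at most its order. [folklore] -/
theorem totalDegree_det_le {ι : Type*} [Fintype ι] [DecidableEq ι]
    (M : Matrix ι ι (MvPolynomial (Fin n) F)) (hM : ∀ a b, (M a b).totalDegree ≤ 1) :
    M.det.totalDegree ≤ Fintype.card ι := by
  rw [Matrix.det_apply]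
  refine (totalDegree_finsetSum _ _).trans (Finset.sup_le fun σ _ => ?_)
  refine (totalDegree_units_smul_le _ _).trans ?_
  refine (totalDegree_finsetProd _ _).trans ?_
  calc ∑ i, (M (σ i) i).totalDegree ≤ ∑ _i : ι, 1 := Finset.sum_le_sum fun i _ => hM _ _
    _ = Fintype.card ι := by simp

/-- The `θ × θ` minors of the generic symbolic matrix have total degree `≤ θ`. [folklore] -/
theorem totalDegree_minor_le (K₀ : Matrix (Fin d) (Fin d) F) (K : Fin n → Matrix (Fin d) (Fin d) F)
    {θ : ℕ} (r c : Fin θ → Fin d) :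
    (((symbolicPolyMatrix K₀ K).submatrix r c).det).totalDegree ≤ θ := by
  have := totalDegree_det_le ((symbolicPolyMatrix K₀ K).submatrix r c)
    fun a b => totalDegree_symbolicPolyMatrix_apply_le K₀ K (r a) (c b)
  simpa using this

/-- A monomial of `P` involves at most `totalDegree P` variables. [folklore] -/
theorem card_support_le_totalDegree {P : MvPolynomial (Fin n) F} {m : Fin n →₀ ℕ}
    (hm : m ∈ P.support) : m.support.card ≤ P.totalDegree := by
  refine le_trans ?_ (le_totalDegree hm)
  rw [Finsupp.sum, Finset.card_eq_sum_ones]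
  exact Finset.sum_le_sum fun i hi => Nat.one_le_iff_ne_zero.2 (Finsupp.mem_support_iff.1 hi)

/-- A non-vanishing `θ × θ` minor has distinct rows, so `θ ≤ d`. [folklore] -/
theorem le_of_minor_support_nonempty (K₀ : Matrix (Fin d) (Fin d) F)
    (K : Fin n → Matrix (Fin d) (Fin d) F) {θ : ℕ} (r c : Fin θ → Fin d) {m : Fin n →₀ ℕ}
    (hm : m ∈ (((symbolicPolyMatrix K₀ K).submatrix r c).det).support) : θ ≤ d := by
  have hr : Function.Injective r := by
    intro i j hij
    by_contra hne
    have h0 : ((symbolicPolyMatrix K₀ K).submatrix r c).det = 0 :=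
      Matrix.det_zero_of_row_eq hne (funext fun b => by simp [Matrix.submatrix_apply, hij])
    rw [h0, support_zero] at hm
    exact absurd hm (Finset.notMem_empty _)
  simpa using Fintype.card_le_of_injective r hr

/-- **GRANK locality (matrix form).** If the generic rank of `K₀ + ∑_{vᵢ=1} Xᵢ Kᵢ` is at least `θ`,
then already a sub-selection `t ⊆ {i | vᵢ = 1}` of AT MOST `min θ d` wires achieves rank `≥ θ`: a
non-vanishing `θ`-minor has a surviving monomial (Edmonds: `le_rank_symbolicMatrix_iff`), that monomial
has total degree `≤ θ` (affine-linear entries), and switching on exactly its variables keeps it.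
[folklore] -/
theorem grank_local (K₀ : Matrix (Fin d) (Fin d) F) (K : Fin n → Matrix (Fin d) (Fin d) F) (θ : ℕ)
    (v : Fin n → Bool) (h : θ ≤ (symbolicMatrix K₀ K v).rank) :
    ∃ t : Finset (Fin n), t.card ≤ θ ∧ t.card ≤ d ∧ (∀ i ∈ t, v i = true) ∧
      θ ≤ (symbolicMatrix K₀ K (fun i => decide (i ∈ t))).rank := by
  rw [le_rank_symbolicMatrix_iff] at h
  obtain ⟨r, c, m, hm, hv⟩ := h
  refine ⟨m.support, (card_support_le_totalDegree hm).trans (totalDegree_minor_le K₀ K r c),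
    (card_support_le_totalDegree hm).trans
      ((totalDegree_minor_le K₀ K r c).trans (le_of_minor_support_nonempty K₀ K r c hm)), hv, ?_⟩
  rw [le_rank_symbolicMatrix_iff]
  exact ⟨r, c, m, hm, fun i hi => by simpa using hi⟩

end GRankLocal

/-- **GRANK gates are `s`-local.** Every accepted input of a GRANK gate of size parameter `s` contains an
accepted sub-input with at most `s` wires switched on; equivalently every MINTERM of a `GRANK_s` gate has
at most `s` elements (in fact `≤ min θ d`). So a single GRANK gate computing a monotone `f` needs dimension
`d ≥` the largest minterm of `f` (`∧_k` needs `d ≥ k`; Edmonds' perfect-matching gate has `d = n` for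
minterms of size `n`), and for FIXED `d` a GRANK gate of fan-in `k` is a monotone DNF with `≤ (k+1)^d`
terms: all super-polynomial power of GRANK sits in GROWING dimension, through cancellations among
`≤ d`-subsets. [folklore] -/
theorem IsGRankGate.local {s : ℕ} {g : GateFn} (hg : IsGRankGate s g) (v : Fin g.1 → Bool)
    (hv : g.2 v = true) :
    ∃ t : Finset (Fin g.1), t.card ≤ s ∧ (∀ i ∈ t, v i = true) ∧
      g.2 (fun i => decide (i ∈ t)) = true := by
  obtain ⟨F, _, d, θ, hd, K₀, K, hgate⟩ := hg
  obtain ⟨t, -, htd, htv, ht⟩ := grank_local K₀ K θ v ((hgate v).1 hv)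
  exact ⟨t, htd.trans hd, htv, (hgate _).2 ht⟩

/-- In particular `∧_k` (all `k` wires must be on) is not a GRANK gate of dimension `< k`. [folklore] -/
theorem and_not_isGRankGate {k s : ℕ} (hs : s < k) : ¬ IsGRankGate s (GateFn.and k) := by
  intro h
  obtain ⟨t, hts, -, ht⟩ := IsGRankGate.local h (fun _ => true) (by simp [GateFn.and])
  have hall : ∀ i, i ∈ t := by simpa [GateFn.and] using ht
  have htu : t = Finset.univ := Finset.eq_univ_iff_forall.2 hall
  have hk : t.card = k := by rw [htu, Finset.card_univ]; exact Fintype.card_fin k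
  omega

/-! ## §5 PERM gates are LOCAL too: a minterm with `r` wires forces `2^r ≤ d!` -/

section PermLocal

variable {n d : ℕ}

/-- Independent generator families double the subgroup at each step: if no `σᵢ, i ∈ T` lies in the
subgroup generated by the others, then `2^{#T} ≤ |⟨σᵢ : i ∈ T⟩|`. [folklore] -/
theorem two_pow_card_le_card_closure (σ : Fin n → Equiv.Perm (Fin d)) :
    ∀ T : Finset (Fin n), (∀ i ∈ T, σ i ∉ Subgroup.closure (σ '' ↑(T.erase i))) →
      2 ^ T.card ≤ Nat.card (Subgroup.closure (σ '' (↑T : Set (Fin n)))) := by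
  classical
  intro T
  induction T using Finset.induction_on with
  | empty =>
    intro _
    simp only [Finset.card_empty, pow_zero]
    exact Nat.card_pos
  | insert a T ha ih =>
    intro hind
    have hT : ∀ i ∈ T, σ i ∉ Subgroup.closure (σ '' ↑(T.erase i)) := by
      intro i hi hmem
      refine hind i (Finset.mem_insert_of_mem hi) (Subgroup.closure_mono (Set.image_mono ?_) hmem)
      intro j hj
      simp only [Finset.coe_erase, Set.mem_sdiff, Finset.mem_coe, Set.mem_singleton_iff,
        Finset.coe_insert, Set.mem_insert_iff] at hj ⊢
      exact ⟨Or.inr hj.1, hj.2⟩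
    have hσa : σ a ∉ Subgroup.closure (σ '' (↑T : Set (Fin n))) := by
      have := hind a (Finset.mem_insert_self a T)
      rwa [Finset.erase_insert ha] at this
    set H := Subgroup.closure (σ '' (↑T : Set (Fin n))) with hH
    set H' := Subgroup.closure (σ '' (↑(insert a T) : Set (Fin n))) with hH'
    have hle : H ≤ H' := Subgroup.closure_mono (Set.image_mono (by simp))
    have hmem : σ a ∈ H' := Subgroup.subset_closure ⟨a, by simp, rfl⟩
    have hne : Nat.card H ≠ Nat.card H' := by
      intro hc
      have : H = H' := Subgroup.eq_of_le_of_card_ge hle hc.ge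
      exact hσa (this ▸ hmem)
    have hdvd : Nat.card H ∣ Nat.card H' := Subgroup.card_dvd_of_le hle
    obtain ⟨q, hq⟩ := hdvd
    have hq2 : 2 ≤ q := by
      rcases Nat.lt_or_ge q 2 with hlt | hge
      · interval_cases q
        · rw [mul_zero] at hq; exact absurd hq (Nat.card_pos (α := H')).ne'
        · rw [mul_one] at hq; exact absurd hq.symm hne
      · exact hge
    calc 2 ^ (insert a T).card = 2 ^ T.card * 2 := by rw [Finset.card_insert_of_notMem ha, pow_succ]
      _ ≤ Nat.card H * q := Nat.mul_le_mul (ih hT) hq2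
      _ = Nat.card H' := hq.symm

/-- **PERM locality (group form).** If `τ ∈ ⟨σᵢ : i ∈ T⟩` but `τ ∉ ⟨σᵢ : i ∈ T ∖ {j}⟩` for every
`j ∈ T` (i.e. `T` is a MINTERM of the PERM gate `(σ, τ)` on `d` points), then `2^{#T} ≤ d!`: the chain of
subgroups along `T` is strict (a non-strict step would make that generator redundant) and each strict
step at least doubles the order (Lagrange). Hence minterms of a `PERM_s` gate have `≤ log₂ (s!) < s log₂ s`
wires. [folklore] -/
theorem perm_local (σ : Fin n → Equiv.Perm (Fin d)) (τ : Equiv.Perm (Fin d)) (T : Finset (Fin n))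
    (hT : τ ∈ Subgroup.closure (σ '' (↑T : Set (Fin n))))
    (hmin : ∀ j ∈ T, τ ∉ Subgroup.closure (σ '' ↑(T.erase j))) :
    2 ^ T.card ≤ d.factorial := by
  classical
  have hind : ∀ i ∈ T, σ i ∉ Subgroup.closure (σ '' ↑(T.erase i)) := by
    intro i hi hmem
    refine hmin i hi ((Subgroup.closure_le _).2 ?_ hT)
    rintro _ ⟨j, hj, rfl⟩
    by_cases hji : j = i
    · subst hji; exact hmem
    · exact Subgroup.subset_closure ⟨j, by simp [hji, hj], rfl⟩
  calc 2 ^ T.card ≤ Nat.card (Subgroup.closure (σ '' (↑T : Set (Fin n)))) :=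
        two_pow_card_le_card_closure σ T hind
    _ ≤ Nat.card (Equiv.Perm (Fin d)) := Subgroup.card_le_card_group _
    _ = d.factorial := by rw [Nat.card_eq_fintype_card, Fintype.card_perm, Fintype.card_fin]

/-- **PERM gates are local.** Every accepted input of a PERM gate on `d ≤ s` points contains an accepted
sub-input `t` with `2^{#t} ≤ s!`, i.e. every minterm of a `PERM_s` gate has at most `log₂ (s!) ≤ s log₂ s`
wires. (Contrast: `∧_k ∈ CONV₁` for every `k` — in the extended basis all LARGE-minterm power is convex.)
Consequence for the third door (§3): locality does NOT obstruct LIN-UNSAT over `ℤ/2^k` as one PERM gate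
(its minterms — minimal unsolvable subsystems — have `≤ k(D+1)` rows); only the homomorphic embedding is
excluded, so that one-gate question remains open. [folklore] -/
theorem IsPermGate.local {s : ℕ} {g : GateFn} (hg : IsPermGate s g) (v : Fin g.1 → Bool)
    (hv : g.2 v = true) :
    ∃ t : Finset (Fin g.1), 2 ^ t.card ≤ s.factorial ∧ (∀ i ∈ t, v i = true) ∧
      g.2 (fun i => decide (i ∈ t)) = true := by
  classical
  obtain ⟨d, hd, σ, τ, hgate⟩ := hg
  -- accepted sub-selections of the on-wires, and one of minimal cardinality
  set S : Finset (Finset (Fin g.1)) := (Finset.univ.filter fun i => v i = true).powerset.filter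
    fun t => τ ∈ Subgroup.closure (σ '' (↑t : Set (Fin g.1))) with hS
  have hSne : S.Nonempty := by
    refine ⟨Finset.univ.filter fun i => v i = true, ?_⟩
    simp only [hS, Finset.mem_filter, Finset.mem_powerset, Finset.Subset.refl, true_and]
    have := (hgate v).1 hv
    convert this using 3
    ext i; simp
  obtain ⟨t, htS, htmin⟩ := S.exists_min_image Finset.card hSne
  simp only [hS, Finset.mem_filter, Finset.mem_powerset] at htS
  obtain ⟨htsub, ht⟩ := htS
  have hmin : ∀ j ∈ t, τ ∉ Subgroup.closure (σ '' ↑(t.erase j)) := by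
    intro j hj hmem
    have hmemS : t.erase j ∈ S := by
      simp only [hS, Finset.mem_filter, Finset.mem_powerset]
      exact ⟨(Finset.erase_subset j t).trans htsub, hmem⟩
    have := htmin _ hmemS
    rw [Finset.card_erase_of_mem hj] at this
    have hpos : 0 < t.card := Finset.card_pos.2 ⟨j, hj⟩
    omega
  refine ⟨t, (perm_local σ τ t ht hmin).trans (Nat.factorial_le hd), fun i hi => ?_, ?_⟩
  · have := htsub hi
    simpa using this
  · rw [hgate]
    convert ht using 3
    ext i; simp

end PermLocal

/-! ## §6 Gate-by-gate rebasing of straight-line programs (the honest content of "simulate each gate") -/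

section Rebase

variable {ι : Type*} {B' : Set GateFn}

/-- All wires of a program as one multi-output map `x ↦ (w ↦ value of wire w)`; out-of-range gate
wires read `false`, as in `wireOf`. [folklore] -/
def allWires (gs : List (Gate ι)) : (ι → Bool) → ι ⊕ ℕ → Bool := fun x w => wireOf x (vals gs x) w

/-- A constant gate of the target basis costs one gate. [folklore] -/
theorem cktSize_const_of_mem (ι : Type*) {b : Bool} (hb : GateFn.const b ∈ B') :
    CktSize B' (fun (_ : ι → Bool) (_ : Unit) => b) 1 :=
  (CktSize.gate (B := B') (ι := ι) (GateFn.const b) hb Fin.elim0).congr fun _ _ => rfl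

/-- **Rebasing (wire form).** If every gate of a straight-line program, as a function of the WIRE
valuation it reads (`y ↦ g.op (y ∘ g.args)`), has a `B'`-program with at most `m` gates, and `B'` has
the constant `0`, then ALL wires of the program are computed by one `B'`-program with at most
`1 + m · #gates` gates (one layer per gate, reading the already rebased wires; no well-formedness needed:
forward references read `false` on both sides). [folklore] -/
theorem cktSize_allWires' (h0 : GateFn.const false ∈ B') (m : ℕ) :
    ∀ gs : List (Gate ι), (∀ g ∈ gs, CktSize B'
        (fun (y : ι ⊕ ℕ → Bool) (_ : Unit) => g.op fun a => y (g.args a)) m) →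
      CktSize B' (allWires gs) (1 + m * gs.length) := by
  intro gs
  induction gs using List.reverseRecOn with
  | nil =>
    intro _
    have h1 : CktSize B' (fun (x : ι → Bool) => Sum.elim x (fun (_ : Unit) => false)) (0 + 1) :=
      (CktSize.id B').pair (cktSize_const_of_mem ι h0)
    refine (h1.outMap (Sum.map _root_.id fun _ => ())).congr fun x w => ?_
    rcases w with i | j <;> simp [allWires]
  | append_singleton gs g ih =>
    intro hsim
    have hgs := ih fun g' hg' => hsim g' (List.mem_append_left _ hg')
    have hG := hsim g (List.mem_append_right _ (List.mem_singleton_self g))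
    have hstep : CktSize B' (fun (y : ι ⊕ ℕ → Bool) =>
        Sum.elim y (fun (_ : Unit) => g.op fun a => y (g.args a))) (0 + m) :=
      (CktSize.id B').pair hG
    have hcomp := hgs.comp hstep
    refine ((hcomp.outMap fun w : ι ⊕ ℕ => match w with
      | .inl i => Sum.inl (Sum.inl i)
      | .inr j => if j = gs.length then Sum.inr () else Sum.inl (Sum.inr j)).of_le
        (by simp; ring_nf; omega)).congr fun x w => ?_
    rcases w with i | j
    · simp [allWires]
    · by_cases hj : j = gs.length
      · subst hj
        simp only [if_true, Sum.elim_inr, allWires, wireOf_inr, vals_append_singleton]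
        rw [List.getD_append_right _ _ _ _ (length_vals gs x).le, length_vals, Nat.sub_self,
          List.getD_cons_zero]
      · simp only [hj, if_false, Sum.elim_inl, allWires, wireOf_inr, vals_append_singleton]
        rcases lt_or_gt_of_ne hj with hlt | hgt
        · rw [List.getD_append _ _ _ _ (by rw [length_vals]; exact hlt)]
        · rw [List.getD_eq_default _ _ (by rw [length_vals]; omega),
            List.getD_eq_default _ _ (by
              rw [List.length_append, length_vals, List.length_singleton]; omega)]

/-- **Rebasing (gate form).** The same with the hypothesis on each gate as a function of ITS OWN
argument tuple. [folklore] -/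
theorem cktSize_allWires (h0 : GateFn.const false ∈ B') (m : ℕ) (gs : List (Gate ι))
    (hsim : ∀ g ∈ gs, CktSize B' (fun (z : Fin g.arity → Bool) (_ : Unit) => g.op z) m) :
    CktSize B' (allWires gs) (1 + m * gs.length) :=
  cktSize_allWires' h0 m gs fun g hg => (hsim g hg).rewire g.args

/-- **Rebasing a circuit (wire form).** [folklore] -/
theorem Circuit.rebase' (h0 : GateFn.const false ∈ B') (m : ℕ) (C : Circuit ι)
    (hsim : ∀ g ∈ C.gates, CktSize B'
      (fun (y : ι ⊕ ℕ → Bool) (_ : Unit) => g.op fun a => y (g.args a)) m) :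
    ∃ C' : Circuit ι, C'.IsOver B' ∧ C'.size ≤ 1 + m * C.size ∧ ∀ x, C'.eval x = C.eval x := by
  have h := ((cktSize_allWires' h0 m C.gates hsim).outMap fun _ : Unit => C.output).toCircuit
  obtain ⟨C', hB, hs, he⟩ := h
  exact ⟨C', hB, hs, fun x => by rw [he, circuit_eval]; rfl⟩

/-- **Rebasing a circuit (gate form).** Under the gate-wise hypothesis a circuit becomes a circuit over
`B'` with at most `1 + m · size` gates computing the same function. [folklore] -/
theorem Circuit.rebase (h0 : GateFn.const false ∈ B') (m : ℕ) (C : Circuit ι)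
    (hsim : ∀ g ∈ C.gates, CktSize B' (fun (z : Fin g.arity → Bool) (_ : Unit) => g.op z) m) :
    ∃ C' : Circuit ι, C'.IsOver B' ∧ C'.size ≤ 1 + m * C.size ∧ ∀ x, C'.eval x = C.eval x :=
  Circuit.rebase' h0 m C fun g hg => (hsim g hg).rewire g.args

end Rebase

/-! ## §7 Every MONOTONE function of `k` variables has a `{∧₂,∨₂,0,1}`-program of size `≤ monoBound k` -/

/-- Size of the monotone Shannon expansion `f = f|₀ ∨ (x₀ ∧ f|₁)`: `monoBound 0 = 1`,
`monoBound (k+1) = 2·monoBound k + 2` (`= 3·2^k − 2`). [folklore] -/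
def monoBound : ℕ → ℕ
  | 0 => 1
  | k + 1 => 2 * monoBound k + 2

/-- `monoBound` is monotone. [folklore] -/
theorem monoBound_mono : Monotone monoBound := by
  refine monotone_nat_of_le_succ fun k => ?_
  simp only [monoBound]; omega

/-- `∧₂ ∈ {∧₂,∨₂,0,1}`. [folklore] -/
theorem and_mem_monotoneBasis01 : GateFn.and 2 ∈ monotoneBasis01 :=
  monotoneBasis_subset_monotoneBasis01 (Set.mem_insert _ _)

/-- `∨₂ ∈ {∧₂,∨₂,0,1}`. [folklore] -/
theorem or_mem_monotoneBasis01 : GateFn.or 2 ∈ monotoneBasis01 :=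
  monotoneBasis_subset_monotoneBasis01 (Set.mem_insert_of_mem _ (Set.mem_singleton _))

/-- `0, 1 ∈ {∧₂,∨₂,0,1}`. [folklore] -/
theorem const_mem_monotoneBasis01 (b : Bool) : GateFn.const b ∈ monotoneBasis01 := by
  cases b
  · exact Set.mem_insert_of_mem _ (Set.mem_insert _ _)
  · exact Set.mem_insert _ _

/-- The monotone multiplexer `b ∨ (c ∧ a)` on three given wires costs `2` gates over `{∧₂,∨₂,0,1}`.
[folklore] -/
theorem cktSize_monoMux {ι : Type*} (c a b : ι) :
    CktSize monotoneBasis01 (fun (x : ι → Bool) (_ : Unit) => (x b || (x c && x a))) 2 := by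
  have h1 : CktSize monotoneBasis01 (fun (x : ι → Bool) =>
      Sum.elim x (fun (_ : Unit) => (x c && x a))) (0 + 1) :=
    (CktSize.id monotoneBasis01).pair
      ((CktSize.gate (B := monotoneBasis01) (GateFn.and 2) and_mem_monotoneBasis01 ![c, a]).congr
        fun x _ => by
          simp only [GateFn.and, Fin.forall_fin_two, Matrix.cons_val_zero, Matrix.cons_val_one,
            Bool.decide_and, Bool.decide_eq_true])
  have h2 : CktSize monotoneBasis01 (fun (y : ι ⊕ Unit → Bool) (_ : Unit) =>
      (y (.inl b) || y (.inr ()))) 1 :=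
    (CktSize.gate (B := monotoneBasis01) (GateFn.or 2) or_mem_monotoneBasis01
      ![Sum.inl b, Sum.inr ()]).congr fun y _ => by
        simp only [GateFn.or, Fin.exists_fin_two, Matrix.cons_val_zero, Matrix.cons_val_one,
          Bool.decide_or, Bool.decide_eq_true]
  exact (h1.comp h2).congr fun x _ => by simp

/-- **Monotone Shannon expansion.** Every MONOTONE Boolean function of `k` variables is computed by a
program over `{∧₂, ∨₂, 0, 1}` with at most `monoBound k` gates (`f = f|_{x₀=0} ∨ (x₀ ∧ f|_{x₀=1})`,
valid exactly because `f|₀ ≤ f|₁`). [folklore] -/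
theorem cktSize_monotone_univ_fin : ∀ (k : ℕ) (f : (Fin k → Bool) → Unit → Bool), Monotone f →
    CktSize monotoneBasis01 f (monoBound k)
  | 0, f, _ => (cktSize_const_of_mem (Fin 0) (const_mem_monotoneBasis01 (f Fin.elim0 ()))).congr
      fun x u => by rw [Subsingleton.elim x Fin.elim0]
  | k + 1, f, hf => by
    have hc : ∀ b : Bool, CktSize monotoneBasis01 (fun (x : Fin (k + 1) → Bool) (u : Unit) =>
        f (Fin.cons b fun i => x i.succ) u) (monoBound k) := fun b =>
      (cktSize_monotone_univ_fin k (fun x' => f (Fin.cons b x'))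
        (fun x y hxy => hf (Fin.cons_le_cons.2 ⟨le_rfl, hxy⟩))).rewire Fin.succ
    have h1 : CktSize monotoneBasis01 (fun (x : Fin (k + 1) → Bool) =>
        Sum.elim x (Sum.elim (fun u => f (Fin.cons true fun i => x i.succ) u)
          (fun u => f (Fin.cons false fun i => x i.succ) u)))
        (0 + (monoBound k + monoBound k)) :=
      (CktSize.id monotoneBasis01).pair ((hc true).pair (hc false))
    have h2 := h1.comp (cktSize_monoMux (ι := Fin (k + 1) ⊕ (Unit ⊕ Unit))
      (.inl 0) (.inr (.inl ())) (.inr (.inr ())))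
    refine (h2.of_le (by simp [monoBound]; omega)).congr fun x u => ?_
    obtain ⟨⟩ := u
    induction x using Fin.consCases with
    | _ b y =>
      have hle : f (Fin.cons false y) () ≤ f (Fin.cons true y) () :=
        hf (Fin.cons_le_cons.2 ⟨Bool.false_le _, le_rfl⟩) ()
      cases b
      · simp
      · simp only [Sum.elim_inl, Fin.cons_zero, Sum.elim_inr, Fin.cons_succ, Bool.true_and]
        revert hle
        cases f (Fin.cons false y) () <;> cases f (Fin.cons true y) () <;> simp

/-- A monotone gate of fan-in `≤ k` has a `{∧₂,∨₂,0,1}`-program of size `≤ monoBound k`. [folklore] -/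
theorem cktSize_of_monotone_gate {k : ℕ} (g : GateFn) (hg : Monotone g.2) (hk : g.1 ≤ k) :
    CktSize monotoneBasis01 (fun (z : Fin g.1 → Bool) (_ : Unit) => g.2 z) (monoBound k) :=
  (cktSize_monotone_univ_fin g.1 (fun z _ => g.2 z) (fun _ _ h _ => hg h)).of_le (monoBound_mono hk)

/-! ## §8 STRENGTHENING S₂ — wide gates of BOUNDED FAN-IN: false for every bound -/

/-- No `{∧₂, ∨₂}`-circuit computes a constant function: at the all-`b` input every in-range wire
carries `b` (`b ∧ b = b ∨ b = b`). [folklore] -/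
theorem wireOf_const_of_monotoneBasis {ι : Type*} (b : Bool) :
    ∀ gs : List (Gate ι), WF gs → (∀ g ∈ gs, g.fn ∈ monotoneBasis) →
      ∀ w : ι ⊕ ℕ, (∀ m, w = .inr m → m < gs.length) →
        wireOf (fun _ => b) (vals gs fun _ => b) w = b := by
  intro gs
  induction gs using List.reverseRecOn with
  | nil =>
    rintro - - (i | m) hw
    · rfl
    · exact absurd (hw m rfl) (Nat.not_lt_zero _)
  | append_singleton gs g ih =>
    intro hwf hB
    have ih' := ih hwf.of_append_left fun g' hg' => hB g' (List.mem_append_left _ hg')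
    rintro (i | m) hw
    · rfl
    · have hm : m < gs.length + 1 := by simpa using hw m rfl
      simp only [wireOf_inr, vals_append_singleton]
      rcases Nat.lt_or_ge m gs.length with hlt | hge
      · rw [List.getD_append _ _ _ _ (by rw [length_vals]; exact hlt)]
        exact ih' (.inr m) fun m' h => by cases h; exact hlt
      · have hmeq : m = gs.length := by omega
        subst hmeq
        rw [List.getD_append_right _ _ _ _ (length_vals gs _).le, length_vals, Nat.sub_self,
          List.getD_cons_zero]
        -- `g` is `∧₂` or `∨₂`; its arguments are in-range wires (well-formedness), all carrying `b`
        have hgB := hB g (List.mem_append_right _ (List.mem_singleton_self g))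
        have hargs : ∀ a, wireOf (fun _ => b) (vals gs fun _ => b) (g.args a) = b := fun a =>
          ih' (g.args a) fun m' hm' => hwf.getLast a m' hm'
        rcases hgB with h | h
        · obtain ⟨u, v, rfl⟩ := exists_eq_andGate_of_fn_eq h
          have hu := hargs (0 : Fin 2)
          have hv := hargs (1 : Fin 2)
          cases b <;> simp_all [andGate, GateFn.and, Fin.forall_fin_two]
        · rw [Set.mem_singleton_iff] at h
          obtain ⟨u, v, rfl⟩ := exists_eq_orGate_of_fn_eq h
          have hu := hargs (0 : Fin 2)
          have hv := hargs (1 : Fin 2)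
          cases b <;> simp_all [orGate, GateFn.or, Fin.exists_fin_two]

/-- Hence no circuit over `{∧₂, ∨₂}` computes a constant, and the monotone complexity of a constant is
the junk value `0`. [folklore] -/
theorem circuitSizeOver_monotoneBasis_const {ι : Type*} (b : Bool) :
    circuitSizeOver monotoneBasis (fun _ : ι → Bool => b) = 0 := by
  rw [circuitSizeOver, Nat.sInf_eq_zero]
  refine Or.inr (Set.eq_empty_iff_forall_notMem.2 ?_)
  rintro s ⟨C, hB, hC, -⟩
  have hw : ∀ m, C.output = .inr m → m < C.gates.length := C.wf_output
  have h1 := wireOf_const_of_monotoneBasis (!b) C.gates (wf_gates C) hB C.output hw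
  have h2 := hC fun _ => !b
  rw [circuit_eval] at h2
  rw [h2] at h1
  cases b <;> simp at h1

/-- STRENGTHENING S₂ — capture by wide gates of FAN-IN AT MOST `k` (any CONV/PERM/GRANK gate allowed, of
any width, provided it reads `≤ k` wires). [folklore] -/
def CaptureBoundedFanIn (k : ℕ) : Prop := CaptureInto fun N => extGate N ∩ {g | g.1 ≤ k}

/-- Size bookkeeping: `1 + m (t + v² + 2)^a ≤ (v + t)^{3a+1}` once `v ≥ 2` and `v ≥ m + 1`. [folklore] -/
theorem size_bookkeeping' {v t m a : ℕ} (hv : 2 ≤ v) (hm : m + 1 ≤ v) :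
    1 + m * (t + v ^ 2 + 2) ^ a ≤ (v + t) ^ (3 * a + 1) := by
  have h1 : v ^ 2 + 2 ≤ v ^ 3 := by nlinarith
  have h2 : v ^ 3 + t ≤ (v + t) ^ 3 := by
    have h3 : 1 ≤ 3 * v ^ 2 + 3 * v * t + t ^ 2 := by nlinarith
    calc v ^ 3 + t = v ^ 3 + t * 1 := by ring
      _ ≤ v ^ 3 + t * (3 * v ^ 2 + 3 * v * t + t ^ 2) := by gcongr
      _ = (v + t) ^ 3 := by ring
  have hN : (t + v ^ 2 + 2) ^ a ≤ (v + t) ^ (3 * a) := by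
    rw [pow_mul]; exact Nat.pow_le_pow_left (by omega) a
  have hpos : 1 ≤ (t + v ^ 2 + 2) ^ a := Nat.one_le_pow _ _ (by omega)
  calc 1 + m * (t + v ^ 2 + 2) ^ a ≤ (t + v ^ 2 + 2) ^ a + m * (t + v ^ 2 + 2) ^ a := by omega
    _ = (m + 1) * (t + v ^ 2 + 2) ^ a := by ring
    _ ≤ (v + t) * (v + t) ^ (3 * a) := Nat.mul_le_mul (by omega) hN
    _ = (v + t) ^ (3 * a + 1) := by ring

/-- **The strengthening "wide gates of bounded fan-in" is FALSE, for every bound `k`.** A CONV/PERM/GRANK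
gate reading `≤ k` wires is just SOME monotone function of `≤ k` wires (`extGate_monotone`), hence a
`{∧₂,∨₂,0,1}`-gadget of constant size `monoBound k` (§7); rebasing (§6) turns the simulating circuit into
a `{∧₂,∨₂,0,1}`-circuit of size `≤ 1 + monoBound k · N^a`, constants are eliminated
(`const_or_exists_monotone_circuit`), and the tree's PROVED Tardos gap (`not_monotoneTransfer_pow_holds`)
refutes the resulting polynomial monotone-to-general transfer. So any proof of `Capture` must use wide
gates of UNBOUNDED fan-in (growing with `t + n`). [cite: Tardos1988] -/
theorem not_captureBoundedFanIn (k : ℕ) : ¬ CaptureBoundedFanIn k := by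
  rintro ⟨a, h⟩
  refine not_monotoneTransfer_pow_holds (3 * a + 1) ?_
  filter_upwards [eventually_ge_atTop (monoBound k + 2)] with v hv f hf C hB hC
  obtain ⟨C', h1, h2, h3⟩ := h _ inferInstance f hf C (hB.mono deMorganBasis_subset_B2) hC
  -- rebase `C'` gate by gate into `{∧₂,∨₂,0,1}`
  obtain ⟨C'', hB'', hs'', he''⟩ := Circuit.rebase (const_mem_monotoneBasis01 false) (monoBound k) C'
    fun g hg => by
      obtain ⟨hgE, hgk⟩ := h1 g hg
      exact cktSize_of_monotone_gate g.fn (extGate_monotone hgE) hgk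
  -- eliminate the constants
  rcases const_or_exists_monotone_circuit C''.gates C''.output (wf_gates C'') hB'' C''.wf_output with
    ⟨b, hb⟩ | ⟨D, hDB, hDs, hDe⟩
  · have hfb : f = fun _ => b := funext fun x => by rw [← h3 x, ← he'' x, circuit_eval, hb x]
    rw [hfb, circuitSizeOver_monotoneBasis_const]
    exact Nat.zero_le _
  · calc circuitSizeOver monotoneBasis f ≤ D.size :=
          circuitSizeOver_le_of_computes D hDB fun x => by rw [hDe, ← circuit_eval, he'', h3]
      _ ≤ C''.size := hDs
      _ ≤ 1 + monoBound k * C'.size := hs''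
      _ ≤ 1 + monoBound k * (C.size + Fintype.card ((⊤ : SimpleGraph (Fin v)).edgeSet) + 2) ^ a :=
          by gcongr
      _ ≤ 1 + monoBound k * (C.size + v ^ 2 + 2) ^ a := by
          have := card_edgeSet_top_le v
          gcongr
      _ ≤ (v + C.size) ^ (3 * a + 1) := size_bookkeeping' (by omega) (by omega)

/-! ## §9 AUTOMATIC CASES: every monotone CNF / DNF is ONE CONV gate (so `Capture` is trivial unless BOTH
the number of minterms and the number of maxterms are super-polynomial) -/

section AutoCases

variable {n : ℕ}

/-- `∑ⱼ [j ∈ c]·[vⱼ] = #{j ∈ c | vⱼ = 1}`. [folklore] -/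
theorem sum_mem_mul_indicator (c : Finset (Fin n)) (v : Fin n → Bool) :
    (∑ j, (if j ∈ c then (1 : ℝ) else 0) * (if v j then (1 : ℝ) else 0)) =
      ((c.filter fun j => v j = true).card : ℝ) := by
  simp_rw [boole_mul]
  rw [Finset.sum_ite_mem, Finset.univ_inter, Finset.sum_boole]

/-- **A monotone CNF with `m` clauses is ONE CONV gate of width `m`** (`p = m` linear constraints
`1 ≤ ∑_{j ∈ clause} [vⱼ]`, no matrix variable: `q = 0`). [folklore] -/
theorem isConvGate_cnf {m : ℕ} (c : Fin m → Finset (Fin n)) :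
    IsConvGate m ⟨n, fun v => decide (∀ l, ∃ j ∈ c l, v j = true)⟩ := by
  refine ⟨m, 0, le_rfl, fun _ => 0, fun _ => -1, fun l j => if j ∈ c l then 1 else 0,
    fun l j => by simp only; split_ifs <;> norm_num, fun v => ?_⟩
  show decide (∀ l, ∃ j ∈ c l, v j = true) = true ↔ _
  rw [decide_eq_true_iff]
  simp only [Matrix.zero_mul, Matrix.trace_zero, sum_mem_mul_indicator]
  constructor
  · intro h
    refine ⟨0, Matrix.PosSemidef.zero, fun l => ?_⟩
    obtain ⟨j, hj, hvj⟩ := h l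
    have : (1 : ℝ) ≤ ((c l).filter fun j => v j = true).card := by
      exact_mod_cast Finset.card_pos.2 ⟨j, Finset.mem_filter.2 ⟨hj, hvj⟩⟩
    linarith
  · rintro ⟨-, -, h⟩ l
    have h1 : (1 : ℝ) ≤ ((c l).filter fun j => v j = true).card := by linarith [h l]
    have h2 : 0 < ((c l).filter fun j => v j = true).card := by exact_mod_cast h1
    obtain ⟨j, hj⟩ := Finset.card_pos.1 h2
    exact ⟨j, (Finset.mem_filter.1 hj).1, (Finset.mem_filter.1 hj).2⟩

/-- Width of the DNF gate: `p + q` with `q` slots and `p = 1 + q·n` constraints. [folklore] -/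
def dnfWidth (n q : ℕ) : ℕ := Fintype.card (Option (Fin q × Fin n)) + q

/-- `dnfWidth n q = q·n + 1 + q`. [folklore] -/
theorem dnfWidth_eq (n q : ℕ) : dnfWidth n q = q * n + 1 + q := by
  simp [dnfWidth, Fintype.card_option, Fintype.card_prod, Fintype.card_fin]

/-- **A monotone DNF with `q` terms is ONE CONV gate of width `q·n + 1 + q`** (an LP in SDP clothing, as
in `CliqueLPGate.cliqueGate_isConvGate`): variables `Y ⪰ 0` of dimension `q` (one diagonal slot per term),
constraints `tr Y ≥ 1` and `Y_PP ≤ [vⱼ]` for every term `P` and every `j ∈ T_P`. A satisfied term `P` gives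
the feasible point `E_PP`; a feasible `Y` has a positive diagonal slot, whose term is switched on.
[folklore] -/
theorem isConvGate_dnf {q : ℕ} (T : Fin q → Finset (Fin n)) :
    IsConvGate (dnfWidth n q) ⟨n, fun v => decide (∃ P, ∀ j ∈ T P, v j = true)⟩ := by
  classical
  let eP := Fintype.equivFin (Option (Fin q × Fin n))
  let A : Fin (Fintype.card (Option (Fin q × Fin n))) → Matrix (Fin q) (Fin q) ℝ := fun i =>
    (eP.symm i).elim (-1) fun x => if x.2 ∈ T x.1 then Matrix.single x.1 x.1 1 else 0
  let b : Fin (Fintype.card (Option (Fin q × Fin n))) → ℝ := fun i => (eP.symm i).elim (-1) fun _ => 0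
  let B : Fin (Fintype.card (Option (Fin q × Fin n))) → Fin n → ℝ := fun i j' =>
    (eP.symm i).elim 0 fun x => if j' = x.2 then 1 else 0
  refine ⟨_, q, le_rfl, A, b, B, ?_, ?_⟩
  · intro i j'
    simp only [B]
    cases eP.symm i with
    | none => simp
    | some x =>
      simp only [Option.elim_some]
      split_ifs <;> norm_num
  · show ∀ v : Fin n → Bool, decide (∃ P, ∀ j ∈ T P, v j = true) = true ↔
      ∃ Y : Matrix (Fin q) (Fin q) ℝ, Y.PosSemidef ∧
        ∀ i, (A i * Y).trace ≤ b i + ∑ j : Fin n, B i j * (if v j then (1 : ℝ) else 0)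
    intro v
    rw [decide_eq_true_iff]
    have hsum : ∀ j : Fin n,
        (∑ j', (if j' = j then (1 : ℝ) else 0) * (if v j' then (1 : ℝ) else 0)) =
          if v j then 1 else 0 := fun j => by
      rw [Finset.sum_eq_single j (fun j' _ hne => by rw [if_neg hne, zero_mul])
        (fun h => absurd (Finset.mem_univ j) h), if_pos rfl, one_mul]
    have hind : ∀ j : Fin n, (0 : ℝ) ≤ if v j then 1 else 0 := fun j => by
      split_ifs <;> norm_num
    constructor
    · rintro ⟨P₀, hP₀⟩
      refine ⟨Matrix.single P₀ P₀ 1, ?_, fun i => ?_⟩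
      · rw [← Matrix.diagonal_single]
        exact Matrix.PosSemidef.diagonal fun P => by
          simp only [Pi.single_apply, Pi.zero_apply]
          split_ifs <;> norm_num
      · obtain ⟨o, rfl⟩ := eP.surjective i
        rcases o with _ | ⟨P, j⟩
        · simp only [A, b, B, Equiv.symm_apply_apply, Option.elim_none]
          simp [Matrix.trace_single_eq_same]
        · simp only [A, b, B, Equiv.symm_apply_apply, Option.elim_some]
          rw [hsum j, zero_add]
          by_cases hin : j ∈ T P
          · rw [if_pos hin, Matrix.trace_single_mul, smul_eq_mul, one_mul, Matrix.single_apply]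
            by_cases hP : P₀ = P
            · subst hP
              rw [if_pos ⟨rfl, rfl⟩, hP₀ j hin, if_pos rfl]
            · rw [if_neg (fun h => hP h.1)]
              exact hind j
          · rw [if_neg hin, Matrix.zero_mul, Matrix.trace_zero]
            exact hind j
    · rintro ⟨Y, hY, hc⟩
      have h1 : 1 ≤ Y.trace := by
        have h0 : ((-1 : Matrix _ _ ℝ) * Y).trace ≤ -1 + ∑ j', (0 : ℝ) * (if v j' then (1 : ℝ) else 0) := by
          have := hc (eP none)
          simp only [A, b, B, Equiv.symm_apply_apply, Option.elim_none] at this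
          exact this
        simp only [neg_mul, one_mul, Matrix.trace_neg, zero_mul, Finset.sum_const_zero,
          add_zero] at h0
        linarith
      obtain ⟨P₀, hpos⟩ : ∃ P, 0 < Y P P := by
        by_contra hneg
        have hle : ∀ P, Y P P ≤ 0 := fun P => not_lt.1 fun h => hneg ⟨P, h⟩
        have : Y.trace ≤ 0 := Finset.sum_nonpos fun P _ => hle P
        linarith
      refine ⟨P₀, fun j hin => ?_⟩
      have h2 : ((if j ∈ T P₀ then Matrix.single P₀ P₀ 1 else 0 : Matrix _ _ ℝ) * Y).trace ≤
          0 + ∑ j', (if j' = j then (1 : ℝ) else 0) * (if v j' then (1 : ℝ) else 0) := by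
        have := hc (eP (some (P₀, j)))
        simp only [A, b, B, Equiv.symm_apply_apply, Option.elim_some] at this
        exact this
      rw [if_pos hin, Matrix.trace_single_mul, smul_eq_mul, one_mul, zero_add, hsum] at h2
      cases hv : v j
      · rw [hv] at h2
        simp only [Bool.false_eq_true, if_false] at h2
        linarith
      · rfl

/-- A single gate wired to the inputs is a size-`1` circuit. [folklore] -/
theorem exists_size_one_circuit (g : GateFn) {s : ℕ} (hg : g ∈ extGate s) :
    ∃ C : Circuit (Fin g.1), C.IsOver (extGate s) ∧ C.size ≤ 1 ∧ C.Computes g.2 := by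
  obtain ⟨C, hB, hs, hC⟩ := (CktSize.gate (B := extGate s) g hg _root_.id).toCircuit
  exact ⟨C, hB, hs, fun x => hC x⟩

/-- **AUTOMATIC CASE (DNF side).** If a Boolean function of `n` variables is the upward closure of `q`
sets (`f v = 1 ↔ some Tₚ is switched on` — e.g. a monotone `f` with `q` minterms), then it is computed by
a size-ONE circuit over `B_s` as soon as `s ≥ q·n + 1 + q`. [folklore] -/
theorem exists_size_one_of_dnf {q : ℕ} (T : Fin q → Finset (Fin n)) (f : (Fin n → Bool) → Bool)
    (hf : ∀ v, f v = true ↔ ∃ P, ∀ j ∈ T P, v j = true) {s : ℕ} (hs : q * n + 1 + q ≤ s) :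
    ∃ C : Circuit (Fin n), C.IsOver (extGate s) ∧ C.size ≤ 1 ∧ C.Computes f := by
  have hg : (⟨n, fun v => decide (∃ P, ∀ j ∈ T P, v j = true)⟩ : GateFn) ∈ extGate s :=
    (((isConvGate_dnf T).mono (by rw [dnfWidth_eq]; exact hs))).mem_extGate
  obtain ⟨C, hB, h1, hC⟩ := exists_size_one_circuit _ hg
  refine ⟨C, hB, h1, fun v => ?_⟩
  rw [hC v]
  show decide _ = f v
  rw [Bool.eq_iff_iff, decide_eq_true_iff, hf]

/-- **AUTOMATIC CASE (CNF side).** If `f` is a monotone CNF with `m` clauses (e.g. a monotone `f` with `m`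
maxterms), then it is computed by a size-ONE circuit over `B_s` as soon as `s ≥ m`. [folklore] -/
theorem exists_size_one_of_cnf {m : ℕ} (c : Fin m → Finset (Fin n)) (f : (Fin n → Bool) → Bool)
    (hf : ∀ v, f v = true ↔ ∀ l, ∃ j ∈ c l, v j = true) {s : ℕ} (hs : m ≤ s) :
    ∃ C : Circuit (Fin n), C.IsOver (extGate s) ∧ C.size ≤ 1 ∧ C.Computes f := by
  have hg : (⟨n, fun v => decide (∀ l, ∃ j ∈ c l, v j = true)⟩ : GateFn) ∈ extGate s :=
    ((isConvGate_cnf c).mono hs).mem_extGate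
  obtain ⟨C, hB, h1, hC⟩ := exists_size_one_circuit _ hg
  refine ⟨C, hB, h1, fun v => ?_⟩
  rw [hC v]
  show decide _ = f v
  rw [Bool.eq_iff_iff, decide_eq_true_iff, hf]

/-- Every monotone Boolean function is the upward closure of its accepted sets (so the DNF case always
applies with `q =` the number of accepted — or of minimal accepted — inputs). [folklore] -/
theorem monotone_iff_exists_subset (f : (Fin n → Bool) → Bool) (hf : Monotone f) (v : Fin n → Bool) :
    f v = true ↔ ∃ S : Finset (Fin n), f (fun j => decide (j ∈ S)) = true ∧ ∀ j ∈ S, v j = true := by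
  constructor
  · intro hv
    refine ⟨Finset.univ.filter fun j => v j = true, ?_, fun j hj => (Finset.mem_filter.1 hj).2⟩
    convert hv using 2
    ext j; simp
  · rintro ⟨S, hS, hsub⟩
    have hle : (fun j => decide (j ∈ S)) ≤ v := fun j => by
      by_cases hj : j ∈ S
      · simp [hj, hsub j hj]
      · simp [hj]
    exact eq_true_of_le_of_eq_true (hf hle) hS

end AutoCases

/-! ## §10 Local gates are polynomial monotone DNFs: the DNF gadget -/

section DNFGadget

variable {κ : Type*}

/-- `∧₂, ∨₂, 0, 1` memberships (local copies). [folklore] -/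
theorem and_mem_monotoneBasis01' : GateFn.and 2 ∈ monotoneBasis01 :=
  monotoneBasis_subset_monotoneBasis01 (Set.mem_insert _ _)

/-- `∨₂ ∈ {∧₂,∨₂,0,1}` (local copy). [folklore] -/
theorem or_mem_monotoneBasis01' : GateFn.or 2 ∈ monotoneBasis01 :=
  monotoneBasis_subset_monotoneBasis01 (Set.mem_insert_of_mem _ (Set.mem_singleton _))

/-- `0, 1 ∈ {∧₂,∨₂,0,1}` (local copy). [folklore] -/
theorem const_mem_monotoneBasis01' (b : Bool) : GateFn.const b ∈ monotoneBasis01 := by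
  cases b
  · exact Set.mem_insert_of_mem _ (Set.mem_insert _ _)
  · exact Set.mem_insert _ _

/-- A constant costs one gate over `{∧₂,∨₂,0,1}`. [folklore] -/
theorem cktSize_const01 (κ : Type*) (b : Bool) :
    CktSize monotoneBasis01 (fun (_ : κ → Bool) (_ : Unit) => b) 1 :=
  (CktSize.gate (B := monotoneBasis01) (ι := κ) (GateFn.const b) (const_mem_monotoneBasis01' b)
    Fin.elim0).congr fun _ _ => rfl

/-- `y u ∧ y w` costs one gate. [folklore] -/
theorem cktSize_and01 (u w : κ) :
    CktSize monotoneBasis01 (fun (y : κ → Bool) (_ : Unit) => (y u && y w)) 1 :=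
  (CktSize.gate (B := monotoneBasis01) (GateFn.and 2) and_mem_monotoneBasis01' ![u, w]).congr
    fun y _ => by
      simp only [GateFn.and, Fin.forall_fin_two, Matrix.cons_val_zero, Matrix.cons_val_one,
        Bool.decide_and, Bool.decide_eq_true]

/-- `y u ∨ y w` costs one gate. [folklore] -/
theorem cktSize_or01 (u w : κ) :
    CktSize monotoneBasis01 (fun (y : κ → Bool) (_ : Unit) => (y u || y w)) 1 :=
  (CktSize.gate (B := monotoneBasis01) (GateFn.or 2) or_mem_monotoneBasis01' ![u, w]).congr
    fun y _ => by
      simp only [GateFn.or, Fin.exists_fin_two, Matrix.cons_val_zero, Matrix.cons_val_one,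
        Bool.decide_or, Bool.decide_eq_true]

/-- **Big AND** of a list of wires: `#list + 1` gates. [folklore] -/
theorem cktSize_bigAnd : ∀ l : List κ,
    CktSize monotoneBasis01 (fun (y : κ → Bool) (_ : Unit) => l.all fun w => y w) (l.length + 1)
  | [] => (cktSize_const01 κ true).congr fun _ _ => rfl
  | w :: l => by
    have h1 : CktSize monotoneBasis01 (fun (y : κ → Bool) =>
        Sum.elim y (fun (_ : Unit) => l.all fun w => y w)) (0 + (l.length + 1)) :=
      (CktSize.id monotoneBasis01).pair (cktSize_bigAnd l)
    have h2 := h1.comp (cktSize_and01 (κ := κ ⊕ Unit) (.inl w) (.inr ()))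
    refine (h2.of_le (by simp)).congr fun y _ => ?_
    simp [List.all_cons]

/-- **Big OR** of `M` wires: `M + 1` gates. [folklore] -/
theorem cktSize_bigOr : ∀ M : ℕ,
    CktSize monotoneBasis01 (fun (z : Fin M → Bool) (_ : Unit) => decide (∃ i, z i = true)) (M + 1)
  | 0 => (cktSize_const01 (Fin 0) false).congr fun _ _ => by simp
  | M + 1 => by
    have h0 : CktSize monotoneBasis01 (fun (z : Fin (M + 1) → Bool) (_ : Unit) =>
        decide (∃ i : Fin M, z i.castSucc = true)) (M + 1) :=
      (cktSize_bigOr M).rewire Fin.castSucc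
    have h1 : CktSize monotoneBasis01 (fun (z : Fin (M + 1) → Bool) =>
        Sum.elim z (fun (_ : Unit) => decide (∃ i : Fin M, z i.castSucc = true))) (0 + (M + 1)) :=
      (CktSize.id monotoneBasis01).pair h0
    have h2 := h1.comp (cktSize_or01 (κ := Fin (M + 1) ⊕ Unit) (.inl (Fin.last M)) (.inr ()))
    refine (h2.of_le (by omega)).congr fun z _ => ?_
    simp only [Sum.elim_inl, Sum.elim_inr]
    rw [Bool.eq_iff_iff]
    simp only [Bool.or_eq_true, decide_eq_true_eq]
    constructor
    · rintro (h | ⟨i, hi⟩)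
      · exact ⟨_, h⟩
      · exact ⟨_, hi⟩
    · rintro ⟨i, hi⟩
      rcases Fin.eq_castSucc_or_eq_last i with ⟨j, rfl⟩ | rfl
      · exact Or.inr ⟨j, hi⟩
      · exact Or.inl hi

/-- **DNF** of `M` terms given as lists: `∑ (#termᵢ + 1) + (M + 1)` gates; with terms of length `≤ L`:
`≤ M·(L+2) + 1`. [folklore] -/
theorem cktSize_dnf {M L : ℕ} (term : Fin M → List κ) (hL : ∀ i, (term i).length ≤ L) :
    CktSize monotoneBasis01 (fun (y : κ → Bool) (_ : Unit) =>
      decide (∃ i, (term i).all (fun w => y w) = true)) (M * (L + 2) + 1) := by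
  have h1 : CktSize monotoneBasis01 (fun (y : κ → Bool) (i : Fin M) => (term i).all fun w => y w)
      (∑ i : Fin M, ((term i).length + 1)) :=
    CktSize.pi_fin fun i => cktSize_bigAnd (term i)
  have h2 := h1.comp (cktSize_bigOr M)
  refine (h2.of_le ?_).congr fun y _ => rfl
  calc ∑ i : Fin M, ((term i).length + 1) + (M + 1) ≤ ∑ _i : Fin M, (L + 1) + (M + 1) := by
        gcongr with i; exact hL i
    _ = M * (L + 2) + 1 := by simp; ring

end DNFGadget

/-! ## §11 Wire-local monotone maps have polynomial `{∧₂,∨₂,0,1}`-gadgets -/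

section LocalGadget

variable {κ : Type*} [DecidableEq κ]

/-- The wire set listed by an enumeration `f : Fin L → Option S` (blanks allowed). [folklore] -/
def listed (S : Finset κ) {L : ℕ} (f : Fin L → Option S) : Finset κ :=
  Finset.univ.biUnion fun i => ((f i).map Subtype.val).toFinset

omit [DecidableEq κ] in
/-- An option lists at most one element. [folklore] -/
theorem card_toFinset_option_le [DecidableEq κ] (o : Option κ) : o.toFinset.card ≤ 1 := by
  cases o <;> simp

/-- Membership in the listed set. [folklore] -/
theorem mem_listed {S : Finset κ} {L : ℕ} {f : Fin L → Option S} {w : κ} :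
    w ∈ listed S f ↔ ∃ i, (f i).map Subtype.val = some w := by
  simp [listed, Option.mem_toFinset, Option.mem_def]

/-- The listed set lies inside `S`. [folklore] -/
theorem listed_subset {S : Finset κ} {L : ℕ} (f : Fin L → Option S) : listed S f ⊆ S := by
  intro w hw
  obtain ⟨i, hi⟩ := mem_listed.1 hw
  cases hfi : f i with
  | none => rw [hfi] at hi; simp at hi
  | some x => rw [hfi] at hi; simp only [Option.map_some, Option.some.injEq] at hi; exact hi ▸ x.2

/-- At most `L` wires are listed. [folklore] -/
theorem card_listed_le {S : Finset κ} {L : ℕ} (f : Fin L → Option S) : (listed S f).card ≤ L := by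
  calc (listed S f).card ≤ ∑ i : Fin L, (((f i).map Subtype.val).toFinset).card := Finset.card_biUnion_le
    _ ≤ ∑ _i : Fin L, 1 := Finset.sum_le_sum fun i _ => card_toFinset_option_le _
    _ = L := by simp

/-- Every `t ⊆ S` with `#t ≤ L` is listed by some enumeration. [folklore] -/
theorem exists_listed_eq {S : Finset κ} {L : ℕ} (t : Finset κ) (ht : t ⊆ S) (hL : t.card ≤ L) :
    ∃ f : Fin L → Option S, listed S f = t := by
  let e : t ≃ Fin t.card := t.equivFin
  refine ⟨fun i => if h : (i : ℕ) < t.card then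
      some ⟨(e.symm ⟨i, h⟩ : t).1, ht (e.symm ⟨i, h⟩).2⟩ else none, ?_⟩
  ext w
  rw [mem_listed]
  constructor
  · rintro ⟨i, hi⟩
    by_cases h : (i : ℕ) < t.card
    · rw [dif_pos h] at hi
      simp only [Option.map_some, Option.some.injEq] at hi
      exact hi ▸ (e.symm ⟨i, h⟩).2
    · rw [dif_neg h] at hi
      simp at hi
  · intro hw
    refine ⟨Fin.castLE hL (e ⟨w, hw⟩), ?_⟩
    have h : ((Fin.castLE hL (e ⟨w, hw⟩) : Fin L) : ℕ) < t.card := by simp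
    rw [dif_pos h]
    simp only [Option.map_some, Option.some.injEq]
    have : (⟨((Fin.castLE hL (e ⟨w, hw⟩) : Fin L) : ℕ), h⟩ : Fin t.card) = e ⟨w, hw⟩ := Fin.ext (by simp)
    rw [this, Equiv.symm_apply_apply]

/-- Size of the gadget for an `L`-local map on `R` candidate wires: `(R+1)^L (L+2) + 1`. [folklore] -/
def localBound (R L : ℕ) : ℕ := (R + 1) ^ L * (L + 2) + 1

/-- `localBound` is monotone in `R`. [folklore] -/
theorem localBound_mono_left {R R' : ℕ} (h : R ≤ R') (L : ℕ) : localBound R L ≤ localBound R' L := by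
  unfold localBound
  gcongr

/-- **Wire-local monotone maps are polynomial monotone DNFs.** If `h` is monotone and every accepted `y`
contains an accepted sub-selection `t ⊆ S` of at most `L` wires, then `h` has a `{∧₂,∨₂,0,1}`-program with
`≤ (#S + 1)^L (L + 2) + 1` gates: the OR, over the accepted enumerations `f : Fin L → Option S`, of the AND
of the listed wires. [folklore] -/
theorem cktSize_of_wireLocal (h : (κ → Bool) → Bool) (hmono : Monotone h) (S : Finset κ) (L : ℕ)
    (hloc : ∀ y, h y = true → ∃ t : Finset κ, t ⊆ S ∧ t.card ≤ L ∧ (∀ w ∈ t, y w = true) ∧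
      h (fun w => decide (w ∈ t)) = true) :
    CktSize monotoneBasis01 (fun y (_ : Unit) => h y) (localBound S.card L) := by
  classical
  let Acc := {f : Fin L → Option S // h (fun w => decide (w ∈ listed S f)) = true}
  set M := Fintype.card Acc with hM
  let e : Acc ≃ Fin M := Fintype.equivFin Acc
  let term : Fin M → List κ := fun i => (listed S (e.symm i).1).toList
  have hterm : ∀ i, (term i).length ≤ L := fun i => by
    simp only [term, Finset.length_toList]
    exact card_listed_le _
  have hdnf := cktSize_dnf term hterm
  have hMle : M ≤ (S.card + 1) ^ L := by
    calc M ≤ Fintype.card (Fin L → Option S) := Fintype.card_subtype_le _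
      _ = (S.card + 1) ^ L := by
          rw [Fintype.card_fun, Fintype.card_option, Fintype.card_coe, Fintype.card_fin]
  refine (hdnf.of_le (by unfold localBound; gcongr)).congr fun y _ => ?_
  -- correctness of the DNF
  rw [Bool.eq_iff_iff, decide_eq_true_iff]
  constructor
  · rintro ⟨i, hi⟩
    rw [List.all_eq_true] at hi
    have hle : (fun w => decide (w ∈ listed S (e.symm i).1)) ≤ y := fun w => by
      by_cases hw : w ∈ listed S (e.symm i).1
      · have := hi w (Finset.mem_toList.2 hw)
        simp [hw, this]
      · simp [hw]
    exact eq_true_of_le_of_eq_true (hmono hle) (e.symm i).2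
  · intro hy
    obtain ⟨t, htS, htL, hty, ht⟩ := hloc y hy
    obtain ⟨f, hf⟩ := exists_listed_eq t htS htL
    have hacc : h (fun w => decide (w ∈ listed S f)) = true := by rw [hf]; exact ht
    refine ⟨e ⟨f, hacc⟩, ?_⟩
    rw [List.all_eq_true]
    intro w hw
    simp only [term, Equiv.symm_apply_apply, Finset.mem_toList, hf] at hw
    exact hty w hw

end LocalGadget

/-! ## §12 STRENGTHENING S₃ — PERM/GRANK gates of FIXED width `s₀` (any fan-in) plus any wide gates of
fan-in `≤ k`: FALSE for every `s₀, k` (locality ⇒ polynomial DNF gadgets ⇒ Tardos gap) -/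

section FixedWidth

variable {ι : Type*}

/-- Position-locality of a monotone gate transfers to WIRE-locality by monotonicity: the image of a small
accepted position set is a small accepted wire set. [folklore] -/
theorem wireLocal_of_posLocal [DecidableEq ι] (g : Gate ι) (hmono : Monotone g.op) {L : ℕ}
    (hpos : ∀ z : Fin g.arity → Bool, g.op z = true →
      ∃ t₀ : Finset (Fin g.arity), t₀.card ≤ L ∧ (∀ a ∈ t₀, z a = true) ∧
        g.op (fun a => decide (a ∈ t₀)) = true)
    (S : Finset (ι ⊕ ℕ)) (hS : ∀ a, g.args a ∈ S) (y : ι ⊕ ℕ → Bool)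
    (hy : g.op (fun a => y (g.args a)) = true) :
    ∃ t : Finset (ι ⊕ ℕ), t ⊆ S ∧ t.card ≤ L ∧ (∀ w ∈ t, y w = true) ∧
      g.op (fun a => decide (g.args a ∈ t)) = true := by
  obtain ⟨t₀, hL, hon, hacc⟩ := hpos _ hy
  refine ⟨t₀.image g.args, ?_, Finset.card_image_le.trans hL, ?_, ?_⟩
  · intro w hw
    obtain ⟨a, -, rfl⟩ := Finset.mem_image.1 hw
    exact hS a
  · intro w hw
    obtain ⟨a, ha, rfl⟩ := Finset.mem_image.1 hw
    exact hon a ha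
  · refine eq_true_of_le_of_eq_true (hmono fun a => ?_) hacc
    by_cases ha : a ∈ t₀
    · simp [ha, Finset.mem_image_of_mem g.args ha]
    · simp [ha]

/-- Any gate of arity `≤ L` is `L`-local in positions. [folklore] -/
theorem posLocal_of_arity_le (g : Gate ι) {L : ℕ} (hL : g.arity ≤ L) (z : Fin g.arity → Bool)
    (hz : g.op z = true) :
    ∃ t₀ : Finset (Fin g.arity), t₀.card ≤ L ∧ (∀ a ∈ t₀, z a = true) ∧
      g.op (fun a => decide (a ∈ t₀)) = true := by
  refine ⟨Finset.univ.filter fun a => z a = true, ?_, fun a ha => (Finset.mem_filter.1 ha).2, ?_⟩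
  · refine (Finset.card_filter_le _ _).trans ?_
    rw [Finset.card_univ, Fintype.card_fin]
    exact hL
  · convert hz using 2
    ext a
    simp

/-- The target basis of strengthening S₃ at size parameter `N`: `∧₂, ∨₂`, CONV gates of width `≤ N` but
fan-in `≤ k`, and PERM / GRANK gates of FIXED width `s₀` (any fan-in). [folklore] -/
def fixedWidthBasis (s₀ k N : ℕ) : Set GateFn :=
  {g | g = GateFn.and 2 ∨ g = GateFn.or 2 ∨ (IsConvGate N g ∧ g.1 ≤ k) ∨ IsPermGate s₀ g ∨
    IsGRankGate s₀ g}

/-- Every gate of the S₃ basis is monotone. [folklore] -/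
theorem monotone_of_mem_fixedWidthBasis {s₀ k N : ℕ} {g : GateFn} (hg : g ∈ fixedWidthBasis s₀ k N) :
    Monotone g.2 := by
  rcases hg with rfl | rfl | ⟨h, -⟩ | h | h
  · exact GateFn.and_monotone 2
  · exact GateFn.or_monotone 2
  · exact h.monotone
  · exact h.monotone
  · exact h.monotone

/-- Every gate of the S₃ basis is `(k + s₀! + s₀ + 2)`-local in positions. [folklore] -/
theorem posLocal_of_mem_fixedWidthBasis {s₀ k N : ℕ} (g : Gate ι)
    (hg : g.fn ∈ fixedWidthBasis s₀ k N) (z : Fin g.arity → Bool) (hz : g.op z = true) :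
    ∃ t₀ : Finset (Fin g.arity), t₀.card ≤ k + s₀.factorial + s₀ + 2 ∧ (∀ a ∈ t₀, z a = true) ∧
      g.op (fun a => decide (a ∈ t₀)) = true := by
  rcases hg with h | h | ⟨-, hk⟩ | h | h
  · exact posLocal_of_arity_le g (by rw [show g.arity = 2 from congrArg Sigma.fst h]; omega) z hz
  · exact posLocal_of_arity_le g (by rw [show g.arity = 2 from congrArg Sigma.fst h]; omega) z hz
  · exact posLocal_of_arity_le g (le_trans hk (by omega)) z hz
  · obtain ⟨t, ht, hon, hacc⟩ := IsPermGate.local h z hz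
    have h1 : t.card ≤ s₀.factorial := (Nat.lt_two_pow_self).le.trans ht
    exact ⟨t, le_trans h1 (by omega), hon, hacc⟩
  · obtain ⟨t, ht, hon, hacc⟩ := IsGRankGate.local h z hz
    exact ⟨t, le_trans ht (by omega), hon, hacc⟩

/-- STRENGTHENING S₃ of the crux: capture into `fixedWidthBasis s₀ k N`. [folklore] -/
def CaptureFixedWidth (s₀ k : ℕ) : Prop :=
  ∃ a : ℕ, ∀ (ι : Type) (_ : Fintype ι) (f : (ι → Bool) → Bool), Monotone f →
    ∀ C : Circuit ι, C.IsOver B2 → C.Computes f →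
      ∃ C' : Circuit ι, C'.IsOver (fixedWidthBasis s₀ k ((C.size + Fintype.card ι + 2) ^ a)) ∧
        C'.size ≤ (C.size + Fintype.card ι + 2) ^ a ∧ C'.Computes f

/-- The wires available to a well-formed program: inputs and its own gates. [folklore] -/
theorem args_mem_wireSet [Fintype ι] [DecidableEq ι] (C : Circuit ι) {g : Gate ι} (hg : g ∈ C.gates)
    (a : Fin g.arity) :
    g.args a ∈ (Finset.univ.image Sum.inl ∪ (Finset.range C.size).image Sum.inr : Finset (ι ⊕ ℕ)) := by
  obtain ⟨j, hj, rfl⟩ := List.mem_iff_getElem.1 hg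
  rcases h : (C.gates[j]).args a with i | m
  · exact Finset.mem_union_left _ (Finset.mem_image_of_mem _ (Finset.mem_univ i))
  · refine Finset.mem_union_right _ (Finset.mem_image_of_mem _ (Finset.mem_range.2 ?_))
    exact (C.wf j hj a m h).trans hj

/-- Size of that wire set: `≤ |ι| + size`. [folklore] -/
theorem card_wireSet_le [Fintype ι] [DecidableEq ι] (C : Circuit ι) :
    (Finset.univ.image Sum.inl ∪ (Finset.range C.size).image Sum.inr : Finset (ι ⊕ ℕ)).card ≤
      Fintype.card ι + C.size :=
  (Finset.card_union_le _ _).trans (add_le_add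
    (Finset.card_image_le.trans (by rw [Finset.card_univ]))
    (Finset.card_image_le.trans (by rw [Finset.card_range])))

/-- Size bookkeeping for S₃: `1 + localBound (n + M^a) L · M^a ≤ (v + t)^{3((a+1)L + a) + 1}` for
`M = t + n + 2`, `n ≤ v²`, `v ≥ L + 4`. [folklore] -/
theorem size_bookkeeping_fixed {v t n a L : ℕ} (hv : 2 ≤ v) (hvL : L + 4 ≤ v) (hn : n ≤ v ^ 2) :
    1 + localBound (n + (t + n + 2) ^ a) L * (t + n + 2) ^ a ≤
      (v + t) ^ (3 * ((a + 1) * L + a) + 1) := by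
  set M := t + n + 2 with hMdef
  have hM1 : 1 ≤ M := by omega
  have hMa : 1 ≤ M ^ a := Nat.one_le_pow _ _ hM1
  have hM3 : M ≤ (v + t) ^ 3 := by
    have := size_bookkeeping (t := t) hv
    omega
  have hR : n + M ^ a + 1 ≤ M ^ (a + 1) := by
    have h2 : (n + 2) * M ^ a ≤ M * M ^ a := Nat.mul_le_mul_right _ (by omega)
    rw [pow_succ']
    nlinarith [h2, hMa]
  set e := (a + 1) * L + a with he
  have hpow : (M ^ (a + 1)) ^ L * M ^ a = M ^ e := by rw [← pow_mul, ← pow_add]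
  have hMe : 1 ≤ M ^ e := Nat.one_le_pow _ _ hM1
  have hMae : M ^ a ≤ M ^ e := Nat.pow_le_pow_right hM1 (Nat.le_add_left _ _)
  calc 1 + localBound (n + M ^ a) L * M ^ a
      ≤ 1 + ((M ^ (a + 1)) ^ L * (L + 2) + 1) * M ^ a := by unfold localBound; gcongr
    _ = 1 + ((M ^ (a + 1)) ^ L * M ^ a * (L + 2) + M ^ a) := by ring
    _ = 1 + (M ^ e * (L + 2) + M ^ a) := by rw [hpow]
    _ ≤ M ^ e + (M ^ e * (L + 2) + M ^ e) := by gcongr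
    _ = (L + 4) * M ^ e := by ring
    _ ≤ (v + t) * ((v + t) ^ 3) ^ e := Nat.mul_le_mul (by omega) (Nat.pow_le_pow_left hM3 e)
    _ = (v + t) ^ (3 * e + 1) := by rw [← pow_mul, ← pow_succ']

/-- **STRENGTHENING S₃ is FALSE for every `s₀, k`.** PERM and GRANK gates of a FIXED width `s₀` — of any
fan-in — together with `∧₂, ∨₂` and CONV gates of fan-in `≤ k` cannot capture monotone P/poly: every
such gate is `L`-local for the constant `L = k + s₀! + s₀ + 2` (§4, §5), hence a `{∧₂,∨₂,0,1}`-gadget of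
size `localBound (n + N) L`, polynomial in `N` (§11); rebase (§6), eliminate constants, and the Tardos gap
(`not_monotoneTransfer_pow_holds`) refutes the resulting polynomial transfer. So any proof of `Capture`
must use PERM/GRANK gates of GROWING width or CONV gates of unbounded fan-in — the width parameter
`(t+n+2)^a` inside `Ext` is load-bearing for the linear-algebra gates, not only for CONV. [folklore] -/
theorem not_captureFixedWidth (s₀ k : ℕ) : ¬ CaptureFixedWidth s₀ k := by
  classical
  rintro ⟨a, h⟩
  set L := k + s₀.factorial + s₀ + 2 with hL
  refine not_monotoneTransfer_pow_holds (3 * ((a + 1) * L + a) + 1) ?_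
  filter_upwards [eventually_ge_atTop (L + 4)] with v hv f hf C hB hC
  obtain ⟨C', h1, h2, h3⟩ := h _ inferInstance f hf C (hB.mono deMorganBasis_subset_B2) hC
  set n := Fintype.card ((⊤ : SimpleGraph (Fin v)).edgeSet) with hn
  set N := (C.size + n + 2) ^ a with hN
  let S : Finset (((⊤ : SimpleGraph (Fin v)).edgeSet) ⊕ ℕ) :=
    Finset.univ.image Sum.inl ∪ (Finset.range C'.size).image Sum.inr
  have hScard : S.card ≤ n + N := (card_wireSet_le C').trans (by omega)
  -- rebase `C'` gate by gate into `{∧₂,∨₂,0,1}` through the locality gadgets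
  obtain ⟨C'', hB'', hs'', he''⟩ := Circuit.rebase' (const_mem_monotoneBasis01 false)
    (localBound (n + N) L) C' fun g hg => by
      have hgB := h1 g hg
      have hmono : Monotone g.op := monotone_of_mem_fixedWidthBasis hgB
      refine (cktSize_of_wireLocal (fun y => g.op fun a => y (g.args a))
        (fun y y' hyy' => hmono fun a => hyy' (g.args a)) S L ?_).of_le (localBound_mono_left hScard L)
      exact wireLocal_of_posLocal g hmono (posLocal_of_mem_fixedWidthBasis g hgB) S
        (args_mem_wireSet C' hg)
  -- eliminate the constants
  rcases const_or_exists_monotone_circuit C''.gates C''.output (wf_gates C'') hB'' C''.wf_output with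
    ⟨b, hb⟩ | ⟨D, hDB, hDs, hDe⟩
  · have hfb : f = fun _ => b := funext fun x => by rw [← h3 x, ← he'' x, circuit_eval, hb x]
    rw [hfb, circuitSizeOver_monotoneBasis_const]
    exact Nat.zero_le _
  · calc circuitSizeOver monotoneBasis f ≤ D.size :=
          circuitSizeOver_le_of_computes D hDB fun x => by rw [hDe, ← circuit_eval, he'', h3]
      _ ≤ C''.size := hDs
      _ ≤ 1 + localBound (n + N) L * C'.size := hs''
      _ ≤ 1 + localBound (n + N) L * N := by gcongr
      _ ≤ (v + C.size) ^ (3 * ((a + 1) * L + a) + 1) :=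
          size_bookkeeping_fixed (by omega) hv (card_edgeSet_top_le v)

end FixedWidth

/-! ## §13 Normal form for provers and refuters alike: it suffices to treat `ι = Fin n` -/

section FinNormalForm

variable {ι ι' : Type*}

/-- A circuit is a straight-line program realising its own function (the converse of
`CktSize.toCircuit`). [folklore] -/
theorem CktSize.ofCircuit {B : Set GateFn} (C : Circuit ι) (hB : C.IsOver B) :
    CktSize B (fun x (_ : Unit) => C.eval x) C.size :=
  ⟨C.gates, fun _ => C.output, le_rfl,
    ⟨wf_gates C, hB, fun _ m hm => C.wf_output m hm, fun x _ => (circuit_eval C x).symm⟩⟩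

/-- Transport of circuits along a map of variables: a circuit over `B` on variables `ι` computing
`f` yields one on variables `ι'` computing `x' ↦ f (x' ∘ e)`, of no greater size. [folklore] -/
theorem Circuit.exists_rewire {B : Set GateFn} (C : Circuit ι) (hB : C.IsOver B)
    {f : (ι → Bool) → Bool} (hf : C.Computes f) (e : ι → ι') :
    ∃ C' : Circuit ι', C'.IsOver B ∧ C'.size ≤ C.size ∧ C'.Computes fun x' => f fun i => x' (e i) := by
  obtain ⟨C', hB', hs, hC'⟩ := ((CktSize.ofCircuit C hB).rewire e).toCircuit
  exact ⟨C', hB', hs, fun x' => by rw [hC' x', hf]⟩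

/-- `Capture` restricted to the variable types `Fin n`. [folklore] -/
def CaptureFin : Prop :=
  ∃ a : ℕ, ∀ (n : ℕ) (f : (Fin n → Bool) → Bool), Monotone f →
    ∀ C : Circuit (Fin n), C.IsOver B2 → C.Computes f →
      ∃ C' : Circuit (Fin n), C'.IsOver (extGate ((C.size + n + 2) ^ a)) ∧
        C'.size ≤ (C.size + n + 2) ^ a ∧ C'.Computes f

/-- **Normal form.** `Capture` is equivalent to its restriction to `ι = Fin n` (transport along
`Fintype.equivFin`; sizes are preserved, `|ι| = n`). So provers may construct the simulating circuit on
`Fin n`, and refuters may look for counterexamples there. [folklore] -/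
theorem capture_iff_captureFin : Capture ↔ CaptureFin := by
  have hExt : ∀ s : ℕ, ({g : GateFn | g = GateFn.and 2 ∨ g = GateFn.or 2 ∨ IsConvGate s g ∨
      IsPermGate s g ∨ IsGRankGate s g}) = extGate s := fun s => by
    ext g; rw [mem_extGate_iff]; rfl
  unfold Capture CaptureFin
  simp only []
  constructor
  · rintro ⟨a, h⟩
    refine ⟨a, fun n f hf C hB hC => ?_⟩
    obtain ⟨C', h1, h2, h3⟩ := h (Fin n) inferInstance f hf C hB hC
    rw [Fintype.card_fin] at h1 h2
    exact ⟨C', by rw [← hExt]; exact h1, h2, h3⟩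
  · rintro ⟨a, h⟩
    refine ⟨a, fun ι _ f hf C hB hC => ?_⟩
    classical
    set n := Fintype.card ι
    let e : ι ≃ Fin n := Fintype.equivFin ι
    -- transport the `B₂`-circuit to `Fin n`
    let f' : (Fin n → Bool) → Bool := fun y => f fun i => y (e i)
    have hf' : Monotone f' := fun y y' hyy' => hf fun i => hyy' (e i)
    obtain ⟨D, hDB, hDs, hDc⟩ := Circuit.exists_rewire C hB hC e
    obtain ⟨D', h1, h2, h3⟩ := h n f' hf' D hDB hDc
    -- transport the extended circuit back to `ι`
    obtain ⟨C', hC'B, hC's, hC'c⟩ := Circuit.exists_rewire D' h1 h3 e.symm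
    have hmono : extGate ((D.size + n + 2) ^ a) ⊆ extGate ((C.size + n + 2) ^ a) :=
      extGate_mono (Nat.pow_le_pow_left (by omega) a)
    refine ⟨C', ?_, hC's.trans (h2.trans (Nat.pow_le_pow_left (by omega) a)), fun x => ?_⟩
    · rw [← hExt ((C.size + n + 2) ^ a)] at hmono
      exact fun g hg => hmono (hC'B g hg)
    · rw [hC'c x]
      show f (fun i => x (e.symm (e i))) = f x
      simp

end FinNormalForm

/-! ## §14 The PERM door revisited: the order obstruction is NOT a lower bound (`Th₂⁶ ∈ PERM₅`), block
normal form (several generators per wire = size-one circuit), and the Myhill–Nerode chain invariant -/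

section PermThreshold

open Equiv

/-- The 5-cycle `0 ↦ 1 ↦ a ↦ b ↦ c ↦ 0` of `Fin 5`. [folklore] -/
def cyc5 (a b c : Fin 5) : Perm (Fin 5) := swap 0 1 * swap 1 a * swap a b * swap b c

/-- One 5-cycle out of each of the six Sylow 5-subgroups of `A₅` (the six orderings of `{2,3,4}`
after `0 ↦ 1`). [folklore] -/
def sylow5 : Fin 6 → Perm (Fin 5) :=
  ![cyc5 2 3 4, cyc5 2 4 3, cyc5 3 2 4, cyc5 3 4 2, cyc5 4 2 3, cyc5 4 3 2]

/-- The target 3-cycle `(0 1 2)`. [folklore] -/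
def tau3 : Perm (Fin 5) := swap 0 1 * swap 1 2

/-- The product of a word in two letters `a` (`true`) and `b` (`false`). [folklore] -/
def wordProd {G : Type*} [Monoid G] (a b : G) : List Bool → G
  | [] => 1
  | c :: w => (if c then a else b) * wordProd a b w

/-- A word in `a, b` lies in the subgroup they generate. [folklore] -/
theorem wordProd_mem_closure {G : Type*} [Group G] (a b : G) :
    ∀ w : List Bool, wordProd a b w ∈ Subgroup.closure ({a, b} : Set G)
  | [] => Subgroup.one_mem _
  | c :: w => by
    refine Subgroup.mul_mem _ ?_ (wordProd_mem_closure a b w)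
    cases c
    · exact Subgroup.subset_closure (Set.mem_insert_of_mem _ (Set.mem_singleton _))
    · exact Subgroup.subset_closure (Set.mem_insert _ _)

/-- Words expressing `(0 1 2)` in each ordered pair of distinct Sylow representatives (breadth-first
search, lengths `≤ 7`; row `i`, column `j` is a word in `a = sylow5 i`, `b = sylow5 j`). [folklore] -/
def pairWord : Fin 6 → Fin 6 → List Bool :=
  ![![[], [true, true, false, true, true], [true, true, true, false, true], [false, false, true, true],
      [false, false, false, true, false], [true, false, true, false]],
    ![[true, true, false, true, true], [], [false, false, false, true, false], [true, false, true, false],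
      [true, true, true, false, true], [false, false, true, true]],
    ![[false, false, false, true, false], [true, true, true, false, true], [],
      [false, true, false, false, false], [true, true, false, false, false, true, true],
      [true, false, true, true, true]],
    ![[true, true, false, false], [false, true, false, true], [true, false, true, true, true], [],
      [false, true, false, false, false], [true, true, false, true, true]],
    ![[true, true, true, false, true], [false, false, false, true, false],
      [true, true, false, false, false, true, true], [true, false, true, true, true], [],
      [false, true, false, false, false]],
    ![[false, true, false, true], [true, true, false, false], [false, true, false, false, false],
      [true, true, false, true, true], [true, false, true, true, true], []]]

set_option maxRecDepth 100000 in
/-- Every two distinct Sylow representatives generate the 3-cycle `(0 1 2)` (in fact all of `A₅`: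
two distinct Sylow 5-subgroups lie in no common maximal subgroup `A₄`, `D₁₀`, `S₃`). [folklore] -/
theorem wordProd_pairWord : ∀ i j : Fin 6, i ≠ j →
    wordProd (sylow5 i) (sylow5 j) (pairWord i j) = tau3 := by
  intro i j h
  fin_cases i <;> fin_cases j <;> first | exact absurd rfl h | decide

/-- The representatives have order `5`. [folklore] -/
theorem sylow5_pow_five : ∀ i : Fin 6, sylow5 i ^ 5 = 1 := by decide

/-- … and none of their powers is the 3-cycle. [folklore] -/
theorem sylow5_pow_ne_tau3 : ∀ (i : Fin 6) (r : Fin 5), sylow5 i ^ (r : ℕ) ≠ tau3 := by decide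

/-- `(0 1 2) ∈ ⟨σᵢ, σⱼ⟩` for `i ≠ j`. [folklore] -/
theorem tau3_mem_closure_pair {i j : Fin 6} (h : i ≠ j) :
    tau3 ∈ Subgroup.closure ({sylow5 i, sylow5 j} : Set (Perm (Fin 5))) := by
  rw [← wordProd_pairWord i j h]
  exact wordProd_mem_closure _ _ _

/-- `(0 1 2) ∉ ⟨σᵢ⟩` (a group of order `5`). [folklore] -/
theorem tau3_not_mem_closure_singleton (i : Fin 6) :
    tau3 ∉ Subgroup.closure ({sylow5 i} : Set (Perm (Fin 5))) := by
  rw [Subgroup.mem_closure_singleton]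
  rintro ⟨n, hn⟩
  rw [zpow_eq_zpow_emod' n (sylow5_pow_five i)] at hn
  have h0 : 0 ≤ n % ((5 : ℕ) : ℤ) := Int.emod_nonneg _ (by norm_num)
  have h5 : n % ((5 : ℕ) : ℤ) < 5 := Int.emod_lt_of_pos _ (by norm_num)
  obtain ⟨r, hr⟩ : ∃ r : ℕ, (r : ℤ) = n % ((5 : ℕ) : ℤ) := ⟨_, Int.toNat_of_nonneg h0⟩
  rw [← hr, zpow_natCast] at hn
  have hr5 : r < 5 := by omega
  exact sylow5_pow_ne_tau3 i ⟨r, hr5⟩ hn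

/-- `(0 1 2) ≠ 1`. [folklore] -/
theorem tau3_ne_one : tau3 ≠ 1 := by decide

/-- **`Th₂⁶` is ONE PERM gate on `5` points** (so is LIN-UNSAT over `ℤ/P` in one unknown with the six
equations `y = 0, …, y = 5`, for EVERY prime `P ≥ 7` — a "mod-`P` behaviour" that no homomorphic image
of `ℤ/P` inside `Sym(5)` could produce, cf. §3): wire `i` switches on a 5-cycle `σᵢ` of the `i`-th
Sylow 5-subgroup of `A₅`, target `τ = (0 1 2)`; one Sylow subgroup has order `5 ∌ τ`, two distinct
ones generate `A₅ ∋ τ`. The order obstruction `no_zmod_primePow_embedding` is therefore NOT a one-gate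
lower bound: PERM gates compute through PAIRWISE GENERATION, and pairwise-generating families in `Sym(d)`
have size exponential in `d` (Blackburn 2006: `2^{d-1}` for large odd... cliques of the generating graph),
so `Th₂ⁿ ∈ PERM_{O(log n)}`. [folklore] -/
theorem thr_six_two_isPermGate : IsPermGate 5 (GateFn.thr 6 2) := by
  refine ⟨5, le_rfl, sylow5, tau3, fun v => ?_⟩
  show decide (2 ≤ GateFn.numOnes v) = true ↔ _
  rw [decide_eq_true_iff]
  constructor
  · intro h2
    obtain ⟨i, hi, j, hj, hij⟩ := Finset.one_lt_card.1 (show 1 < GateFn.numOnes v from h2)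
    simp only [Finset.mem_filter, Finset.mem_univ, true_and] at hi hj
    refine Subgroup.closure_mono ?_ (tau3_mem_closure_pair hij)
    intro x hx
    simp only [Set.mem_insert_iff, Set.mem_singleton_iff] at hx
    rcases hx with rfl | rfl
    · exact ⟨i, hi, rfl⟩
    · exact ⟨j, hj, rfl⟩
  · intro hmem
    by_contra h2
    -- at most one wire is on: the on-set lies inside a singleton `{i₀}`
    obtain ⟨i₀, hi₀⟩ : ∃ i₀ : Fin 6, {i : Fin 6 | v i = true} ⊆ {i₀} := by
      by_cases hex : ∃ i, v i = true
      · obtain ⟨i, hi⟩ := hex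
        refine ⟨i, fun j hj => ?_⟩
        by_contra hji
        refine h2 (Finset.one_lt_card.2 ⟨j, ?_, i, ?_, hji⟩)
        · simpa [GateFn.numOnes] using hj
        · simpa [GateFn.numOnes] using hi
      · refine ⟨0, fun j hj => absurd ⟨j, hj⟩ hex⟩
    have hsub : sylow5 '' {i : Fin 6 | v i = true} ⊆ {sylow5 i₀} := by
      rintro _ ⟨j, hj, rfl⟩
      rw [Set.mem_singleton_iff, Set.mem_singleton_iff.1 (hi₀ hj)]
    exact tau3_not_mem_closure_singleton i₀ (Subgroup.closure_mono hsub hmem)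

end PermThreshold

/-! ### §14.1 Block normal form: one PERM gate with several generators per wire = a size-one circuit -/

section BlockPerm

open Equiv

/-- **Block PERM gates**: wire `i` switches on a whole subgroup `P i ≤ Sym(d)` (equivalently: several
generators), target `τ`; the gate fires iff `τ ∈ ⨆_{vᵢ = 1} P i` — a JOIN condition in the subgroup
lattice. This is the semilattice normal form of the PERM door: `v ↦ ⨆_{vᵢ=1} P i` is a join-homomorphism
`(2^{[n]}, ∪) → Sub(Sym d)` and the gate is the principal filter `{H | τ ∈ H}` after it. [folklore] -/
def IsBlockPermGate (s : ℕ) (g : GateFn) : Prop :=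
  ∃ d : ℕ, d ≤ s ∧ ∃ (P : Fin g.1 → Subgroup (Perm (Fin d))) (τ : Perm (Fin d)),
    ∀ v : Fin g.1 → Bool, g.2 v = true ↔ τ ∈ ⨆ i ∈ {i | v i = true}, P i

/-- The subgroup generated by an indexed image is the join of the cyclic pieces. [folklore] -/
theorem closure_image_eq_iSup {α G : Type*} [Group G] (σ : α → G) (S : Set α) :
    Subgroup.closure (σ '' S) = ⨆ i ∈ S, Subgroup.closure ({σ i} : Set G) := by
  apply le_antisymm
  · rw [Subgroup.closure_le]
    rintro _ ⟨i, hi, rfl⟩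
    exact Subgroup.mem_iSup_of_mem i
      (Subgroup.mem_iSup_of_mem hi (Subgroup.subset_closure (Set.mem_singleton _)))
  · refine iSup₂_le fun i hi => (Subgroup.closure_le _).2 ?_
    rintro _ ⟨⟩
    exact Subgroup.subset_closure ⟨i, hi, rfl⟩

/-- Every PERM gate is a block PERM gate (cyclic blocks). [folklore] -/
theorem IsPermGate.isBlockPermGate {s : ℕ} {g : GateFn} (h : IsPermGate s g) :
    IsBlockPermGate s g := by
  obtain ⟨d, hd, σ, τ, hiff⟩ := h
  refine ⟨d, hd, fun i => Subgroup.closure {σ i}, τ, fun v => ?_⟩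
  rw [hiff, closure_image_eq_iSup]

/-- The join over the switched-on blocks is generated by the switched-on block ELEMENTS. [folklore] -/
theorem iSup_eq_closure_iUnion {n d : ℕ} (P : Fin n → Subgroup (Perm (Fin d))) (v : Fin n → Bool) :
    (⨆ i ∈ {i | v i = true}, P i) =
      Subgroup.closure (⋃ i ∈ {i : Fin n | v i = true}, (P i : Set (Perm (Fin d)))) := by
  rw [Subgroup.closure_iUnion]
  refine iSup_congr fun i => ?_
  rw [Subgroup.closure_iUnion]
  refine iSup_congr fun _ => ?_
  rw [Subgroup.closure_eq]

/-- **Blocks cost nothing at the circuit level**: a block PERM gate of width `s` is computed by a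
size-ONE circuit whose single gate is an honest `PERM_s` gate reading each input wire repeatedly (one
position per element of the block). So provers may design PERM gadgets with arbitrarily many generators
per wire (e.g. the annihilator blocks of an abelian coset constraint, Stub 3a of the line
`csp-spine-meet-to-join`) and still land ONE gate. [folklore] -/
theorem IsBlockPermGate.exists_size_one {s : ℕ} {g : GateFn} (h : IsBlockPermGate s g) :
    ∃ C : Circuit (Fin g.1), C.IsOver {g' | IsPermGate s g'} ∧ C.size ≤ 1 ∧ C.Computes g.2 := by
  classical
  obtain ⟨d, hd, P, τ, hiff⟩ := h
  -- positions: pairs (wire, element of its block)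
  let Pos := Σ i : Fin g.1, P i
  let e : Pos ≃ Fin (Fintype.card Pos) := Fintype.equivFin Pos
  let σ' : Fin (Fintype.card Pos) → Perm (Fin d) := fun a => ((e.symm a).2 : Perm (Fin d))
  let w : Fin (Fintype.card Pos) → Fin g.1 := fun a => (e.symm a).1
  let g' : GateFn := ⟨Fintype.card Pos, fun u => decide (τ ∈ Subgroup.closure (σ' '' {a | u a = true}))⟩
  have hg' : IsPermGate s g' := ⟨d, hd, σ', τ, fun u => by simp [g']⟩
  obtain ⟨C, hB, hs, hev⟩ := (CktSize.gate (B := {g' | IsPermGate s g'}) g' hg' w).toCircuit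
  refine ⟨C, hB, hs, fun x => ?_⟩
  rw [hev x]
  show decide (τ ∈ Subgroup.closure (σ' '' {a | x (w a) = true})) = g.2 x
  have key : Subgroup.closure (σ' '' {a | x (w a) = true}) = ⨆ i ∈ {i | x i = true}, P i := by
    rw [iSup_eq_closure_iUnion]
    congr 1
    ext p
    simp only [Set.mem_image, Set.mem_setOf_eq, Set.mem_iUnion, SetLike.mem_coe, exists_prop]
    constructor
    · rintro ⟨a, ha, rfl⟩
      exact ⟨w a, ha, (e.symm a).2.2⟩
    · rintro ⟨i, hi, hp⟩
      refine ⟨e ⟨i, ⟨p, hp⟩⟩, ?_, ?_⟩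
      · show x (e.symm (e ⟨i, ⟨p, hp⟩⟩)).1 = true
        rw [Equiv.symm_apply_apply]; exact hi
      · show ((e.symm (e ⟨i, ⟨p, hp⟩⟩)).2 : Perm (Fin d)) = p
        rw [Equiv.symm_apply_apply]
  rw [key]
  cases hx : g.2 x
  · rw [decide_eq_false_iff_not]
    intro hmem
    rw [← hiff] at hmem
    rw [hmem] at hx
    exact Bool.noConfusion hx
  · rw [decide_eq_true_iff]
    exact (hiff x).1 hx

/-- In particular a block PERM gate of width `s` is a size-one circuit over `B_s`. [folklore] -/
theorem IsBlockPermGate.exists_size_one_extGate {s : ℕ} {g : GateFn} (h : IsBlockPermGate s g) :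
    ∃ C : Circuit (Fin g.1), C.IsOver (extGate s) ∧ C.size ≤ 1 ∧ C.Computes g.2 := by
  obtain ⟨C, hB, hs, hC⟩ := h.exists_size_one
  exact ⟨C, hB.mono fun g' hg' => IsPermGate.mem_extGate hg', hs, hC⟩

/-! ### §14.3 The Myhill–Nerode chain invariant of (block) PERM gates -/

/-- The indicator vector of a finset of wires. [folklore] -/
def ind {n : ℕ} (A : Finset (Fin n)) : Fin n → Bool := fun j => decide (j ∈ A)

/-- The join over a union of selections is the join of the joins. [folklore] -/
theorem iSup_ind_union {n d : ℕ} (P : Fin n → Subgroup (Perm (Fin d))) (A B : Finset (Fin n)) :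
    (⨆ i ∈ {i | ind (A ∪ B) i = true}, P i) =
      (⨆ i ∈ {i | ind A i = true}, P i) ⊔ ⨆ i ∈ {i | ind B i = true}, P i := by
  have hset : {i | ind (A ∪ B) i = true} = {i | ind A i = true} ∪ {i | ind B i = true} := by
    ext i; simp [ind]
  rw [hset, _root_.iSup_union]

/-- **Chain invariant (Myhill–Nerode for PERM).** If a block PERM gate of width `s` has nested
selections `S₀ ⊆ S₁ ⊆ ⋯ ⊆ S_L` such that each consecutive pair is DISTINGUISHABLE by some common
extension `T` (the residual functions `T ↦ g(Sᵢ ∪ T)` differ), then the joins `⨆_{Sᵢ} P` form a strict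
chain of subgroups of `Sym(d)`, each step at least doubling the order (Lagrange): `2^L ≤ s!`, i.e.
`L ≤ log₂ s! < s log₂ s`. This is the general one-gate lower-bound tool behind `perm_local` (§5: a
minterm is such a chain with `T = ∅`-type witnesses). What it yields for the third door: the residual
classes of LIN-UNSAT over `ℤ/2^k` in `D` unknowns are solution submodules, whose chains have length
`≤ k(D+1)` — so the invariant can never force `d` beyond `poly(k, D)`: a super-polynomial ONE-gate lower
bound for the door (if true at all) needs a lattice-embedding obstruction finer than chain length (e.g.
a coordinatisation argument for the submodule lattice of `(ℤ/2^k)^3` inside `Sub(Sym d)`), which is not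
in print. [folklore] -/
theorem IsBlockPermGate.two_pow_chain_le {s : ℕ} {g : GateFn} (h : IsBlockPermGate s g) {L : ℕ}
    (S : Fin (L + 1) → Finset (Fin g.1)) (hmono : ∀ i : Fin L, S i.castSucc ⊆ S i.succ)
    (hdist : ∀ i : Fin L, ∃ T : Finset (Fin g.1),
      g.2 (ind (S i.castSucc ∪ T)) ≠ g.2 (ind (S i.succ ∪ T))) :
    2 ^ L ≤ s.factorial := by
  classical
  obtain ⟨d, hd, P, τ, hiff⟩ := h
  let H : Fin (L + 1) → Subgroup (Perm (Fin d)) := fun i => ⨆ j ∈ {j | ind (S i) j = true}, P j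
  have hHmono : ∀ i : Fin L, H i.castSucc ≤ H i.succ := fun i => by
    refine iSup₂_le fun j hj => ?_
    have hj' : j ∈ {j | ind (S i.succ) j = true} := by
      simp only [Set.mem_setOf_eq, ind, decide_eq_true_eq] at hj ⊢
      exact hmono i hj
    exact le_iSup₂_of_le j hj' le_rfl
  have hHne : ∀ i : Fin L, H i.castSucc ≠ H i.succ := fun i heq => by
    obtain ⟨T, hT⟩ := hdist i
    apply hT
    have h1 : (⨆ j ∈ {j | ind (S i.castSucc ∪ T) j = true}, P j) =
        ⨆ j ∈ {j | ind (S i.succ ∪ T) j = true}, P j := by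
      rw [iSup_ind_union, iSup_ind_union]
      exact congrArg (· ⊔ _) heq
    rw [Bool.eq_iff_iff, hiff, hiff, h1]
  -- each strict step at least doubles the order
  have hstep : ∀ i : Fin L, 2 * Nat.card (H i.castSucc) ≤ Nat.card (H i.succ) := fun i => by
    obtain ⟨q, hq⟩ := Subgroup.card_dvd_of_le (hHmono i)
    have hq2 : 2 ≤ q := by
      rcases Nat.lt_or_ge q 2 with hlt | hge
      · interval_cases q
        · rw [mul_zero] at hq; exact absurd hq (Nat.card_pos (α := H i.succ)).ne'
        · rw [mul_one] at hq
          exact absurd (Subgroup.eq_of_le_of_card_ge (hHmono i) hq.le) (hHne i)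
      · exact hge
    calc 2 * Nat.card (H i.castSucc) = Nat.card (H i.castSucc) * 2 := mul_comm _ _
      _ ≤ Nat.card (H i.castSucc) * q := Nat.mul_le_mul_left _ hq2
      _ = Nat.card (H i.succ) := hq.symm
  have hind : ∀ m : ℕ, (hm : m ≤ L) → 2 ^ m ≤ Nat.card (H ⟨m, Nat.lt_succ_of_le hm⟩) := by
    intro m
    induction m with
    | zero => intro _; rw [pow_zero]; exact Nat.card_pos
    | succ m ih =>
      intro hm
      have := hstep ⟨m, hm⟩
      have ih' := ih (Nat.le_of_succ_le hm)
      simp only [Fin.castSucc_mk, Fin.succ_mk] at this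
      calc 2 ^ (m + 1) = 2 * 2 ^ m := by ring
        _ ≤ 2 * Nat.card (H ⟨m, _⟩) := Nat.mul_le_mul_left 2 ih'
        _ ≤ Nat.card (H ⟨m + 1, _⟩) := this
  calc 2 ^ L ≤ Nat.card (H ⟨L, Nat.lt_succ_self L⟩) := hind L le_rfl
    _ ≤ Nat.card (Perm (Fin d)) := Subgroup.card_le_card_group _
    _ = d.factorial := by rw [Nat.card_eq_fintype_card, Fintype.card_perm, Fintype.card_fin]
    _ ≤ s.factorial := Nat.factorial_le hd

end BlockPerm

/-! ## §15 POSITIVE BOUNDARY: `Capture` holds for slice functions (Berkowitz 1982), with target basis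
`{∧₂, ∨₂, 0, 1}` — no wide gate at all -/

section DoubleRail

variable {ι : Type*}

/-- The two rails of an input: `x` and `¬x` as one assignment of `ι ⊕ ι`. [folklore] -/
def rails (x : ι → Bool) : ι ⊕ ι → Bool := Sum.elim x fun i => !x i

/-- Specification of a DOUBLE-RAIL simulation `F` of the program `gs`: fed with the rails of `x`,
the positive copy of wire `w` carries its value in `gs` and the negative copy the complement
(out-of-range gate wires: `false` / `true`). [folklore] -/
def DRSpec (gs : List (Gate ι)) (F : (ι ⊕ ι → Bool) → (ι ⊕ ℕ) ⊕ (ι ⊕ ℕ) → Bool) : Prop :=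
  ∀ (x : ι → Bool) (w : ι ⊕ ℕ), F (rails x) (Sum.inl w) = wireOf x (vals gs x) w ∧
    F (rails x) (Sum.inr w) = !wireOf x (vals gs x) w

/-- Two constants cost two gates over `{∧₂,∨₂,0,1}`. [folklore] -/
theorem cktSize_false_true (κ : Type*) :
    CktSize monotoneBasis01 (fun (_ : κ → Bool) => Sum.elim (fun _ : Unit => false) fun _ : Unit => true)
      (1 + 1) :=
  (cktSize_const_mono01 κ false).pair (cktSize_const_mono01 κ true)

/-- Old wires keep their values when a gate is appended (wires beyond stay junk). [folklore] -/
theorem wireOf_vals_append_singleton_of_ne (gs : List (Gate ι)) (g : Gate ι) (x : ι → Bool)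
    {w : ι ⊕ ℕ} (hw : w ≠ Sum.inr gs.length) :
    wireOf x (vals (gs ++ [g]) x) w = wireOf x (vals gs x) w := by
  rcases w with i | m
  · simp
  · simp only [wireOf_inr, vals_append_singleton]
    have hm : m ≠ gs.length := fun h => hw (by rw [h])
    rcases lt_or_gt_of_ne hm with hlt | hgt
    · rw [List.getD_append _ _ _ _ (by rw [length_vals]; exact hlt)]
    · rw [List.getD_eq_default _ _ (by
          rw [List.length_append, length_vals, List.length_singleton]; omega),
        List.getD_eq_default _ _ (by rw [length_vals]; omega)]

/-- The new wire carries the new gate's value. [folklore] -/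
theorem wireOf_vals_append_singleton_self (gs : List (Gate ι)) (g : Gate ι) (x : ι → Bool) :
    wireOf x (vals (gs ++ [g]) x) (Sum.inr gs.length) =
      g.op (fun a => wireOf x (vals gs x) (g.args a)) := by
  simp only [wireOf_inr, vals_append_singleton]
  rw [List.getD_append_right _ _ _ _ (length_vals gs x).le, length_vals, Nat.sub_self,
    List.getD_cons_zero]

/-- **Double rail** (Jukna 2012, §1.2 / §10.1: "negations can be pushed to the inputs at the cost of
doubling the size"): every `{∧₂, ∨₂, ¬}`-program with `L` gates has a MONOTONE program over
`{∧₂, ∨₂, 0, 1}` on the doubled input `ι ⊕ ι`, with at most `2 + 2L` gates, carrying every wire and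
its complement when fed with `(x, ¬x)`: `∧ ↦ (∧, ∨)`, `∨ ↦ (∨, ∧)`, `¬ ↦ swap the rails` (free).
[folklore] -/
theorem exists_doubleRail [DecidableEq ι] : ∀ gs : List (Gate ι), (∀ g ∈ gs, g.fn ∈ deMorganBasis) →
    ∃ F : (ι ⊕ ι → Bool) → (ι ⊕ ℕ) ⊕ (ι ⊕ ℕ) → Bool,
      DRSpec gs F ∧ CktSize monotoneBasis01 F (2 + 2 * gs.length) := by
  intro gs
  induction gs using List.reverseRecOn with
  | nil =>
    intro _
    refine ⟨fun y w => match w with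
      | Sum.inl (Sum.inl i) => y (Sum.inl i)
      | Sum.inr (Sum.inl i) => y (Sum.inr i)
      | Sum.inl (Sum.inr _) => false
      | Sum.inr (Sum.inr _) => true, ?_, ?_⟩
    · intro x w
      rcases w with i | m <;> simp [rails]
    · have h := (CktSize.id monotoneBasis01 (ι := ι ⊕ ι)).pair (cktSize_false_true (ι ⊕ ι))
      refine ((h.outMap fun w : (ι ⊕ ℕ) ⊕ (ι ⊕ ℕ) => match w with
        | Sum.inl (Sum.inl i) => Sum.inl (Sum.inl i)
        | Sum.inr (Sum.inl i) => Sum.inl (Sum.inr i)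
        | Sum.inl (Sum.inr _) => Sum.inr (Sum.inl ())
        | Sum.inr (Sum.inr _) => Sum.inr (Sum.inr ())).of_le (by simp)).congr fun y w => ?_
      rcases w with (i | m) | (i | m) <;> rfl
  | append_singleton gs g ih =>
    intro hB
    obtain ⟨F, hF, hFs⟩ := ih fun g' hg' => hB g' (List.mem_append_left _ hg')
    have hg : g.fn ∈ deMorganBasis := hB g (List.mem_append_right _ (List.mem_singleton_self g))
    simp only [deMorganBasis, Set.mem_insert_iff, Set.mem_singleton_iff] at hg
    set L := gs.length with hL
    -- the rerouting of the two copies of the new wire `inr L` to two fresh outputs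
    let r : (ι ⊕ ℕ) ⊕ (ι ⊕ ℕ) → ((ι ⊕ ℕ) ⊕ (ι ⊕ ℕ)) ⊕ (Unit ⊕ Unit) := fun w =>
      if w = Sum.inl (Sum.inr L) then Sum.inr (Sum.inl ())
      else if w = Sum.inr (Sum.inr L) then Sum.inr (Sum.inr ()) else Sum.inl w
    -- generic assembly: a 2-gate (or 0-gate) gadget computing the two new rails from old rails
    have assemble : ∀ (P N : ((ι ⊕ ℕ) ⊕ (ι ⊕ ℕ) → Bool) → Bool) (m : ℕ), m ≤ 2 →
        CktSize monotoneBasis01 (fun (z : (ι ⊕ ℕ) ⊕ (ι ⊕ ℕ) → Bool) =>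
          Sum.elim z (Sum.elim (fun _ : Unit => P z) (fun _ : Unit => N z))) (0 + m) →
        (∀ x, P (F (rails x)) = g.op (fun a => wireOf x (vals gs x) (g.args a))) →
        (∀ x, N (F (rails x)) = !g.op (fun a => wireOf x (vals gs x) (g.args a))) →
        ∃ F' : (ι ⊕ ι → Bool) → (ι ⊕ ℕ) ⊕ (ι ⊕ ℕ) → Bool,
          DRSpec (gs ++ [g]) F' ∧ CktSize monotoneBasis01 F' (2 + 2 * (gs ++ [g]).length) := by
      intro P N m hm hgad hP hN
      have hcomp := hFs.comp hgad
      refine ⟨_, ?_, (hcomp.outMap r).of_le (by simp; omega)⟩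
      intro x w
      constructor
      · show Sum.elim (F (rails x)) _ (r (Sum.inl w)) = _
        by_cases hw : w = Sum.inr L
        · subst hw
          rw [wireOf_vals_append_singleton_self]
          simp [r, hP x]
        · rw [wireOf_vals_append_singleton_of_ne _ _ _ hw]
          simp [r, hw, (hF x w).1]
      · show Sum.elim (F (rails x)) _ (r (Sum.inr w)) = _
        by_cases hw : w = Sum.inr L
        · subst hw
          rw [wireOf_vals_append_singleton_self]
          simp [r, hN x]
        · rw [wireOf_vals_append_singleton_of_ne _ _ _ hw]
          simp [r, hw, (hF x w).2]
    rcases hg with h | h | h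
    · -- `∧`: positive rail `∧`, negative rail `∨`
      obtain ⟨u, v, rfl⟩ := exists_eq_andGate_of_fn_eq h
      refine assemble (fun z => z (Sum.inl u) && z (Sum.inl v)) (fun z => z (Sum.inr u) || z (Sum.inr v))
        2 le_rfl ((CktSize.id monotoneBasis01).pair ((cktSize_and01 _ _).pair (cktSize_or01 _ _)))
        (fun x => ?_) fun x => ?_
      · rw [andGate_op, (hF x u).1, (hF x v).1]
      · rw [andGate_op, (hF x u).2, (hF x v).2, Bool.not_and]
    · -- `∨`: positive rail `∨`, negative rail `∧`
      obtain ⟨u, v, rfl⟩ := exists_eq_orGate_of_fn_eq h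
      refine assemble (fun z => z (Sum.inl u) || z (Sum.inl v)) (fun z => z (Sum.inr u) && z (Sum.inr v))
        2 le_rfl ((CktSize.id monotoneBasis01).pair ((cktSize_or01 _ _).pair (cktSize_and01 _ _)))
        (fun x => ?_) fun x => ?_
      · rw [orGate_op, (hF x u).1, (hF x v).1]
      · rw [orGate_op, (hF x u).2, (hF x v).2, Bool.not_or]
    · -- `¬`: swap the rails (no gate)
      obtain ⟨u, rfl⟩ := exists_eq_notGate_of_fn_eq h
      refine assemble (fun z => z (Sum.inr u)) (fun z => z (Sum.inl u)) 0 (by norm_num)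
        (((CktSize.id monotoneBasis01).pair
          ((CktSize.proj monotoneBasis01 fun _ : Unit => (Sum.inr u : (ι ⊕ ℕ) ⊕ (ι ⊕ ℕ))).pair
            (CktSize.proj monotoneBasis01 fun _ : Unit => (Sum.inl u : (ι ⊕ ℕ) ⊕ (ι ⊕ ℕ))))).congr
          fun z w => by rcases w with w | (w | w) <;> rfl)
        (fun x => ?_) fun x => ?_
      · simp [notGate, (hF x u).2]
      · simp [notGate, (hF x u).1]

/-- Programs over `{∧₂,∨₂,0,1}` compute monotone multi-output maps. [folklore] -/
theorem CktSize.monotone_of_monotoneBasis01 {κ : Type*} {F : (ι → Bool) → κ → Bool} {s : ℕ}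
    (h : CktSize monotoneBasis01 F s) : Monotone F := by
  obtain ⟨gs, out, -, hR⟩ := h
  intro y y' hyy' k
  rw [← hR.eval y k, ← hR.eval y' k]
  exact monotone_wireOf_vals_monotoneBasis01 gs hR.isOver (out k) hyy'

end DoubleRail

section Slice

variable {n : ℕ}

/-- **Berkowitz without the tightness bookkeeping.** A `k`-slice function with a `{∧₂,∨₂,¬}`-program
of `t` gates has a `{∧₂,∨₂,0,1}`-program of `c + (2 + 2t)` gates, where `c` gates compute all
pseudo-complements `Th_k(x - xᵢ)`: double-rail the program and feed the negative rail with the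
pseudo-complements; correct on the slice by (10.1) `Th_k(x - xᵢ) = ¬xᵢ`, below/above it by the
monotone sandwich `F(x,0) ≤ F(x,¬x) ≤ F(x,1)` (Jukna 2012, Thm. 10.1). [cite: Jukna2012, Thm. 10.1] -/
theorem cktSize_slice_of_deMorgan {k : ℕ} {f : (Fin n → Bool) → Bool} (hf : IsSliceFunction k f)
    {t : ℕ} (hC : CktSize deMorganBasis (fun x (_ : Unit) => f x) t) {c : ℕ}
    (hP : CktSize monotoneBasis01 (fun (x : Fin n → Bool) (i : Fin n) => pseudoComplement k i x) c) :
    CktSize monotoneBasis01 (fun x (_ : Unit) => f x) (c + (2 + 2 * t)) := by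
  obtain ⟨gs, out, hl, hR⟩ := hC
  obtain ⟨F, hF, hFs⟩ := exists_doubleRail gs hR.isOver
  have hG : CktSize monotoneBasis01
      (fun x : Fin n → Bool => Sum.elim x fun i => pseudoComplement k i x) (0 + c) :=
    (CktSize.id monotoneBasis01).pair hP
  have hH := (hG.comp hFs).outMap fun _ : Unit => (Sum.inl (out ()) : (Fin n ⊕ ℕ) ⊕ (Fin n ⊕ ℕ))
  refine (hH.of_le (by omega)).congr fun x _ => ?_
  have hmono := CktSize.monotone_of_monotoneBasis01 hFs
  have hslice : F (rails x) (Sum.inl (out ())) = f x := by rw [(hF x _).1, hR.eval x ()]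
  show F (Sum.elim x fun i => pseudoComplement k i x) (Sum.inl (out ())) = f x
  rcases lt_trichotomy (hammingWeight x) k with hlt | heq | hgt
  · -- below the slice: pseudo-complements are `0`, `F(x,0) ≤ F(x,¬x) = f x = 0`
    have hle : (Sum.elim x fun i => pseudoComplement k i x) ≤ rails x := by
      rintro (i | i)
      · exact le_rfl
      · simp [rails, pseudoComplement_eq_false_of_lt i x hlt]
    have := hmono hle (Sum.inl (out ()))
    rw [hslice, hf.1 x hlt] at this
    rw [hf.1 x hlt]
    exact le_antisymm this (Bool.false_le _)
  · -- on the slice: (10.1)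
    have : (Sum.elim x fun i => pseudoComplement k i x) = rails x := by
      ext (i | i)
      · rfl
      · exact pseudoComplement_eq_not i x heq
    rw [this, hslice]
  · -- above the slice: pseudo-complements are `1`, `1 = f x = F(x,¬x) ≤ F(x,1)`
    have hle : rails x ≤ (Sum.elim x fun i => pseudoComplement k i x) := by
      rintro (i | i)
      · exact le_rfl
      · simp [rails, pseudoComplement_eq_true_of_lt i x hgt]
    have := hmono hle (Sum.inl (out ()))
    rw [hslice, hf.2 x hgt] at this
    rw [hf.2 x hgt]
    exact le_antisymm (Bool.le_true _) this

/-- A circuit realises its own function as a program. [folklore] -/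
theorem cktSize_of_circuit {ι : Type*} {B : Set GateFn} (C : Circuit ι) (hB : C.IsOver B)
    {f : (ι → Bool) → Bool} (hf : C.Computes f) : CktSize B (fun x (_ : Unit) => f x) C.size :=
  ⟨C.gates, fun _ => C.output, le_rfl,
    ⟨wf_gates C, hB, fun _ m hm => C.wf_output m hm, fun x _ => (circuit_eval C x).symm.trans (hf x)⟩⟩

/-- `{∧₂,∨₂,0,1} ⊆ B_s` for `s ≥ 1` (constants are CONV gates of width `≤ 1`). [folklore] -/
theorem monotoneBasis01_subset_extGate {s : ℕ} (hs : 1 ≤ s) : monotoneBasis01 ⊆ extGate s := by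
  intro g hg
  simp only [monotoneBasis01, monotoneBasis, Set.mem_insert_iff, Set.mem_singleton_iff] at hg
  rcases hg with rfl | rfl | rfl | rfl
  · -- `1`: no constraint
    refine IsConvGate.mem_extGate ⟨0, 0, by omega, fun _ => 0, fun _ => 0, fun _ _ => 0,
      fun _ _ => le_rfl, fun v => ?_⟩
    show true = true ↔ _
    simp only [true_iff]
    exact ⟨0, Matrix.PosSemidef.zero, fun i => i.elim0⟩
  · -- `0`: the infeasible constraint `0 ≤ -1`
    refine IsConvGate.mem_extGate ⟨1, 0, hs, fun _ => 0, fun _ => -1, fun _ _ => 0,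
      fun _ _ => le_rfl, fun v => ?_⟩
    show false = true ↔ _
    simp only [Bool.false_eq_true, false_iff, not_exists, not_and, not_forall, not_le]
    intro Y _
    exact ⟨0, by simp⟩
  · exact and_mem_extGate s
  · exact or_mem_extGate s

/-- **`Capture` holds for slice functions — with NO wide gate** (Berkowitz 1982 / Jukna 2012 Thm. 10.1,
assembled: `B₂ → {∧,∨,¬}` (`12t+3` gates), double rail (`2 + 2·(12t+3)`), pseudo-complements
(`c·n·log² n`), hence `≤ (t+n+2)^a` for an absolute `a`; small `n < n₀` by monotone Shannon expansion).
So a counterexample to the crux is far from the slices: together with §9 (few minterms / few maxterms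
⇒ ONE CONV gate) the counterexample space is "non-sliceable monotone P-functions with super-polynomially
many minterms and maxterms" — matching, Tardos's function, LIN-UNSAT are of this kind, slices of NP-hard
functions (the OneSlice route) are not. [cite: Jukna2012, Thm. 10.1] -/
theorem captureSlice_monotoneBasis01 : ∃ a : ℕ, ∀ (n k : ℕ) (f : (Fin n → Bool) → Bool), Monotone f →
    IsSliceFunction k f → ∀ C : Circuit (Fin n), C.IsOver B2 → C.Computes f →
      ∃ C' : Circuit (Fin n), C'.IsOver monotoneBasis01 ∧ C'.size ≤ (C.size + n + 2) ^ a ∧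
        C'.Computes f := by
  obtain ⟨c, n₀, hP⟩ := pseudoComplements_cktSize_holds
  refine ⟨n₀ + c + 30, fun n k f hmono hf C hB hcomp => ?_⟩
  have hbase : 2 ≤ C.size + n + 2 := by omega
  rcases Nat.lt_or_ge n (max n₀ 1) with hsmall | hbig
  · -- small `n`: monotone Shannon expansion, `monoBound n ≤ 3·2^n` gates
    obtain ⟨C', hB', hs', hev'⟩ :=
      (cktSize_monotone_univ_fin n (fun x _ => f x) fun x y hxy _ => hmono hxy).toCircuit
    refine ⟨C', hB', hs'.trans ?_, fun x => hev' x⟩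
    have hmb : ∀ m, monoBound m + 2 ≤ 3 * 2 ^ m := fun m => by
      induction m with
      | zero => simp [monoBound]
      | succ m ih => simp only [monoBound, pow_succ]; omega
    have hn : n ≤ n₀ := by omega
    calc monoBound n ≤ 3 * 2 ^ n := by have := hmb n; omega
      _ ≤ 4 * 2 ^ n₀ := by
          have := Nat.pow_le_pow_right (show 1 ≤ 2 by norm_num) hn
          omega
      _ = 2 ^ (n₀ + 2) := by ring
      _ ≤ (C.size + n + 2) ^ (n₀ + 2) := Nat.pow_le_pow_left hbase _
      _ ≤ (C.size + n + 2) ^ (n₀ + c + 30) := Nat.pow_le_pow_right (by omega) (by omega)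
  · -- `n ≥ n₀`, `n ≥ 1`
    have hn1 : 1 ≤ n := le_trans (le_max_right _ _) hbig
    have hn0 : n₀ ≤ n := le_trans (le_max_left _ _) hbig
    have h1 := (cktSize_of_circuit C hB hcomp).deMorgan_of_B2 ⟨0, hn1⟩
    have h2 := cktSize_slice_of_deMorgan hf h1 (hP n hn0 k)
    obtain ⟨C', hB', hs', hev'⟩ := h2.toCircuit
    refine ⟨C', hB', hs'.trans ?_, fun x => hev' x⟩
    set N := C.size + n + 2 with hN
    have hlog : Nat.log 2 n ≤ n := (Nat.log_lt_self 2 (by omega)).le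
    have hn3 : n * Nat.log 2 n ^ 2 ≤ N ^ 3 := by
      calc n * Nat.log 2 n ^ 2 ≤ n * n ^ 2 := Nat.mul_le_mul_left _ (Nat.pow_le_pow_left hlog 2)
        _ = n ^ 3 := by ring
        _ ≤ N ^ 3 := Nat.pow_le_pow_left (by omega) 3
    have hN3 : N ≤ N ^ 3 := by
      calc N = N ^ 1 := (pow_one N).symm
        _ ≤ N ^ 3 := Nat.pow_le_pow_right (by omega) (by norm_num)
    have h2c : c + 27 ≤ 2 ^ (c + 27) := (Nat.lt_two_pow_self).le
    calc c * (n * Nat.log 2 n ^ 2) + (2 + 2 * (12 * C.size + 3))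
        ≤ c * N ^ 3 + 26 * N := add_le_add (Nat.mul_le_mul_left c hn3) (by omega)
      _ ≤ c * N ^ 3 + 26 * N ^ 3 := by have := Nat.mul_le_mul_left 26 hN3; omega
      _ = (c + 26) * N ^ 3 := by ring
      _ ≤ 2 ^ (c + 27) * N ^ 3 := Nat.mul_le_mul_right _ (by omega)
      _ ≤ N ^ (c + 27) * N ^ 3 := Nat.mul_le_mul_right _ (Nat.pow_le_pow_left hbase _)
      _ = N ^ (c + 27 + 3) := by rw [← pow_add]
      _ ≤ N ^ (n₀ + c + 30) := Nat.pow_le_pow_right (by omega) (by omega)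

/-- The same with the crux's target basis: `Capture` restricted to slice functions is a THEOREM (the
simulating circuit lives in `{∧₂,∨₂,0,1} ⊆ B_1 ⊆ B_N`). [cite: Jukna2012, Thm. 10.1] -/
theorem captureSlice : ∃ a : ℕ, ∀ (n k : ℕ) (f : (Fin n → Bool) → Bool), Monotone f →
    IsSliceFunction k f → ∀ C : Circuit (Fin n), C.IsOver B2 → C.Computes f →
      ∃ C' : Circuit (Fin n), C'.IsOver (extGate ((C.size + n + 2) ^ a)) ∧
        C'.size ≤ (C.size + n + 2) ^ a ∧ C'.Computes f := by
  obtain ⟨a, h⟩ := captureSlice_monotoneBasis01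
  refine ⟨a, fun n k f hmono hf C hB hcomp => ?_⟩
  obtain ⟨C', hB', hs', hev'⟩ := h n k f hmono hf C hB hcomp
  exact ⟨C', hB'.mono (monotoneBasis01_subset_extGate (Nat.one_le_pow _ _ (by omega))), hs', hev'⟩

end Slice

/-! ## §16 (targets of the line `csp-spine-meet-to-join`, Stub 3b) Functional / permutation constraints
never need a PERM gate: UNSAT is cover-graph connectivity -/

section PermCSP

variable {V D J : Type*}

/-- A menu of PERMUTATION CONSTRAINTS on variables `V` with domain `D`: constraint `j` demands
`h (dst j) = perm j (h (src j))`. Every binary coset constraint whose subgroup `H ≤ G × G` is the graph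
of a bijection (holonomy `h(y) = c·h(x)`, two-sided `h(y) = c·h(x)·d`, automorphism-twisted
`h(y) = c·φ(h(x))`), and every Unique-Games-type constraint, is of this form. [folklore] -/
structure PermCSP (V D J : Type*) where
  /-- source variable of constraint `j` -/
  src : J → V
  /-- target variable of constraint `j` -/
  dst : J → V
  /-- the bijection of the domain imposed by constraint `j` -/
  perm : J → Equiv.Perm D

variable (P : PermCSP V D J)

/-- The SELECTED sub-system `S` is satisfiable. [folklore] -/
def PermCSP.Sat (S : Set J) : Prop :=
  ∃ h : V → D, ∀ j ∈ S, h (P.dst j) = P.perm j (h (P.src j))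

/-- One step in the COVER GRAPH on `V × D` of the selected sub-system: along constraint `j ∈ S`,
`(src j, a) — (dst j, perm j a)`, in both directions. [folklore] -/
inductive PermCSP.Step (S : Set J) : V × D → V × D → Prop
  | fwd (j : J) (hj : j ∈ S) (a : D) : PermCSP.Step S (P.src j, a) (P.dst j, P.perm j a)
  | bwd (j : J) (hj : j ∈ S) (a : D) : PermCSP.Step S (P.dst j, P.perm j a) (P.src j, a)

/-- Connectivity in the cover graph. [folklore] -/
def PermCSP.Reach (S : Set J) : V × D → V × D → Prop := Relation.ReflTransGen (P.Step S)

/-- The monotone UNSAT witness: some fibre has NO "good" point, i.e. from every `(x, a)` one reaches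
another point `(x, a')` of the same fibre. [folklore] -/
def PermCSP.Bad (S : Set J) : Prop :=
  ∃ x : V, ∀ a : D, ∃ a' : D, a' ≠ a ∧ P.Reach S (x, a) (x, a')

variable {P}

/-- The cover graph is undirected. [folklore] -/
theorem PermCSP.step_symm {S : Set J} {p q : V × D} (h : P.Step S p q) : P.Step S q p := by
  cases h with
  | fwd j hj a => exact .bwd j hj a
  | bwd j hj a => exact .fwd j hj a

/-- Reachability is symmetric. [folklore] -/
theorem PermCSP.Reach.symm {S : Set J} {p q : V × D} (h : P.Reach S p q) : P.Reach S q p := by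
  induction h with
  | refl => exact Relation.ReflTransGen.refl
  | tail _ hs ih => exact Relation.ReflTransGen.head (PermCSP.step_symm hs) ih

/-- Reachability is transitive. [folklore] -/
theorem PermCSP.Reach.trans {S : Set J} {p q r : V × D} (h₁ : P.Reach S p q) (h₂ : P.Reach S q r) :
    P.Reach S p r :=
  Relation.ReflTransGen.trans h₁ h₂

/-- Steps are monotone in the selection. [folklore] -/
theorem PermCSP.Step.mono {S T : Set J} (hST : S ⊆ T) {p q : V × D} (h : P.Step S p q) : P.Step T p q := by
  cases h with
  | fwd j hj a => exact .fwd j (hST hj) a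
  | bwd j hj a => exact .bwd j (hST hj) a

/-- Reachability is MONOTONE in the selection (more constraints, more edges). [folklore] -/
theorem PermCSP.Reach.mono {S T : Set J} (hST : S ⊆ T) {p q : V × D} (h : P.Reach S p q) :
    P.Reach T p q := by
  induction h with
  | refl => exact Relation.ReflTransGen.refl
  | tail _ hs ih => exact Relation.ReflTransGen.tail ih (PermCSP.Step.mono hST hs)

/-- Hence the witness `Bad` is monotone in the selection. [folklore] -/
theorem PermCSP.Bad.mono {S T : Set J} (hST : S ⊆ T) (h : P.Bad S) : P.Bad T := by
  obtain ⟨x, hx⟩ := h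
  refine ⟨x, fun a => ?_⟩
  obtain ⟨a', ha', hr⟩ := hx a
  exact ⟨a', ha', hr.mono hST⟩

/-- Along a solution `h`, everything reachable from `(x, h x)` lies on the graph of `h`. [folklore] -/
theorem PermCSP.Reach.eq_of_sat {S : Set J} {h : V → D}
    (hsat : ∀ j ∈ S, h (P.dst j) = P.perm j (h (P.src j))) {x : V} {q : V × D}
    (hr : P.Reach S (x, h x) q) : q.2 = h q.1 := by
  induction hr with
  | refl => rfl
  | tail _ hs ih =>
    cases hs with
    | fwd j hj a =>
      simp only at ih ⊢
      rw [hsat j hj, ← ih]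
    | bwd j hj a =>
      simp only at ih ⊢
      rw [hsat j hj] at ih
      exact (P.perm j).injective ih

/-- **Soundness of the witness**: `Bad S → ¬ Sat S`. [folklore] -/
theorem PermCSP.not_sat_of_bad {S : Set J} (hb : P.Bad S) : ¬ P.Sat S := by
  rintro ⟨h, hsat⟩
  obtain ⟨x, hx⟩ := hb
  obtain ⟨a', ha', hr⟩ := hx (h x)
  exact ha' (PermCSP.Reach.eq_of_sat hsat hr)

/-- **Path lifting**: a path from `(x, a)` to `(y, b)` acts on the whole fibre by ONE permutation `π`
with `π a = b` (the holonomy of its projection). [folklore] -/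
theorem PermCSP.Reach.lift {S : Set J} {x y : V} {a b : D} (hr : P.Reach S (x, a) (y, b)) :
    ∃ π : Equiv.Perm D, π a = b ∧ ∀ c : D, P.Reach S (x, c) (y, π c) := by
  -- generalise the endpoints to run the induction
  suffices ∀ q : V × D, P.Reach S (x, a) q →
      ∃ π : Equiv.Perm D, π a = q.2 ∧ ∀ c : D, P.Reach S (x, c) (q.1, π c) from this _ hr
  intro q hq
  induction hq with
  | refl => exact ⟨1, rfl, fun c => Relation.ReflTransGen.refl⟩
  | tail _ hs ih =>
    obtain ⟨π, hπ, hall⟩ := ih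
    cases hs with
    | fwd j hj a₀ =>
      simp only at hπ hall
      refine ⟨π.trans (P.perm j), ?_, fun c => ?_⟩
      · simp only [Equiv.trans_apply]
        rw [hπ]
      · simp only [Equiv.trans_apply]
        exact (hall c).tail (.fwd j hj (π c))
    | bwd j hj a₀ =>
      simp only at hπ hall
      refine ⟨π.trans (P.perm j).symm, ?_, fun c => ?_⟩
      · simp only [Equiv.trans_apply]
        rw [hπ, Equiv.symm_apply_apply]
      · simp only [Equiv.trans_apply]
        have h2 : P.Step S (P.dst j, π c) (P.src j, (P.perm j).symm (π c)) := by
          have := PermCSP.Step.bwd (P := P) (S := S) j hj ((P.perm j).symm (π c))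
          rwa [Equiv.apply_symm_apply] at this
        exact (hall c).tail h2

/-- A GOOD point of the fibre of `x`: its component meets the fibre only in itself. [folklore] -/
def PermCSP.Good (S : Set J) (x : V) (a : D) : Prop :=
  ∀ a' : D, P.Reach S (x, a) (x, a') → a' = a

/-- Goodness is transported along paths. [folklore] -/
theorem PermCSP.Good.transport {S : Set J} {x y : V} {a b : D} (hg : P.Good S x a)
    (hr : P.Reach S (x, a) (y, b)) : P.Good S y b := by
  intro b' hb'
  obtain ⟨π, hπa, hall⟩ := hr.lift
  have h1 : P.Reach S (x, a) (y, b') := hr.trans hb'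
  have h2 : P.Reach S (x, π.symm b') (y, b') := by
    have := hall (π.symm b')
    rwa [Equiv.apply_symm_apply] at this
  have h3 : P.Reach S (x, a) (x, π.symm b') := h1.trans h2.symm
  have h4 := hg _ h3
  rw [Equiv.symm_apply_eq] at h4
  rw [h4, hπa]

/-- Base connectivity (projection of the cover graph). [folklore] -/
def PermCSP.Conn (S : Set J) (x y : V) : Prop := ∃ a b : D, P.Reach S (x, a) (y, b)

/-- From a connected base point every fibre point lifts. [folklore] -/
theorem PermCSP.Conn.reach {S : Set J} {x y : V} (h : P.Conn S x y) (c : D) :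
    ∃ d : D, P.Reach S (x, c) (y, d) := by
  obtain ⟨a, b, hr⟩ := h
  obtain ⟨π, -, hall⟩ := hr.lift
  exact ⟨π c, hall c⟩

/-- Base connectivity is an equivalence relation on the variables met by the domain. [folklore] -/
theorem PermCSP.conn_equivalence [Nonempty D] (S : Set J) : Equivalence (P.Conn S) where
  refl x := let ⟨a⟩ := ‹Nonempty D›; ⟨a, a, Relation.ReflTransGen.refl⟩
  symm := fun ⟨a, b, h⟩ => ⟨b, a, h.symm⟩
  trans := fun ⟨a, b, h₁⟩ h₂ => by
    obtain ⟨d, hd⟩ := PermCSP.Conn.reach h₂ b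
    exact ⟨a, d, h₁.trans hd⟩

/-- **Completeness of the witness**: if every fibre has a good point, the selected system is
satisfiable — pick a good point over one representative of each base component and transport it
(well defined because goodness is transported and lifts are unique at good points). [folklore] -/
theorem PermCSP.sat_of_not_bad {S : Set J} (hb : ¬ P.Bad S) : P.Sat S := by
  classical
  simp only [PermCSP.Bad, not_exists, not_forall, not_and] at hb
  -- `g x` is good at `x`
  choose g hg using hb
  have hgood : ∀ x, P.Good S x (g x) := fun x a' hr => by
    by_contra h
    exact hg x a' h hr
  cases isEmpty_or_nonempty D with
  | inl hD =>
    -- no domain element: then there is no variable either (else `hb` produced one)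
    refine ⟨fun x => (hD.false (g x)).elim, fun j _ => (hD.false (g (P.src j))).elim⟩
  | inr hD =>
    -- representatives of base components
    let E : Setoid V := ⟨P.Conn S, PermCSP.conn_equivalence S⟩
    let ρ : V → V := fun x => (Quotient.mk E x).out
    have hρ : ∀ x, P.Conn S (ρ x) x := fun x => Quotient.mk_out (s := E) x
    have hρeq : ∀ x y, P.Conn S x y → ρ x = ρ y := fun x y hxy => by
      show (Quotient.mk E x).out = (Quotient.mk E y).out
      rw [Quotient.sound (s := E) hxy]
    -- transport the good value of the representative
    have hex : ∀ x, ∃ c : D, P.Reach S (ρ x, g (ρ x)) (x, c) := fun x => (hρ x).reach _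
    choose h hh using hex
    have huniq : ∀ x c, P.Reach S (ρ x, g (ρ x)) (x, c) → c = h x := fun x c hc => by
      have hgx : P.Good S x (h x) := (hgood (ρ x)).transport (hh x)
      exact hgx c ((hh x).symm.trans hc)
    refine ⟨h, fun j hj => ?_⟩
    have hconn : P.Conn S (P.src j) (P.dst j) :=
      ⟨g (P.src j), _, Relation.ReflTransGen.single (.fwd j hj _)⟩
    have hρj : ρ (P.dst j) = ρ (P.src j) := (hρeq _ _ hconn).symm
    refine (huniq (P.dst j) _ ?_).symm
    rw [hρj]
    exact (hh (P.src j)).tail (.fwd j hj _)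

/-- **UNSAT of a selected system of permutation constraints is the monotone connectivity condition
`Bad`** — so it is decided by cover-graph `STCONN` queries combined positively
(`∃ x, ∀ a, ∃ a' ≠ a, Reach`), i.e. by a polynomial-size `{∧₂, ∨₂}`-circuit in the selection (STCONN on
`|V|·|D|` vertices has monotone circuits of size `O((|V||D|)³)`; assembling them is routine). For the line
`csp-spine-meet-to-join`: the nonabelian door test `stub_cosetMeetToJoinNonabelian` is NOT decided by
functional (holonomy / automorphism-twisted / two-sided) coset constraints, over any group — those never
need a PERM gate; the test lives in the RELATIONAL constraints through abelian sections (arity `≥ 3`, or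
quotient-couplings), twisted by the group. Already over `S₃`: a ternary coupling
`{u ∈ 𝔽₃³ : u₁+u₂+u₃ = 0} ⋊ ⟨(τ,τ,τ)⟩ ≤ S₃³` and its conjugates (each single constraint is conjugate to a
split one, `H¹ = 0` by coprimality) tie the SIGN classes of the coupled variables and shift the
`𝔽₃`-equation by a multiple of that common sign bit; UNSAT of a selected system is then "`𝔽₂`-system on the
signs + per coupling-component a two-case `𝔽₃`-system". ROADMAP for this `S₃` case (paper, for the lead;
a 3-level `{∧,∨} ∪ PERM` circuit, polynomial): (1) DOUBLE COVER — two `𝔽₃`-unknowns `u_y⁰, u_y¹` per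
variable ("`u_y` if `s_y = 0 / 1`") and each twisted equation written once per value of its class bit; this
is a plain selected `𝔽₃`-linear system `Σ̃(S)` whose restriction to a tie-component is the disjoint union of
the two case-systems (its two sheets); (2) LOCALISED INFEASIBILITY `Inf(y,β)(S)` := "the component of
`u_y^β` in `Σ̃(S)` is infeasible" `=` ONE `𝔽₃`-span (block PERM) gate over the rows MASKED by monotone
wires `v_j ∧ Reach_S(u_y^β, a variable of row j)` (reachability: §17-type `{∧,∨}` circuits) — masking by the
reachability of a row's own variables selects exactly the component's rows; (3) ONE `𝔽₂`-span gate over the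
sign rows (switched by the inputs) and the pin rows `s_y = 1-β` (switched by the wires `Inf(y,β)`): it fires
iff every sign solution meets an infeasible sheet, i.e. iff UNSAT. So `S₃` should PASS the door test; the
linearisation uses the sign TIES (coupled coordinates share one class bit, from `P`-stability of `W` over
`𝔽₃`) — over `ℤ/4`-sections (`D₄ ⊇ ⟨ρ⟩ ≅ ℤ/4`) couplings through the 2-torsion, e.g.
`W = ⟨(ρ, ρ²)⟩ ⋊ ⟨(τ,1),(1,τ)⟩ ≤ D₄²` (binary, relational, signs untied), defeat it: sheets of the cover get
polluted. EVEN twists `2[s]` still linearise (`2[s] = 2σ` for any `ℤ/4`-lift `σ` of the bit, and the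
`𝔽₂`-sign system is `2·(ℤ/4-system)`), so menus all of whose constraints are `ℤ/4`-affine in `(u, 2σ)` are ONE
`ℤ/4`-LIN gate (Stub 2, `m = 4`); the residue of the door test consists of (i) ODD bit couplings `u = c ± [s]`
(cosets of the diagonal reflections `⟨ρτ⟩, ⟨ρ³τ⟩`, already unary; a brute-force check finds no
`(u, 2σ)`-linearisation for them) and (ii) twist cocycles with a QUADRATIC part `2[s₁][s₂]·n ≠ 0` (possible
since `(e₁-1)·t(e₂) ∈ 2M` need not vanish mod `W`) — the natural dual candidate for both being membership in
subgroups of `D₄^N` (class 2: commutators supply the bilinear terms) generated by selected elements, i.e. a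
genuinely NONABELIAN PERM gate. [folklore] -/
theorem PermCSP.not_sat_iff_bad (S : Set J) : ¬ P.Sat S ↔ P.Bad S :=
  ⟨fun h => by_contra fun hb => h (PermCSP.sat_of_not_bad hb), PermCSP.not_sat_of_bad⟩

/-- The link with COSET gates: a binary coset constraint whose subgroup is the GRAPH of a bijection
`φ` of `G` (holonomy = graph of the identity, automorphism twists, …) is a permutation constraint —
`(a, b)⁻¹ · (u, w) ∈ graph φ ↔ w = b · φ (a⁻¹ · u)`. [folklore] -/
theorem mem_coset_graph_iff {G : Type*} [Group G] (φ : G ≃ G) (H : Subgroup (G × G))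
    (hH : ∀ p : G × G, p ∈ H ↔ p.2 = φ p.1) (a b u w : G) :
    (a, b)⁻¹ * (u, w) ∈ H ↔ w = b * φ (a⁻¹ * u) := by
  rw [hH, Prod.inv_mk, Prod.mk_mul_mk]
  exact inv_mul_eq_iff_eq_mul

end PermCSP

/-! ## §17 (targets, Stub 3b continued) … and the circuit: permutation-constraint gates are polynomial
`{∧₂,∨₂,0,1}`-circuits (Boolean transitive closure by `N` relaxation rounds + the formula of §16) -/

section Relax

variable {α : Type*} [Fintype α] [DecidableEq α]

/-- `t` rounds of Bellman–Ford relaxation of the Boolean edge relation `e` from the diagonal: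
`relax e t p q = true` iff `q` is reachable from `p` by at most `t` edges. [folklore] -/
def relax (e : α → α → Bool) : ℕ → α → α → Bool
  | 0, p, q => decide (p = q)
  | t + 1, p, q => relax e t p q || decide (∃ u, relax e t p u = true ∧ e u q = true)

omit [DecidableEq α] in
/-- The edge relation as a `Prop`. [folklore] -/
def edgeRel (e : α → α → Bool) (a b : α) : Prop := e a b = true

/-- Relaxation only finds reachable points. [folklore] -/
theorem reflTransGen_of_relax (e : α → α → Bool) :
    ∀ (t : ℕ) (p q : α), relax e t p q = true → Relation.ReflTransGen (edgeRel e) p q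
  | 0, p, q, h => by
    simp only [relax, decide_eq_true_eq] at h
    subst h
    exact Relation.ReflTransGen.refl
  | t + 1, p, q, h => by
    simp only [relax, Bool.or_eq_true, decide_eq_true_eq] at h
    rcases h with h | ⟨u, hu, he⟩
    · exact reflTransGen_of_relax e t p q h
    · exact (reflTransGen_of_relax e t p u hu).tail he

/-- Relaxation is inflationary in `t`. [folklore] -/
theorem relax_mono_succ (e : α → α → Bool) (t : ℕ) (p q : α) (h : relax e t p q = true) :
    relax e (t + 1) p q = true := by
  simp only [relax, Bool.or_eq_true]
  exact Or.inl h

/-- The set reached from `p` after `t` rounds. [folklore] -/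
def reached (e : α → α → Bool) (t : ℕ) (p : α) : Finset α := Finset.univ.filter fun q => relax e t p q = true

/-- The reached sets increase. [folklore] -/
theorem reached_subset_succ (e : α → α → Bool) (t : ℕ) (p : α) : reached e t p ⊆ reached e (t + 1) p := by
  intro q hq
  simp only [reached, Finset.mem_filter, Finset.mem_univ, true_and] at hq ⊢
  exact relax_mono_succ e t p q hq

/-- One round is a function of the previous reached set: equal sets stay equal. [folklore] -/
theorem reached_succ_eq_of_eq (e : α → α → Bool) {t t' : ℕ} (p : α)
    (h : reached e t p = reached e t' p) : reached e (t + 1) p = reached e (t' + 1) p := by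
  have hpt : ∀ q, relax e t p q = relax e t' p q := fun q => by
    have := congrArg (q ∈ ·) h
    simp only [reached, Finset.mem_filter, Finset.mem_univ, true_and, eq_iff_iff] at this
    rw [Bool.eq_iff_iff, this]
  ext q
  simp only [reached, Finset.mem_filter, Finset.mem_univ, true_and, relax, hpt]

/-- A stable round stays stable. [folklore] -/
theorem reached_stable (e : α → α → Bool) {t : ℕ} (p : α) (h : reached e t p = reached e (t + 1) p) :
    ∀ k, reached e (t + k) p = reached e t p
  | 0 => rfl
  | k + 1 => by
    have ih := reached_stable e p h k
    rw [← add_assoc, reached_succ_eq_of_eq e p ih, ← h]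

/-- Within `card α` rounds the reached set stabilises (it grows strictly until it does, from size `1`).
[folklore] -/
theorem reached_card_stable (e : α → α → Bool) (p : α) :
    reached e (Fintype.card α) p = reached e (Fintype.card α + 1) p := by
  by_contra hne
  -- if the `card α`-th round is unstable, all earlier rounds are unstable, so sizes grow by one each round
  have hunstable : ∀ t ≤ Fintype.card α, reached e t p ≠ reached e (t + 1) p := by
    intro t ht heq
    have := reached_stable e p heq (Fintype.card α - t)
    have h2 := reached_stable e p heq (Fintype.card α - t + 1)
    rw [show t + (Fintype.card α - t) = Fintype.card α by omega] at this
    rw [show t + (Fintype.card α - t + 1) = Fintype.card α + 1 by omega] at h2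
    exact hne (this.trans h2.symm)
  have hgrow : ∀ t ≤ Fintype.card α + 1, t + 1 ≤ (reached e t p).card := by
    intro t
    induction t with
    | zero =>
      intro _
      refine Finset.card_pos.2 ⟨p, ?_⟩
      simp [reached, relax]
    | succ t ih =>
      intro ht
      have h1 := ih (by omega)
      have hss : reached e t p ⊂ reached e (t + 1) p :=
        Finset.ssubset_iff_subset_ne.2 ⟨reached_subset_succ e t p, hunstable t (by omega)⟩
      have := Finset.card_lt_card hss
      omega
  have := hgrow (Fintype.card α + 1) le_rfl
  have hle : (reached e (Fintype.card α + 1) p).card ≤ Fintype.card α := Finset.card_le_univ _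
  omega

/-- **`card α` rounds of relaxation compute reachability.** [folklore] -/
theorem relax_card_iff (e : α → α → Bool) (p q : α) :
    relax e (Fintype.card α) p q = true ↔ Relation.ReflTransGen (edgeRel e) p q := by
  refine ⟨reflTransGen_of_relax e _ p q, fun h => ?_⟩
  -- the stable set contains `p` and is closed under edges
  have hstab := reached_card_stable e p
  set T := Fintype.card α with hT
  have hp : relax e T p p = true := by
    have h0 : relax e 0 p p = true := by simp [relax]
    have : ∀ t, relax e t p p = true := fun t => by
      induction t with
      | zero => exact h0
      | succ t ih => exact relax_mono_succ e t p p ih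
    exact this T
  have hclosed : ∀ u w, relax e T p u = true → e u w = true → relax e T p w = true := by
    intro u w hu huw
    have hw : relax e (T + 1) p w = true := by
      simp only [relax, Bool.or_eq_true, decide_eq_true_eq]
      exact Or.inr ⟨u, hu, huw⟩
    have : w ∈ reached e (T + 1) p := by simpa [reached] using hw
    rw [← hstab] at this
    simpa [reached] using this
  induction h with
  | refl => exact hp
  | tail _ huw ih => exact hclosed _ _ ih huw

/-- Relaxation is monotone in the edge relation. [folklore] -/
theorem relax_mono_edges {e e' : α → α → Bool} (hee' : ∀ a b, e a b = true → e' a b = true) :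
    ∀ (t : ℕ) (p q : α), relax e t p q = true → relax e' t p q = true
  | 0, p, q, h => h
  | t + 1, p, q, h => by
    simp only [relax, Bool.or_eq_true, decide_eq_true_eq] at h ⊢
    rcases h with h | ⟨u, hu, huq⟩
    · exact Or.inl (relax_mono_edges hee' t p q h)
    · exact Or.inr ⟨u, relax_mono_edges hee' t p u hu, hee' u q huq⟩

end Relax

section PermCircuit

open Literature.Computability.Complexity Literature.Computability.Complexity.GateList

variable {nv nd m : ℕ} (P : PermCSP (Fin nv) (Fin nd) (Fin m))

/-- The points of the cover graph. [folklore] -/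
abbrev Pt (nv nd : ℕ) : Type := Fin nv × Fin nd

/-- `(p, q)` is the edge of constraint `j` (in either direction). [folklore] -/
def PermCSP.IsEdge (j : Fin m) (p q : Pt nv nd) : Prop :=
  (p.1 = P.src j ∧ q.1 = P.dst j ∧ q.2 = P.perm j p.2) ∨ (q.1 = P.src j ∧ p.1 = P.dst j ∧ p.2 = P.perm j q.2)

instance PermCSP.decIsEdge (j : Fin m) (p q : Pt nv nd) : Decidable (P.IsEdge j p q) := by
  unfold PermCSP.IsEdge; infer_instance

/-- Steps of the selected cover graph are the selected edges. [folklore] -/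
theorem PermCSP.step_iff (S : Set (Fin m)) (p q : Pt nv nd) :
    P.Step S p q ↔ ∃ j ∈ S, P.IsEdge j p q := by
  constructor
  · intro h
    cases h with
    | fwd j hj a => exact ⟨j, hj, Or.inl ⟨rfl, rfl, rfl⟩⟩
    | bwd j hj a => exact ⟨j, hj, Or.inr ⟨rfl, rfl, rfl⟩⟩
  · rintro ⟨j, hj, h⟩
    obtain ⟨p1, p2⟩ := p
    obtain ⟨q1, q2⟩ := q
    rcases h with ⟨h1, h2, h3⟩ | ⟨h1, h2, h3⟩
    · simp only at h1 h2 h3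
      subst h1 h2 h3
      exact .fwd j hj p2
    · simp only at h1 h2 h3
      subst h1 h2 h3
      exact .bwd j hj q2

/-- The Boolean edge relation of the selection `v`. [folklore] -/
def PermCSP.edgeB (v : Fin m → Bool) (p q : Pt nv nd) : Bool := decide (∃ j, v j = true ∧ P.IsEdge j p q)

/-- It is the step relation of the selected cover graph. [folklore] -/
theorem PermCSP.edgeRel_edgeB (v : Fin m → Bool) :
    edgeRel (P.edgeB v) = P.Step {j | v j = true} := by
  ext p q
  rw [edgeRel, PermCSP.edgeB, decide_eq_true_iff, PermCSP.step_iff]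
  rfl

/-- The monotone UNSAT formula over the relaxation table. [folklore] -/
def PermCSP.badB (v : Fin m → Bool) : Bool :=
  decide (∃ x : Fin nv, ∀ a : Fin nd, ∃ a' : Fin nd,
    relax (P.edgeB v) (Fintype.card (Pt nv nd)) (x, a) (x, a') = true ∧ a' ≠ a)

/-- **The formula decides UNSAT of the selected sub-system.** [folklore] -/
theorem PermCSP.badB_eq_true_iff (v : Fin m → Bool) : P.badB v = true ↔ ¬ P.Sat {j | v j = true} := by
  rw [PermCSP.badB, PermCSP.not_sat_iff_bad, decide_eq_true_iff]
  simp only [PermCSP.Bad, relax_card_iff, PermCSP.edgeRel_edgeB]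
  constructor
  · rintro ⟨x, hx⟩
    refine ⟨x, fun a => ?_⟩
    obtain ⟨a', h1, h2⟩ := hx a
    exact ⟨a', h2, h1⟩
  · rintro ⟨x, hx⟩
    refine ⟨x, fun a => ?_⟩
    obtain ⟨a', h1, h2⟩ := hx a
    exact ⟨a', h2, h1⟩

/-! ### The circuit -/

/-- Wires after the first layer and throughout the iteration: two constants, the edge table, the
relaxation table. [folklore] -/
abbrev St (nv nd : ℕ) : Type := (Unit ⊕ Unit) ⊕ ((Pt nv nd × Pt nv nd) ⊕ (Pt nv nd × Pt nv nd))

/-- The expected wire values after `t` rounds. [folklore] -/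
def PermCSP.expected (t : ℕ) (v : Fin m → Bool) : St nv nd → Bool :=
  Sum.elim (Sum.elim (fun _ => false) (fun _ => true))
    (Sum.elim (fun pq => P.edgeB v pq.1 pq.2) (fun pq => relax (P.edgeB v) t pq.1 pq.2))

/-- One relaxation round on the wires. [folklore] -/
def roundFn (z : St nv nd → Bool) : St nv nd → Bool
  | Sum.inl u => z (Sum.inl u)
  | Sum.inr (Sum.inl pq) => z (Sum.inr (Sum.inl pq))
  | Sum.inr (Sum.inr pq) => z (Sum.inr (Sum.inr pq)) ||
      decide (∃ u : Pt nv nd, z (Sum.inr (Sum.inr (pq.1, u))) = true ∧ z (Sum.inr (Sum.inl (u, pq.2))) = true)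

/-- The round advances the expected values. [folklore] -/
theorem PermCSP.roundFn_expected (t : ℕ) (v : Fin m → Bool) :
    roundFn (P.expected t v) = P.expected (t + 1) v := by
  funext w
  rcases w with u | (pq | pq)
  · rfl
  · rfl
  · simp only [roundFn, PermCSP.expected, Sum.elim_inr, Sum.elim_inl, relax]
    congr 1

/-- Hence `t` rounds from the initial table give the `t`-th table. [folklore] -/
theorem PermCSP.iterate_roundFn_expected (t : ℕ) (v : Fin m → Bool) :
    roundFn^[t] (P.expected 0 v) = P.expected t v := by
  induction t with
  | zero => rfl
  | succ t ih => rw [Function.iterate_succ_apply', ih, PermCSP.roundFn_expected]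

/-- The DNF terms of one relaxed entry `(p, q)`: keep, or go through `u`. [folklore] -/
def roundTerm (pq : Pt nv nd × Pt nv nd) (o : Option (Pt nv nd)) : List (St nv nd) :=
  match o with
  | none => [Sum.inr (Sum.inr pq)]
  | some u => [Sum.inr (Sum.inr (pq.1, u)), Sum.inr (Sum.inl (u, pq.2))]

/-- One round costs `(N²)·((N+1)·4+1)` gates, `N = nv·nd`. [folklore] -/
theorem cktSize_roundFn (nv nd : ℕ) :
    CktSize monotoneBasis01 (roundFn (nv := nv) (nd := nd))
      (0 + (0 + Fintype.card (Pt nv nd × Pt nv nd) * ((Fintype.card (Option (Pt nv nd))) * (2 + 2) + 1))) := by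
  classical
  let e := Fintype.equivFin (Option (Pt nv nd))
  have hrr : ∀ pq : Pt nv nd × Pt nv nd, CktSize monotoneBasis01
      (fun (z : St nv nd → Bool) (_ : Unit) => roundFn z (Sum.inr (Sum.inr pq)))
      ((Fintype.card (Option (Pt nv nd))) * (2 + 2) + 1) := fun pq => by
    refine (cktSize_dnf (fun i => roundTerm pq (e.symm i)) (L := 2) fun i => ?_).congr fun z _ => ?_
    · cases e.symm i <;> simp [roundTerm]
    · simp only [roundFn]
      rw [Bool.eq_iff_iff]
      simp only [decide_eq_true_eq, Bool.or_eq_true]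
      constructor
      · rintro ⟨i, hi⟩
        cases ho : e.symm i with
        | none => rw [ho] at hi; simp [roundTerm] at hi; exact Or.inl hi
        | some u => rw [ho] at hi; simp [roundTerm] at hi; exact Or.inr ⟨u, hi.1, hi.2⟩
      · rintro (h | ⟨u, hu1, hu2⟩)
        · refine ⟨e none, ?_⟩; rw [Equiv.symm_apply_apply]; simp [roundTerm, h]
        · refine ⟨e (some u), ?_⟩; rw [Equiv.symm_apply_apply]; simp [roundTerm, hu1, hu2]
  have h := ((CktSize.proj monotoneBasis01 (fun u : Unit ⊕ Unit => (Sum.inl u : St nv nd))).pair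
    ((CktSize.proj monotoneBasis01 (fun pq : Pt nv nd × Pt nv nd => (Sum.inr (Sum.inl pq) : St nv nd))).pair
      (CktSize.pi_const hrr)))
  refine h.congr fun z w => ?_
  rcases w with u | (pq | pq) <;> rfl

/-- The DNF terms of one edge-table entry: input `j` AND the constant `[IsEdge j p q]`. [folklore] -/
def PermCSP.edgeTerm (pq : Pt nv nd × Pt nv nd) (j : Fin m) : List (Fin m ⊕ (Unit ⊕ Unit)) :=
  [Sum.inl j, if P.IsEdge j pq.1 pq.2 then Sum.inr (Sum.inr ()) else Sum.inr (Sum.inl ())]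

/-- The first layer: constants, edge table, diagonal. [folklore] -/
theorem PermCSP.cktSize_expected_zero :
    CktSize monotoneBasis01 (fun v => P.expected 0 v)
      ((0 + (1 + 1)) + (0 + (Fintype.card (Pt nv nd × Pt nv nd) * (m * (2 + 2) + 1) + 0))) := by
  classical
  -- constants next to the inputs
  have h0 : CktSize monotoneBasis01 (fun (v : Fin m → Bool) =>
      Sum.elim v (Sum.elim (fun _ : Unit => false) (fun _ : Unit => true))) (0 + (1 + 1)) :=
    (CktSize.id monotoneBasis01).pair ((cktSize_const_mono01 _ false).pair (cktSize_const_mono01 _ true))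
  -- edge table as DNFs over (input, constant) pairs
  have hE : ∀ pq : Pt nv nd × Pt nv nd, CktSize monotoneBasis01
      (fun (y : Fin m ⊕ (Unit ⊕ Unit) → Bool) (_ : Unit) =>
        decide (∃ j, (P.edgeTerm pq j).all (fun w => y w) = true)) (m * (2 + 2) + 1) :=
    fun pq => cktSize_dnf (P.edgeTerm pq) fun j => by simp [PermCSP.edgeTerm]
  have h1 := ((CktSize.proj monotoneBasis01 (fun u : Unit ⊕ Unit => (Sum.inr u : Fin m ⊕ (Unit ⊕ Unit)))).pair
    ((CktSize.pi_const hE).pair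
      (CktSize.proj monotoneBasis01 (fun pq : Pt nv nd × Pt nv nd =>
        (if pq.1 = pq.2 then Sum.inr (Sum.inr ()) else Sum.inr (Sum.inl ()) : Fin m ⊕ (Unit ⊕ Unit))))))
  refine (h0.comp h1).congr fun v w => ?_
  rcases w with (u | u) | (pq | pq)
  · rfl
  · rfl
  · -- edge entry
    simp only [Sum.elim_inr, Sum.elim_inl, PermCSP.expected, PermCSP.edgeB]
    apply decide_eq_decide.2  -- both `decide`
    refine exists_congr fun j => ?_
    simp only [PermCSP.edgeTerm, List.all_cons, List.all_nil, Bool.and_true, Bool.and_eq_true, Sum.elim_inl]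
    by_cases h : P.IsEdge j pq.1 pq.2 <;> simp [h]
  · -- diagonal entry
    simp only [Sum.elim_inr, PermCSP.expected, relax]
    by_cases h : pq.1 = pq.2 <;> simp [h]

/-- The output layer: `∃ x, ∀ a, ∃ a', r((x,a),(x,a')) ∧ c(a' ≠ a)` from the final table, where
`c(·)` is the constant wire of that truth value. [folklore] -/
theorem cktSize_output (nv nd : ℕ) :
    CktSize monotoneBasis01 (fun (z : St nv nd → Bool) (_ : Unit) =>
      decide (∃ x : Fin nv, ∀ a : Fin nd, ∃ a' : Fin nd,
        z (Sum.inr (Sum.inr ((x, a), (x, a')))) = true ∧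
          z (if a' ≠ a then Sum.inl (Sum.inr ()) else Sum.inl (Sum.inl ())) = true))
      (Fintype.card (Pt nv nd) * (nd * (2 + 2) + 1) + (nv * (nd + 1) + (nv + 1))) := by
  classical
  -- W(x,a) = ∃ a', r ∧ c(a' ≠ a)
  let wTerm : Pt nv nd → Fin nd → List (St nv nd) := fun xa a' =>
    [Sum.inr (Sum.inr (xa, (xa.1, a'))), if a' ≠ xa.2 then Sum.inl (Sum.inr ()) else Sum.inl (Sum.inl ())]
  have hW : ∀ xa : Pt nv nd, CktSize monotoneBasis01 (fun (z : St nv nd → Bool) (_ : Unit) =>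
      decide (∃ a', (wTerm xa a').all (fun w => z w) = true)) (nd * (2 + 2) + 1) :=
    fun xa => cktSize_dnf (wTerm xa) fun a' => by simp [wTerm]
  have hWall := CktSize.pi_const hW
  -- AND over a, for each x
  have hA : ∀ x : Fin nv, CktSize monotoneBasis01 (fun (w : Pt nv nd → Bool) (_ : Unit) =>
      ((List.finRange nd).map fun a => (x, a)).all (fun xa => w xa)) (nd + 1) := fun x => by
    have := cktSize_bigAnd (κ := Pt nv nd) ((List.finRange nd).map fun a => (x, a))
    simpa using this
  have hAall := CktSize.pi_const hA
  -- OR over x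
  have hO := cktSize_bigOr nv
  have h := (hWall.comp hAall).comp hO
  refine (h.of_le (le_of_eq (by simp only [Fintype.card_prod, Fintype.card_fin]; ring))).congr
    fun z _ => ?_
  rw [Bool.eq_iff_iff, decide_eq_true_iff, decide_eq_true_iff]
  refine exists_congr fun x => ?_
  rw [List.all_eq_true]
  simp only [List.mem_map, List.mem_finRange, true_and, forall_exists_index, forall_apply_eq_imp_iff,
    decide_eq_true_iff]
  refine forall_congr' fun a => exists_congr fun a' => ?_
  simp [wTerm]

/-- **Permutation-constraint gates are polynomial monotone circuits.** UNSAT of the selected sub-system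
of `m` permutation constraints on `nv` variables over a domain of size `nd` is computed by a program over
`{∧₂, ∨₂, 0, 1}` of size `2 + N²(4m+1) + N·N²(4N+5) + N(4·nd+1) + nv(nd+1) + nv + 1`, `N = nv·nd`
(edge table, `N` rounds of relaxation, the formula `∃ x ∀ a ∃ a' ≠ a`). [folklore] -/
theorem PermCSP.cktSize_badB : CktSize monotoneBasis01 (fun v (_ : Unit) => P.badB v)
    (((0 + (1 + 1)) + (0 + (Fintype.card (Pt nv nd × Pt nv nd) * (m * (2 + 2) + 1) + 0))) +
      Fintype.card (Pt nv nd) *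
        (0 + (0 + Fintype.card (Pt nv nd × Pt nv nd) * ((Fintype.card (Option (Pt nv nd))) * (2 + 2) + 1))) +
      (Fintype.card (Pt nv nd) * (nd * (2 + 2) + 1) + (nv * (nd + 1) + (nv + 1)))) := by
  have h := (P.cktSize_expected_zero.comp ((cktSize_roundFn nv nd).iterate (Fintype.card (Pt nv nd)))).comp
    (cktSize_output nv nd)
  refine h.congr fun v _ => ?_
  simp only [PermCSP.iterate_roundFn_expected]
  rw [PermCSP.badB]
  apply decide_eq_decide.2
  refine exists_congr fun x => forall_congr' fun a => exists_congr fun a' => ?_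
  simp only [PermCSP.expected, Sum.elim_inr]
  by_cases h : a' ≠ a <;> simp [h]

/-- The same with a clean polynomial bound `(m + nv + nd + nv·nd + 2)^9`. [folklore] -/
theorem PermCSP.cktSize_badB_poly :
    CktSize monotoneBasis01 (fun v (_ : Unit) => P.badB v) ((m + nv + nd + nv * nd + 2) ^ 9) := by
  refine P.cktSize_badB.of_le ?_
  simp only [Fintype.card_prod, Fintype.card_fin, Fintype.card_option, zero_add, add_zero]
  set N := nv * nd with hN
  set K := m + nv + nd + N + 2 with hK
  have hK2 : 2 ≤ K := by omega
  have hm : m ≤ K := by omega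
  have hnv : nv ≤ K := by omega
  have hnd : nd ≤ K := by omega
  have hNK : N ≤ K := by omega
  have h1 : N * N * (m * (2 + 2) + 1) ≤ K * K * (5 * K) := by
    have : m * (2 + 2) + 1 ≤ 5 * K := by omega
    exact Nat.mul_le_mul (Nat.mul_le_mul hNK hNK) this
  have h2 : N * (N * N * ((N + 1) * (2 + 2) + 1)) ≤ K * (K * K * (7 * K)) := by
    have : (N + 1) * (2 + 2) + 1 ≤ 7 * K := by omega
    exact Nat.mul_le_mul hNK (Nat.mul_le_mul (Nat.mul_le_mul hNK hNK) this)
  have h3 : N * (nd * (2 + 2) + 1) ≤ K * (5 * K) := Nat.mul_le_mul hNK (by omega)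
  have h4 : nv * (nd + 1) ≤ K * (2 * K) := Nat.mul_le_mul hnv (by omega)
  have h5 : nv + 1 ≤ K := by omega
  have hK5 : 20 ≤ K ^ 5 := le_trans (by norm_num) (Nat.pow_le_pow_left hK2 5)
  calc 1 + 1 + N * N * (m * (2 + 2) + 1) + N * (N * N * ((N + 1) * (2 + 2) + 1)) +
        (N * (nd * (2 + 2) + 1) + (nv * (nd + 1) + (nv + 1)))
      ≤ K + K * K * (5 * K) + K * (K * K * (7 * K)) + (K * (5 * K) + (K * (2 * K) + K)) := by
        have : 1 + 1 ≤ K := hK2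
        omega
    _ = 2 * K + 7 * K ^ 2 + 5 * K ^ 3 + 7 * K ^ 4 := by ring
    _ ≤ 2 * K ^ 4 + 7 * K ^ 4 + 5 * K ^ 4 + 7 * K ^ 4 := by
        have a1 : K ≤ K ^ 4 := by
          calc K = K ^ 1 := (pow_one K).symm
            _ ≤ K ^ 4 := Nat.pow_le_pow_right (by omega) (by norm_num)
        have a2 : K ^ 2 ≤ K ^ 4 := Nat.pow_le_pow_right (by omega) (by norm_num)
        have a3 : K ^ 3 ≤ K ^ 4 := Nat.pow_le_pow_right (by omega) (by norm_num)
        omega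
    _ = 21 * K ^ 4 := by ring
    _ ≤ K ^ 5 * K ^ 4 := Nat.mul_le_mul_right _ (le_trans (by norm_num) (Nat.pow_le_pow_left hK2 5))
    _ = K ^ 9 := by rw [← pow_add]

/-- **Corollary (the circuit, for the line's Stub 3b).** The UNSAT function of any menu of permutation
constraints — in particular of every COSET gate all of whose constraint subgroups are graphs of bijections,
over ANY finite group, abelian or not — is computed by a `{∧₂,∨₂,0,1}`-circuit of size
`≤ (m + nv + nd + nv·nd + 2)^9`: no PERM gate is needed for the functional part of the coset stratum.
[folklore] -/
theorem PermCSP.exists_circuit_unsat :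
    ∃ C : Circuit (Fin m), C.IsOver monotoneBasis01 ∧ C.size ≤ (m + nv + nd + nv * nd + 2) ^ 9 ∧
      ∀ v, C.eval v = true ↔ ¬ P.Sat {j | v j = true} := by
  obtain ⟨C, hB, hs, hev⟩ := P.cktSize_badB_poly.toCircuit
  exact ⟨C, hB, hs, fun v => by rw [hev v, PermCSP.badB_eq_true_iff]⟩

end PermCircuit

/-! ## §18 (targets, Stub 3b) The first genuine door-test instance as an object:
`H = ⟨(ρ,ρ²)⟩ ⋊ ⟨(τ,1),(1,τ)⟩ ≤ D₄ × D₄` -/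

section DoorD4

open DihedralGroup

/-- The rotation index of an element of `D₄` (`r i ↦ i`, `sr i ↦ i`; Mathlib: `sr i = s · rⁱ`). [folklore] -/
def rotIdx : DihedralGroup 4 → ZMod 4
  | r i => i
  | sr i => i

/-- The door relation: `rotIdx y = 2 · rotIdx x`, reflection bits free. As a subset of `D₄ × D₄` this is
`H = ⟨(r 1, r 2)⟩ ⋊ ⟨(sr 0, 1), (1, sr 0)⟩` (order 16). [folklore] -/
def DoorRel (p : DihedralGroup 4 × DihedralGroup 4) : Prop := rotIdx p.2 = 2 * rotIdx p.1

instance : DecidablePred DoorRel := fun p => by unfold DoorRel; infer_instance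

/-- It is closed under multiplication (the coupling survives because `2 · 2 = 0` in `ℤ/4`: conjugating
`(ρ, ρ²)` by a reflection in either coordinate stays in `⟨(ρ, ρ²)⟩`). [folklore] -/
theorem doorRel_mul : ∀ p q : DihedralGroup 4 × DihedralGroup 4, DoorRel p → DoorRel q → DoorRel (p * q) := by
  rintro ⟨a, b⟩ ⟨c, d⟩
  cases a <;> cases b <;> cases c <;> cases d <;>
    simp only [DoorRel, Prod.mk_mul_mk, rotIdx, r_mul_r, r_mul_sr, sr_mul_r, sr_mul_sr] <;>
    (rename_i i j k l; revert i j k l; decide)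

/-- `1 ∈ H`. [folklore] -/
theorem doorRel_one : DoorRel 1 := by decide

/-- Inverses. [folklore] -/
theorem doorRel_inv : ∀ p : DihedralGroup 4 × DihedralGroup 4, DoorRel p → DoorRel p⁻¹ := by
  rintro ⟨a, b⟩
  cases a <;> cases b <;> simp only [DoorRel, Prod.inv_mk, rotIdx, inv_r, inv_sr] <;>
    (rename_i i j; revert i j; decide)

/-- **The door subgroup** `H ≤ D₄ × D₄` (order 16; `D₄` nonabelian of order 8, so `IsNonabelianCosetGate`
applies to the gates it generates as soon as `s ≥ 64`). [folklore] -/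
def doorD4 : Subgroup (DihedralGroup 4 × DihedralGroup 4) where
  carrier := {p | DoorRel p}
  mul_mem' := fun {p q} hp hq => doorRel_mul p q hp hq
  one_mem' := doorRel_one
  inv_mem' := fun {p} hp => doorRel_inv p hp

instance : DecidablePred (· ∈ doorD4) := fun p => decidable_of_iff (DoorRel p) Iff.rfl

/-- `|H| = 16`. [folklore] -/
theorem card_doorD4 : (Finset.univ.filter fun p : DihedralGroup 4 × DihedralGroup 4 => p ∈ doorD4).card = 16 := by
  decide

/-- The constraint is RELATIONAL, not functional — `x = 1` allows two values of `y`, `y = 1` four values of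
`x` — so §16–§17 (permutation constraints) do not dispose of it. [folklore] -/
theorem doorD4_not_functional :
    ((1 : DihedralGroup 4), r 0) ∈ doorD4 ∧ ((1 : DihedralGroup 4), sr 0) ∈ doorD4 ∧
      (r 0, (1 : DihedralGroup 4)) ∈ doorD4 ∧ (r 2, (1 : DihedralGroup 4)) ∈ doorD4 ∧
      (sr 0, (1 : DihedralGroup 4)) ∈ doorD4 ∧ (sr 2, (1 : DihedralGroup 4)) ∈ doorD4 := by
  decide

/-- It COUPLES the rotation parts (`(r 1, r 0) ∉ H`) while leaving the reflection bits UNTIED (all four of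
`(r 1, r 2)`, `(r 1, sr 2)`, `(sr 1, r 2)`, `(sr 1, sr 2)` lie in `H`): a 2-torsion coupling `u_y = 2u_x` with
free signs — the configuration that pollutes the double cover of the `S₃` roadmap (§16), hence the first
concrete test for `stub_cosetMeetToJoinNonabelian`. [folklore] -/
theorem doorD4_couples_untied :
    (r 1, r 0) ∉ doorD4 ∧ (r 1, r 2) ∈ doorD4 ∧ (r 1, sr 2) ∈ doorD4 ∧ (sr 1, r 2) ∈ doorD4 ∧
      (sr 1, sr 2) ∈ doorD4 := by
  decide

/-- The ambient group is nonabelian (`r 1 · s ≠ s · r 1`). [folklore] -/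
theorem dihedral4_nonabelian : (r 1 : DihedralGroup 4) * sr 0 ≠ sr 0 * r 1 := by decide

end DoorD4

section DoorGate

open DihedralGroup Literature.Computability.Complexity
open Summit.PneNP.PneNP.Cruxes.Capture.CspSpineMeetToJoin (IsNonabelianCosetGate)

/-- Constraint menu of the door family on `nv` variables: ordered pair of variables and a coset
representative `(c₁, c₂)`; the constraint is `(c₁⁻¹ h x, c₂⁻¹ h y) ∈ H`. [folklore] -/
abbrev DoorIdx (nv : ℕ) : Type := (Fin nv × Fin nv) × (DihedralGroup 4 × DihedralGroup 4)

/-- The selected door system is satisfiable. [folklore] -/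
def DoorSat (nv : ℕ) (v : DoorIdx nv → Bool) : Prop :=
  ∃ h : Fin nv → DihedralGroup 4, ∀ j : DoorIdx nv, v j = true →
    ((j.2.1)⁻¹ * h j.1.1, (j.2.2)⁻¹ * h j.1.2) ∈ doorD4

instance (nv : ℕ) (v : DoorIdx nv → Bool) : Decidable (DoorSat nv v) := by
  unfold DoorSat; infer_instance

/-- **The door gate family**: input `j = ((x,y),(c₁,c₂))` selects the constraint
`(h x, h y) ∈ (c₁,c₂)·H`; the gate fires iff the selected system is UNSATISFIABLE. Arity `64·nv²`.
This is the proposed FIRST TARGET for `stub_cosetMeetToJoinNonabelian`: a polynomial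
`{∧,∨,0,1} ∪ PERM` circuit for `doorGate nv` (or a reason there is none). [folklore] -/
noncomputable def doorGate (nv : ℕ) : GateFn :=
  ⟨Fintype.card (DoorIdx nv), fun v => decide (¬ DoorSat nv (v ∘ Fintype.equivFin (DoorIdx nv)))⟩

/-- The pairing hom `(Fin 2 → G) →* G × G`, `h ↦ (h 0, h 1)`. [folklore] -/
def pairHom (G : Type*) [Group G] : (Fin 2 → G) →* G × G :=
  (Pi.evalMonoidHom (fun _ => G) 0).prod (Pi.evalMonoidHom (fun _ => G) 1)

/-- **The door gates are nonabelian COSET gates of the line** (`IsNonabelianCosetGate s` for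
`s ≥ 64·nv²`, `s ≥ 64`): group `D₄` (order `8`, nonabelian), `nv` variables, every constraint binary with
subgroup `H` pulled back to `Fin 2 → D₄`. So Stub 3b asserts in particular a polynomial
`{∧,∨,0,1} ∪ PERM_{(s+2)^c}` circuit for every `doorGate nv`. [folklore] -/
theorem doorGate_isNonabelianCosetGate (nv s : ℕ) (hs : 64 * nv ^ 2 ≤ s) (hs64 : 64 ≤ s) :
    IsNonabelianCosetGate s (doorGate nv) := by
  classical
  have hcard : Fintype.card (DoorIdx nv) = 64 * nv ^ 2 := by
    simp [DoorIdx, Fintype.card_prod, Fintype.card_fin, DihedralGroup.card]; ring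
  have hnv : nv ≤ s := by
    rcases Nat.eq_zero_or_pos nv with h0 | hpos
    · omega
    · nlinarith
  let e := Fintype.equivFin (DoorIdx nv)
  refine ⟨show Fintype.card (DoorIdx nv) ≤ s from hcard ▸ hs, DihedralGroup 4, inferInstance, inferInstance, nv,
    ⟨r 1, sr 0, dihedral4_nonabelian⟩, by simp [DihedralGroup.card]; omega, hnv,
    fun _ => 2, fun j => ![(e.symm j).1.1, (e.symm j).1.2], fun _ => doorD4.comap (pairHom _),
    fun j => ![(e.symm j).2.1, (e.symm j).2.2], fun _ => by simp [DihedralGroup.card]; omega, fun v => ?_⟩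
  show decide (¬ DoorSat nv (v ∘ e)) = true ↔ _
  rw [decide_eq_true_iff, DoorSat, not_exists, not_exists]
  refine forall_congr' fun h => ?_
  rw [not_iff_not]
  constructor
  · intro H j hj
    have := H (e.symm j) (by simpa using hj)
    simpa [pairHom, Subgroup.mem_comap] using this
  · intro H j hj
    have := H (e j) (by simpa using hj)
    simpa [pairHom, Subgroup.mem_comap] using this

end DoorGate

/-! ## §19 NORMAL FORM: the number of variables is cosmetic in the budget -/

section FewVariables

variable {ι : Type*}

/-- The variables READ by a circuit: input wires of its gates, and its output wire if that is an input.
[folklore] -/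
def readVars [DecidableEq ι] (C : Circuit ι) : Finset ι :=
  ((Finset.univ : Finset (Fin C.gates.length)).biUnion fun j =>
      (Finset.univ : Finset (Fin (C.gates[j]).arity)).biUnion fun a =>
        ((C.gates[j]).args a).getLeft?.toFinset) ∪
    C.output.getLeft?.toFinset

/-- A circuit over `B₂` with `t` gates reads at most `2t + 1` variables. [folklore] -/
theorem card_readVars_le [DecidableEq ι] (C : Circuit ι) (hC : C.IsOver B2) :
    (readVars C).card ≤ 2 * C.size + 1 := by
  unfold readVars
  refine (Finset.card_union_le _ _).trans (add_le_add ?_ (card_toFinset_option_le _))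
  calc ((Finset.univ : Finset (Fin C.gates.length)).biUnion fun j =>
          (Finset.univ : Finset (Fin (C.gates[j]).arity)).biUnion fun a =>
            ((C.gates[j]).args a).getLeft?.toFinset).card
      ≤ ∑ j : Fin C.gates.length, ((Finset.univ : Finset (Fin (C.gates[j]).arity)).biUnion fun a =>
            ((C.gates[j]).args a).getLeft?.toFinset).card := Finset.card_biUnion_le
    _ ≤ ∑ _j : Fin C.gates.length, 2 := Finset.sum_le_sum fun j _ => by
        refine Finset.card_biUnion_le.trans ?_
        calc ∑ a : Fin (C.gates[j]).arity, (((C.gates[j]).args a).getLeft?.toFinset).card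
            ≤ ∑ _a : Fin (C.gates[j]).arity, 1 := Finset.sum_le_sum fun a _ => card_toFinset_option_le _
          _ = (C.gates[j]).arity := by simp
          _ ≤ 2 := hC _ (List.getElem_mem _)
    _ = 2 * C.size := by simp [Circuit.size, mul_comm]

/-- Gate input wires are read variables. [folklore] -/
theorem mem_readVars_of_args [DecidableEq ι] (C : Circuit ι) {j : ℕ} (hj : j < C.gates.length)
    (a : Fin (C.gates[j]).arity) {i : ι} (h : (C.gates[j]).args a = Sum.inl i) : i ∈ readVars C := by
  unfold readVars
  refine Finset.mem_union_left _ (Finset.mem_biUnion.2 ⟨⟨j, hj⟩, Finset.mem_univ _, ?_⟩)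
  refine Finset.mem_biUnion.2 ⟨a, Finset.mem_univ _, ?_⟩
  simp [h]

/-- An input output wire is a read variable. [folklore] -/
theorem mem_readVars_of_output [DecidableEq ι] (C : Circuit ι) {i : ι} (h : C.output = Sum.inl i) :
    i ∈ readVars C := by
  unfold readVars
  refine Finset.mem_union_right _ ?_
  simp [h]

/-- Masking an input outside a set `R` of variables. [folklore] -/
def mask [DecidableEq ι] (R : Finset ι) (x : ι → Bool) : ι → Bool := fun i => if i ∈ R then x i else false

/-- **Locality**: a circuit's gate values only depend on the variables it reads. [folklore] -/
theorem vals_mask [DecidableEq ι] (C : Circuit ι) (x : ι → Bool) :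
    vals C.gates (mask (readVars C) x) = vals C.gates x := by
  -- the prefixes of the gate list read only `readVars`
  suffices ∀ k ≤ C.gates.length, vals (C.gates.take k) (mask (readVars C) x) = vals (C.gates.take k) x by
    simpa using this C.gates.length le_rfl
  intro k
  induction k with
  | zero => intro _; simp
  | succ k ih =>
    intro hk
    have hk' : k < C.gates.length := hk
    rw [List.take_add_one, List.getElem?_eq_getElem hk', Option.toList_some, vals_append_singleton,
      vals_append_singleton, ih hk'.le]
    congr 2
    refine congrArg (C.gates[k]).op (funext fun a => ?_)
    cases h : (C.gates[k]).args a with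
    | inl i =>
      have hi : i ∈ readVars C := mem_readVars_of_args C hk' a h
      simp [mask, hi]
    | inr m => rfl

/-- Hence its value. [folklore] -/
theorem eval_mask [DecidableEq ι] (C : Circuit ι) (x : ι → Bool) :
    C.eval (mask (readVars C) x) = C.eval x := by
  rw [circuit_eval, circuit_eval, vals_mask C x]
  cases h : C.output with
  | inl i =>
    have hi : i ∈ readVars C := mem_readVars_of_output C h
    simp [mask, hi]
  | inr m => rfl

/-- `Capture` with the number of variables DROPPED from the budget. [folklore] -/
def CaptureNoN : Prop :=
  ∃ a : ℕ, ∀ (ι : Type) (_ : Fintype ι) (f : (ι → Bool) → Bool), Monotone f →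
    ∀ C : Circuit ι, C.IsOver B2 → C.Computes f →
      ∃ C' : Circuit ι, C'.IsOver (extGate ((C.size + 2) ^ a)) ∧ C'.size ≤ (C.size + 2) ^ a ∧ C'.Computes f

/-- **NORMAL FORM: the number of variables is cosmetic.** `Capture ↔ CaptureNoN` (the variant whose
budget `(t+2)^a` does not mention `n = |ι|`): a `B₂`-circuit of size `t` reads at most `2t+1` variables
(`card_readVars_le`), its function is determined there (`eval_mask`), so one may capture on
the read variables (`n' ≤ 2t+1`, circuit of size `t+1` after adjoining a constant for the unread ones) and
transport back; `(3t+4)^a ≤ (t+2)^{2a}`. So provers may assume `n ≤ 2t + 1`, and refuters gain nothing from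
padding with dummy variables. [folklore] -/
theorem capture_iff_captureNoN : Capture ↔ CaptureNoN := by
  have hExt : ∀ s : ℕ, ({g : GateFn | g = GateFn.and 2 ∨ g = GateFn.or 2 ∨ IsConvGate s g ∨
      IsPermGate s g ∨ IsGRankGate s g}) = extGate s := fun s => by
    ext g; rw [mem_extGate_iff]; rfl
  unfold Capture CaptureNoN
  simp only []
  constructor
  · rintro ⟨a, h⟩
    refine ⟨2 * a, fun ι _ f hf C hB hC => ?_⟩
    classical
    set R := readVars C with hR
    -- the masked function on the read variables
    let ext : (↥R → Bool) → ι → Bool := fun y i => if hi : i ∈ R then y ⟨i, hi⟩ else false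
    let fR : (↥R → Bool) → Bool := fun y => f (ext y)
    have hfR : Monotone fR := fun y y' hyy' => hf fun i => by
      simp only [ext]
      split_ifs with hi
      · exact hyy' _
      · exact le_rfl
    -- a `B₂`-circuit of size `t + 1` for `fR`: adjoin a constant `0` and rewire
    let e : ι → Option ↥R := fun i => if hi : i ∈ R then some ⟨i, hi⟩ else none
    have h1 : CktSize B2 (fun (y : ↥R → Bool) (o : Option ↥R) => o.elim false fun r => y r) (0 + 1) :=
      (((CktSize.id B2).pair (cktSize_const (↥R) false)).outMap fun o : Option ↥R =>
        o.elim (Sum.inr ()) fun r => Sum.inl r).congr fun y o => by cases o <;> rfl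
    have h2 : CktSize B2 (fun (z : Option ↥R → Bool) (_ : Unit) => C.eval fun i => z (e i)) C.size :=
      (CktSize.ofCircuit C hB).rewire e
    have h3 := h1.comp h2
    obtain ⟨D, hDB, hDs, hDev⟩ := h3.toCircuit
    have hDcomp : D.Computes fR := fun y => by
      rw [hDev y]
      show C.eval (fun i => (e i).elim false fun r => y r) = f (ext y)
      rw [← hC]
      congr 1
      funext i
      simp only [e, ext]
      split_ifs <;> rfl
    -- capture on `↥R`
    obtain ⟨D', hD'B, hD's, hD'c⟩ := h (↥R) inferInstance fR hfR D hDB hDcomp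
    -- transport back along `Subtype.val`
    obtain ⟨C', hC'B, hC's, hC'c⟩ := Circuit.exists_rewire D' hD'B hD'c (Subtype.val : ↥R → ι)
    -- bookkeeping: `(|D| + |R| + 2)^a ≤ (t+2)^(2a)`
    have hcardR : Fintype.card ↥R ≤ 2 * C.size + 1 := by
      rw [Fintype.card_coe]; exact card_readVars_le C hB
    have hbud : (D.size + Fintype.card ↥R + 2) ^ a ≤ (C.size + 2) ^ (2 * a) := by
      rw [pow_mul]
      apply Nat.pow_le_pow_left
      have : D.size ≤ 0 + 1 + C.size := hDs
      nlinarith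
    refine ⟨C', ?_, hC's.trans (hD's.trans hbud), fun x => ?_⟩
    · intro g hg
      have h' : g.fn ∈ extGate ((D.size + Fintype.card ↥R + 2) ^ a) := by
        rw [← hExt]; exact hC'B g hg
      exact extGate_mono hbud h'
    · rw [hC'c x]
      show f (ext fun r => x r.val) = f x
      have hm : ext (fun r => x r.val) = mask R x := by
        funext i
        simp only [ext, mask]
        split_ifs <;> rfl
      rw [hm, ← hC, ← hC x, hR, eval_mask C x]
  · rintro ⟨a, h⟩
    refine ⟨a, fun ι _ f hf C hB hC => ?_⟩
    obtain ⟨C', h1, h2, h3⟩ := h ι inferInstance f hf C hB hC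
    have hle : (C.size + 2) ^ a ≤ (C.size + Fintype.card ι + 2) ^ a := Nat.pow_le_pow_left (by omega) a
    refine ⟨C', ?_, h2.trans hle, h3⟩
    intro g hg
    have h' : g.fn ∈ extGate ((C.size + Fintype.card ι + 2) ^ a) := extGate_mono hle (h1 g hg)
    rw [← hExt] at h'
    exact h'

end FewVariables

/-! ## §20 The algebra behind "LIN-UNSAT = subgroup membership": `ℤ/n` is self-injective, and the
Fredholm alternative over `ℤ/n` (for Stub 2 `stub_cyclicFredholm`, and for §3/§14) -/

section SelfInjective

variable {n : ℕ} [NeZero n]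

/-- Divisibility transfer in `ℤ/n`: if every `r` killing `d` kills `a`, then `a` is a multiple of `d`.
(With `g = gcd(d, n)`: `n/g` kills `d`, hence `a`, so `g ∣ a`, and `g ∈ (d)` by Bézout.) [folklore] -/
theorem ZMod.exists_eq_mul_of_ann_le (d a : ZMod n) (h : ∀ r : ZMod n, r * d = 0 → r * a = 0) :
    ∃ c : ZMod n, a = d * c := by
  obtain ⟨d', rfl⟩ := ZMod.intCast_surjective d
  obtain ⟨a', rfl⟩ := ZMod.intCast_surjective a
  have hn0 : (n : ℤ) ≠ 0 := by exact_mod_cast (NeZero.ne n)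
  set g := Int.gcd d' n with hg
  have hgpos : 0 < g := Int.gcd_pos_of_ne_zero_right _ hn0
  have hgd : (g : ℤ) ∣ d' := Int.gcd_dvd_left _ _
  have hgn : (g : ℤ) ∣ (n : ℤ) := Int.gcd_dvd_right _ _
  obtain ⟨d₁, hd₁⟩ := hgd
  obtain ⟨n₁, hn₁⟩ := hgn
  -- `n₁ = n / g` kills `d`
  have hkill : ((n₁ : ℤ) : ZMod n) * (d' : ZMod n) = 0 := by
    rw [← Int.cast_mul, ZMod.intCast_zmod_eq_zero_iff_dvd]
    refine ⟨d₁, ?_⟩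
    calc n₁ * d' = n₁ * (g * d₁) := by rw [hd₁]
      _ = (g * n₁) * d₁ := by ring
      _ = n * d₁ := by rw [← hn₁]
  have hka := h _ hkill
  rw [← Int.cast_mul, ZMod.intCast_zmod_eq_zero_iff_dvd] at hka
  obtain ⟨q, hq⟩ := hka
  -- so `g ∣ a'`
  have hga : (g : ℤ) ∣ a' := by
    refine ⟨q, ?_⟩
    have h1 : (n₁ : ℤ) * a' = n₁ * (g * q) := by
      calc (n₁ : ℤ) * a' = n * q := hq
        _ = g * n₁ * q := by rw [hn₁]
        _ = n₁ * (g * q) := by ring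
    have hn₁0 : (n₁ : ℤ) ≠ 0 := by
      intro h0
      rw [h0, mul_zero] at hn₁
      exact hn0 hn₁
    exact mul_left_cancel₀ hn₁0 h1
  obtain ⟨a₁, ha₁⟩ := hga
  -- Bézout: `g = d' x + n y`
  have hbez : (g : ℤ) = d' * Int.gcdA d' n + n * Int.gcdB d' n := Int.gcd_eq_gcd_ab d' n
  refine ⟨((Int.gcdA d' n * a₁ : ℤ) : ZMod n), ?_⟩
  rw [← Int.cast_mul, ZMod.intCast_eq_intCast_iff_dvd_sub]
  refine ⟨-(Int.gcdB d' n * a₁), ?_⟩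
  calc d' * (Int.gcdA d' n * a₁) - a' = d' * (Int.gcdA d' n * a₁) - g * a₁ := by rw [ha₁]
    _ = d' * (Int.gcdA d' n * a₁) - (d' * Int.gcdA d' n + n * Int.gcdB d' n) * a₁ := by rw [← hbez]
    _ = n * -(Int.gcdB d' n * a₁) := by ring

/-- `ℤ/n` is a principal ideal ring. [folklore] -/
instance ZMod.isPrincipalIdealRing' : IsPrincipalIdealRing (ZMod n) :=
  IsPrincipalIdealRing.of_surjective (Int.castRingHom (ZMod n)) (ZMod.ringHom_surjective _)

/-- **`ℤ/n` is self-injective** (Baer's criterion: a linear map from the ideal `(d)` sends `d` to a multiple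
`d c` of `d` by `ZMod.exists_eq_mul_of_ann_le`, so `x ↦ x c` extends it). [folklore] -/
theorem ZMod.baer : Module.Baer (ZMod n) (ZMod n) := by
  intro I g
  obtain ⟨d, hd⟩ := (IsPrincipalIdealRing.principal I).principal
  have hdI : d ∈ I := by rw [hd]; exact Ideal.mem_span_singleton_self d
  obtain ⟨c, hc⟩ := ZMod.exists_eq_mul_of_ann_le d (g ⟨d, hdI⟩) fun r hr => by
    have : r • g ⟨d, hdI⟩ = g (r • ⟨d, hdI⟩) := (g.map_smul r _).symm
    rw [smul_eq_mul] at this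
    rw [this]
    have h0 : (r • ⟨d, hdI⟩ : I) = 0 := Subtype.ext (by simpa using hr)
    rw [h0, map_zero]
  refine ⟨c • LinearMap.id, fun x hx => ?_⟩
  rw [hd] at hx
  obtain ⟨s, rfl⟩ := Ideal.mem_span_singleton'.1 hx
  have : g ⟨s * d, hd ▸ Ideal.mem_span_singleton'.2 ⟨s, rfl⟩⟩ = s • g ⟨d, hdI⟩ := by
    rw [← g.map_smul]; congr 1
  simp only [LinearMap.smul_apply, LinearMap.id_apply, smul_eq_mul]
  rw [this, smul_eq_mul, hc]
  ring

/-- `ℤ/n` is an injective `ℤ/n`-module. [folklore] -/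
theorem ZMod.selfInjective : Module.Injective (ZMod n) (ZMod n) := ZMod.baer.injective

/-- **Every nonzero element of a `ℤ/n`-module is detected by a linear functional.** [folklore] -/
theorem ZMod.exists_linearMap_apply_ne_zero {Q : Type*} [AddCommGroup Q] [Module (ZMod n) Q] {q : Q}
    (hq : q ≠ 0) : ∃ φ : Q →ₗ[ZMod n] ZMod n, φ q ≠ 0 := by
  classical
  let τ : ZMod n →ₗ[ZMod n] Q := LinearMap.toSpanSingleton (ZMod n) Q q
  -- the annihilator of `q` is a proper principal ideal `(e)`
  obtain ⟨e, he⟩ := (IsPrincipalIdealRing.principal (LinearMap.ker τ)).principal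
  have hτ1 : τ 1 = q := by simp [τ]
  -- a functional on `ℤ/n` killing `(e)` but not `1`
  obtain ⟨w, hwe, hw1⟩ : ∃ w : ZMod n, e * w = 0 ∧ w ≠ 0 := by
    -- `e` is not a unit (else `q = 0`), so `gcd(e, n) > 1` and `w = n / gcd` works
    obtain ⟨e', rfl⟩ := ZMod.intCast_surjective e
    have hn0 : (n : ℤ) ≠ 0 := by exact_mod_cast (NeZero.ne n)
    set g := Int.gcd e' n with hg
    obtain ⟨e₁, he₁⟩ : (g : ℤ) ∣ e' := Int.gcd_dvd_left _ _
    obtain ⟨n₁, hn₁⟩ : (g : ℤ) ∣ (n : ℤ) := Int.gcd_dvd_right _ _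
    refine ⟨((n₁ : ℤ) : ZMod n), ?_, ?_⟩
    · rw [← Int.cast_mul, ZMod.intCast_zmod_eq_zero_iff_dvd]
      refine ⟨e₁, ?_⟩
      calc e' * n₁ = g * e₁ * n₁ := by rw [he₁]
        _ = g * n₁ * e₁ := by ring
        _ = n * e₁ := by rw [← hn₁]
    · intro hw0
      rw [ZMod.intCast_zmod_eq_zero_iff_dvd] at hw0
      -- `n ∣ n₁` with `n = g n₁` forces `g = 1`, i.e. `e` a unit, i.e. `q = 0`
      obtain ⟨k, hk⟩ := hw0
      have hn₁0 : (n₁ : ℤ) ≠ 0 := by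
        intro h0; rw [h0, mul_zero] at hn₁; exact hn0 hn₁
      have hgk : (g : ℤ) * k = 1 := by
        have : (n₁ : ℤ) * 1 = n₁ * (g * k) := by
          calc (n₁ : ℤ) * 1 = n₁ := mul_one _
            _ = n * k := hk
            _ = g * n₁ * k := by rw [hn₁]
            _ = n₁ * (g * k) := by ring
        exact (mul_left_cancel₀ hn₁0 this).symm
      have hg1 : (g : ℤ) = 1 := by
        have := Int.eq_one_of_mul_eq_one_right (by positivity) hgk
        exact this
      -- Bézout: `1 = e' x + n y`, so `e` is a unit in `ℤ/n` and kills `q`: `q = 0`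
      have hbez : (g : ℤ) = e' * Int.gcdA e' n + n * Int.gcdB e' n := Int.gcd_eq_gcd_ab e' n
      have hunit : (e' : ZMod n) * (Int.gcdA e' n : ZMod n) = 1 := by
        rw [← Int.cast_mul, ← Int.cast_one, ZMod.intCast_eq_intCast_iff_dvd_sub]
        exact ⟨Int.gcdB e' n, by rw [hg1] at hbez; linear_combination hbez⟩
      have heker : (e' : ZMod n) ∈ LinearMap.ker τ := by rw [he]; exact Ideal.mem_span_singleton_self _
      have h1ker : (1 : ZMod n) ∈ LinearMap.ker τ := by
        rw [← hunit, mul_comm]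
        rw [he] at heker ⊢
        exact Ideal.mul_mem_left _ _ heker
      rw [LinearMap.mem_ker, hτ1] at h1ker
      exact hq h1ker
  let ψ₀ : ZMod n →ₗ[ZMod n] ZMod n := w • LinearMap.id
  have hK : LinearMap.ker τ ≤ LinearMap.ker ψ₀ := by
    intro r hr
    rw [he] at hr
    obtain ⟨s, rfl⟩ := Ideal.mem_span_singleton'.1 hr
    rw [LinearMap.mem_ker]
    simp only [ψ₀, LinearMap.smul_apply, LinearMap.id_apply, smul_eq_mul]
    calc w * (s * e) = s * (e * w) := by ring
      _ = 0 := by rw [hwe, mul_zero]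
  -- descend to `range τ = span {q}` and extend to `Q` by self-injectivity
  let ψ : LinearMap.range τ →ₗ[ZMod n] ZMod n := (LinearMap.ker τ).liftQ ψ₀ hK ∘ₗ τ.quotKerEquivRange.symm
  obtain ⟨φ, hφ⟩ := ZMod.baer.extension_property (LinearMap.range τ).subtype
    (LinearMap.range τ).injective_subtype ψ
  refine ⟨φ, ?_⟩
  have hqmem : q ∈ LinearMap.range τ := ⟨1, hτ1⟩
  have h1 : φ q = ψ ⟨q, hqmem⟩ := by
    have := LinearMap.congr_fun hφ ⟨q, hqmem⟩
    simpa using this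
  have h2 : ψ ⟨q, hqmem⟩ = w := by
    simp only [ψ, LinearMap.coe_comp, Function.comp_apply, LinearEquiv.coe_coe]
    have h3 : τ.quotKerEquivRange.symm ⟨q, hqmem⟩ = (LinearMap.ker τ).mkQ 1 := by
      have := LinearMap.quotKerEquivRange_symm_apply_image τ 1 (LinearMap.mem_range_self τ 1)
      convert this using 3
      exact hτ1.symm
    rw [h3, Submodule.mkQ_apply, Submodule.liftQ_apply]
    simp [ψ₀]
  rw [h1, h2]
  exact hw1

end SelfInjective

section Fredholm

variable {n : ℕ} [NeZero n] {m D : Type*} [Fintype m] [Fintype D] [DecidableEq m] [DecidableEq D]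

/-- **Fredholm alternative over `ℤ/n`.** A linear system `A y = b` over `ℤ/n` is unsolvable iff some row
combination `z` kills `A` but not `b` (`ℤ/n` is self-injective, so `b ∉ Col(A)` is detected by a functional
on `(ℤ/n)^m ⧸ Col(A)`). The certificate form is exactly what a PERM gate over the regular representation of
`(ℤ/n)^{D+1}` tests: `(0,…,0,c) ∈ ⟨selected augmented rows⟩` for some `c ≠ 0`. [folklore] -/
theorem ZMod.not_exists_mulVec_eq_iff (A : Matrix m D (ZMod n)) (b : m → ZMod n) :
    (¬ ∃ y : D → ZMod n, A.mulVec y = b) ↔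
      ∃ z : m → ZMod n, Matrix.vecMul z A = 0 ∧ z ⬝ᵥ b ≠ 0 := by
  constructor
  · intro hb
    -- `b ∉ N := range A`; detect its class in the quotient
    let N : Submodule (ZMod n) (m → ZMod n) := LinearMap.range A.mulVecLin
    have hbN : b ∉ N := fun ⟨y, hy⟩ => hb ⟨y, by simpa using hy⟩
    have hq : (Submodule.Quotient.mk b : (m → ZMod n) ⧸ N) ≠ 0 := by
      rwa [Ne, Submodule.Quotient.mk_eq_zero]
    obtain ⟨φ, hφ⟩ := ZMod.exists_linearMap_apply_ne_zero (n := n) hq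
    let Φ : (m → ZMod n) →ₗ[ZMod n] ZMod n := φ ∘ₗ N.mkQ
    refine ⟨fun i => Φ (Pi.single i 1), ?_, ?_⟩
    · -- each column of `A` lies in `N`
      ext j
      simp only [Matrix.vecMul, dotProduct, Pi.zero_apply]
      have hcol : Φ (fun i => A i j) = 0 := by
        have hmem : (fun i => A i j) ∈ N := ⟨Pi.single j 1, by ext i; simp [Matrix.mulVec, dotProduct, Pi.single_apply]⟩
        simp only [Φ, LinearMap.coe_comp, Function.comp_apply, Submodule.mkQ_apply]
        rw [(Submodule.Quotient.mk_eq_zero N).2 hmem, map_zero]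
      have hlin : Φ (fun i => A i j) = ∑ i, A i j * Φ (Pi.single i 1) := by
        conv_lhs => rw [show (fun i => A i j) = ∑ i, A i j • (Pi.single i 1 : m → ZMod n) from by
          ext i; simp [Finset.sum_apply, Pi.single_apply]]
        rw [map_sum]
        simp [smul_eq_mul]
      rw [← hcol, hlin]
      exact Finset.sum_congr rfl fun i _ => mul_comm _ _
    · have hlin : Φ b = ∑ i, b i * Φ (Pi.single i 1) := by
        conv_lhs => rw [show b = ∑ i, b i • (Pi.single i 1 : m → ZMod n) from by
          ext i; simp [Finset.sum_apply, Pi.single_apply]]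
        rw [map_sum]
        simp [smul_eq_mul]
      have : (fun i => Φ (Pi.single i 1)) ⬝ᵥ b = Φ b := by
        rw [hlin, dotProduct]
        exact Finset.sum_congr rfl fun i _ => mul_comm _ _
      rw [this]
      simpa [Φ] using hφ
  · rintro ⟨z, hzA, hzb⟩ ⟨y, rfl⟩
    apply hzb
    rw [Matrix.dotProduct_mulVec, hzA, zero_dotProduct]

end Fredholm

section LinGate

variable {N D m : ℕ} [NeZero m]

/-- **LIN-UNSAT is span membership** (the form a PERM gate tests): the selected affine system
`{a j · y = b j : v j = 1}` over `ℤ/m` is unsolvable iff `(0, c)` lies in the `ℤ/m`-span of the selected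
augmented rows `(a j, b j)` for some `c ≠ 0` (Fredholm alternative, `ZMod.not_exists_mulVec_eq_iff`). For
`m = p^k` one may normalise `c = p^{k-1}`; for the PERM gate an `∨` over the `m - 1` targets `(0, c)` suffices.
[folklore] -/
theorem linUnsat_iff_exists_mem_span (a : Fin N → Fin D → ZMod m) (b : Fin N → ZMod m) (v : Fin N → Bool) :
    (¬ ∃ y : Fin D → ZMod m, ∀ j, v j = true → a j ⬝ᵥ y = b j) ↔
      ∃ c : ZMod m, c ≠ 0 ∧ ((0 : Fin D → ZMod m), c) ∈
        Submodule.span (ZMod m) (Set.range fun j : {j : Fin N // v j = true} => (a j.1, b j.1)) := by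
  classical
  -- the selected rows as a matrix
  let A : Matrix {j : Fin N // v j = true} (Fin D) (ZMod m) := Matrix.of fun j i => a j.1 i
  let bv : {j : Fin N // v j = true} → ZMod m := fun j => b j.1
  have hsys : (∃ y : Fin D → ZMod m, ∀ j, v j = true → a j ⬝ᵥ y = b j) ↔ ∃ y, A.mulVec y = bv := by
    refine exists_congr fun y => ⟨fun h => funext fun j => h j.1 j.2, fun h j hj => ?_⟩
    exact congr_fun h ⟨j, hj⟩
  rw [hsys, ZMod.not_exists_mulVec_eq_iff]
  constructor
  · rintro ⟨z, hzA, hzb⟩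
    refine ⟨z ⬝ᵥ bv, hzb, ?_⟩
    rw [Submodule.mem_span_range_iff_exists_fun]
    refine ⟨z, ?_⟩
    ext i
    · simp only [Prod.fst_sum, Prod.smul_fst, Finset.sum_apply, Pi.smul_apply, smul_eq_mul, Pi.zero_apply]
      have := congr_fun hzA i
      simpa [Matrix.vecMul, dotProduct, A] using this
    · simp [Prod.snd_sum, dotProduct, bv]
  · rintro ⟨c, hc, hmem⟩
    rw [Submodule.mem_span_range_iff_exists_fun] at hmem
    obtain ⟨z, hz⟩ := hmem
    refine ⟨z, ?_, ?_⟩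
    · ext i
      have := congr_arg (fun p => p.1 i) hz
      simpa [Prod.fst_sum, Matrix.vecMul, dotProduct, A] using this
    · have := congr_arg Prod.snd hz
      simp only [Prod.snd_sum, Prod.smul_snd, smul_eq_mul] at this
      rw [show z ⬝ᵥ bv = c from this]
      exact hc

omit [NeZero m] in
/-- Over `ℤ/m`, spans are generated subgroups (so the membership above is literally a PERM-gate condition in
the regular representation of `(ℤ/m)^{D+1}`). [folklore] -/
theorem span_zmod_eq_closure {M : Type*} [AddCommGroup M] [Module (ZMod m) M] (s : Set M) :
    ((Submodule.span (ZMod m) s).toAddSubgroup : Set M) = AddSubgroup.closure s := by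
  apply le_antisymm
  · intro x hx
    have hle : Submodule.span (ZMod m) s ≤ AddSubgroup.toZModSubmodule m (AddSubgroup.closure s) :=
      Submodule.span_le.2 fun y hy => AddSubgroup.subset_closure hy
    exact hle hx
  · exact (AddSubgroup.closure_le ((Submodule.span (ZMod m) s).toAddSubgroup)).2
      (fun y hy => Submodule.subset_span hy)

end LinGate

end Summit.PneNP.PneNP.Cruxes.Capture.Disproof
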